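import Literature.InformationTheory.QuantumCodes.TwoBlockGADoubleCosets
import Literature.InformationTheory.QuantumCodes.CheckWeightThreeDistanceBound
import Mathlib.GroupTheory.SpecificGroups.Alternating
import HarnessLib

/-!
# Lin–Pryadko 2024 Statement 8 beyond disjoint supports: the identity-double-coset subcode of `LP[a,b]`
# is a 2BGA code over any CENTRAL AMALGAM of `G_a` and `G_b`; the printed triple group law needs `N` central

[LinPryadko2024, §IV.C Statement 8] (held text arXiv:2306.16400 chunk p0010 L58–63): "If the intersection
subgroup `N ≡ G_a ∩ G_b` is abelian and normal in both support groups, the subcode of `LP[a,b]` supported in the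
double-coset `G_a1G_b` is equivalent to a 2BGA code over a group `G'` of rank `|G_a 1 G_b|`." The printed proof
(App. VIII.B, chunk p0018 L65–100) takes for `G'` the triples `(α,γ,β)`, `α ∈ G_a`, `γ ∈ N`, `β ∈ G_b`, "with
all triplets in the form `(αx, x⁻¹γy⁻¹, yβ)`, `x,y ∈ N` united into product-preserving equivalence classes.
The group product is defined as `(α₁,γ₁,β₁)·(α₂,γ₂,β₂) = (α₁α₂, α₂⁻¹γ₁α₂ β₁γ₂β₁⁻¹, β₁β₂)`, where the
elements from `H_a` and `H_b` are forced to commute, and the abelian property of `N` is used to ensure the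
consistency of the definition. It is easy to verify the group axioms".

This file records, kernel-checked:

* **§A (the printed law needs more than "abelian and normal")** — `PrintedTripleLaw.mul`, `PrintedTripleLaw.Rel`
  are the printed product and equivalence verbatim; `PrintedTripleLaw.toGroup (α,γ,β) = αγβ` is constant on
  classes (`toGroup_eq_of_rel`); and **`PrintedTripleLaw.not_wellDefined_S3`**: for `G_a = S₃ ⊇ N = A₃ = G_b`
  (`N` abelian, normal in both — `A3_comm`, Mathlib's `alternatingGroup.normal`) the triples `(1,1,1) ~ (1,c⁻¹,c)`
  are equivalent but their products with `(τ,1,1)` lie in DIFFERENT classes (`τ` vs `τc²`), so the printed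
  product is not a function on the stated classes. Replacing `(α₁,γ₁,β₁)` by an equivalent triple changes the
  middle entry of the product by `α₂⁻¹y⁻¹α₂ · y`, which is `1` for all `y ∈ N` iff `α₂` CENTRALISES `N`: the
  construction is consistent exactly when `N` is central in `G_a` and in `G_b` (then `G'` is the central
  product `G_a ∘_N G_b`). We exhibit no failure of Statement 8 ITSELF (for `G = G_aG_b` it holds with `G' = G`);
  this is a proof-gap report in the class of FINDINGS E-8/E-13, not an erratum on a code parameter.
* **§B (Statement 8, central-amalgam form, PROVED for every finite group)** — `TwoBlockGA.IsCentralAmalgam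
  G_a G_b ιa ιb`: a group `G'` with homomorphisms `ιa : G_a → G'`, `ιb : G_b → G'` whose images commute
  (`comm` — "forced to commute"), glued exactly along `G_a ∩ G_b` (`glue : ιa α · ιb β = 1 ↔ αβ = 1 in G`) and
  generating (`surj`). Consequences: `ιa`, `ιb` injective and equal on `N` (`agree`), **`N` central in `G_a`
  and `G_b`** (`central_left/right` — so the hypotheses are satisfiable only in the central case), the fibres of
  `(α,β) ↦ ιa α · ιb β` are those of `(α,β) ↦ αβ` (`eq_iff`), whence a bijection **`dcEquiv : G' ≃ G_a1G_b`**
  with `ιa α ιb β ↦ αβ`. Main theorem **`HX_eq_submatrix_dcSubcode_one` / `HZ_…`**: along `dcEquiv` the check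
  matrices of the 2BGA code `LP[a', b']` over `G'` (`a' = pushLeft ιa a`, `b' = pushRight ιb b`, the coefficient
  vectors transported along `ιa`, `ιb`) ARE those of the identity-double-coset subcode of `LP[a,b]`
  (`TwoBlockGADoubleCosets.dcSubcode`), hence **`LinPryadko2024_statement8_central`** (equal `d^X`, `d^Z`, `k`)
  and `LinPryadko2024_statement8_central_isCode_iff`. Instances: **`isCentralAmalgam_prod`** (`N = {1}`,
  `G' = G_a × G_b`, `pushLeft = prodInl`: the hypergraph-product case of `TwoBlockGADisjointSupports.lean` /
  `dcSubcode_one_isCode_of_disjoint`) and **`isCentralAmalgam_sup`** (`G_a`, `G_b` commuting elementwise inside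
  `G`, e.g. `G` abelian: `G' = G_a ⊔ G_b ≤ G`, cf. `AbelianTwoBlockQuasiAbelianLP.lean`).

* **§C (the central product exists and is unique)** — `TwoBlockGA.CentralProduct G_a G_b := (G_a × G_b) ⧸
  normalClosure {(α,β) : αβ = 1}` with `cpInl`, `cpInr`; for `N` central in both factors the antidiagonal
  `{(n,n⁻¹)}` is already a normal subgroup (`antidiagSubgroup`, `antidiagSubgroup_normal`,
  `normalClosure_antidiag_eq`), and **`isCentralAmalgam_centralProduct`** (`_iff`: a central amalgam exists iff
  `N` is central in both); hence **`LinPryadko2024_statement8_of_central`** (+`_isCode_iff`, `card_centralProduct`):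
  Statement 8 with the explicit `G' = G_a ∘_N G_b` for every pair of support groups with central intersection.
  **`IsCentralAmalgam.mulEquiv`** (`compare`, `compare_comp_left/right`, `compare_bijective`): any two central
  amalgams are isomorphic over `G_a`, `G_b` — the `G'` of Statement 8 is unique.
* **§D (exact amalgams: Statement 8 without "forced to commute")** — `TwoBlockGA.IsAmalgam` keeps only `glue`
  and `surj`; the fibre condition, the bijection `G' ≃ G_a1G_b` and the check-matrix identities survive (the
  entries are evaluated by the sandwich criteria `exists_left/right_sandwich_iff` instead of commutation), so
  **`LinPryadko2024_statement8_amalgam`** (+`_isCode_iff`) holds for every exact amalgam. New instances need NO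
  hypothesis on `N`: `isAmalgam_inclusion` / `isAmalgam_sup_of_le_normalizer(')` / `isAmalgam_subtype` (the
  product set `G_aG_b` is a subgroup of `G`, e.g. one support group normalises the other, or `G = G_aG_b`),
  whence **`LinPryadko2024_statement8_of_subgroup`** with `G' = G_aG_b ≤ G` and `a' = a|_H`, `b' = b|_H`
  (`pushLeft/Right_inclusion_apply`). What remains unproved, in print and here, is the printed case "`N` abelian
  and normal in both" with `N` not central and `G_aG_b` not a subgroup: it requires a group of order
  `|G_a||G_b|/|N|` factorising exactly as `G_a·G_b` over `N`, which App. VIII.B does not supply (§A).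

* **§E (a printed-hypothesis pair with NO exact amalgam)** — `SylowS4.Ga = C_{S₄}((02)(13))`,
  `SylowS4.Gb = C_{S₄}((01)(23))` (two Sylow `2`-subgroups of `S₄`): `N = G_a ∩ G_b = V₄` (`mem_inter_iff`) is
  abelian (`inter_comm`) and normal in both (`inter_normal_left/right`) — the printed hypotheses — but not
  central (`inter_not_central`), `G_aG_b` is not a subgroup (`sq_not_mem_prod`), and
  **`SylowS4.not_isAmalgam`**: NO group `G'` with homomorphisms `G_a → G' ← G_b` is an exact amalgam (a
  fortiori no central amalgam, `not_isCentralAmalgam`). So for this pair Statement 8's `G'` cannot be produced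
  by the printed construction or by any amalgam whatsoever; whether the `G_a1G_b`-subcode is nonetheless
  equivalent to a 2BGA code of order `16` by an unstructured coincidence is left open here. §E′ makes the
  printed data literal: `SylowS4.aS`, `SylowS4.bS ∈ 𝔽₂[S₄]` with SUPPORT GROUPS exactly `G_a`, `G_b`
  (`suppGroup_aS`, `suppGroup_bS`, `statement8_hypotheses_no_amalgam`).
* **§F (kernel certificate: the printed CONCLUSION holds for the §E pair — through an ABELIAN `G′`)** —
  ★★ **`SylowS4.statement8_instance_abelian`**: the `G_a1G_b`-subcode of `LP[a,b]` (`a = aS`, `b = bS`) has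
  the `k`, `d^X`, `d^Z` of the abelian 2BGA code `LP[a′,b′] = TwoBlockGA.css aP bP` over
  `G′ = ℤ₄×ℤ₂×ℤ₂` (`|G′| = 16 = |G_a1G_b|`, `card_G16`, `card_dc_one`); in fact the two codes have THE SAME
  stabiliser spaces after an explicit relabelling of checks and qubits (`S16_HX/HZ`, `C16_HX/HZ`,
  `rowSpace_S16_eq_C16`: literal tables `dTab`, `qTabL/R`, `aTab/bTab`, change-of-basis matrices `uX,vX,uZ,vZ`,
  all by `decide`), i.e. they are permutation-equivalent — although by §E no amalgam of `G_a`, `G_b` exists.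
  General transport lemma `CSSCode.params_eq_of_rowSpace_eq` (same row spaces ⇒ same `k`, `d^X`, `d^Z`).
  (Found by a search over the semiregular abelian subgroups of the subcode's automorphism group; numerically
  the code is `[[32,8,4]]`, not claimed here.)
* **§G (the general obstruction behind §E)** — `IsAmalgam.exists_conj_swap`: in an exact amalgam, when
  `N`-elements are conjugated into `N` by both support groups (the printed "normal in both"), for every
  `α ∈ G_a`, `β ∈ G_b` some `α′ ∈ G_a`, `β′ ∈ G_b` satisfy `β(αnα⁻¹)β⁻¹ = α′(β′nβ′⁻¹)α′⁻¹` on `N` — the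
  conjugation images `θ_a(G_a)θ_b(G_b) ⊆ Aut(N)` must absorb reversed products; violated by two distinct
  transpositions of `V₄ ∖ {1}` (§E).
* **§H (dimension)** — rank certificates (`decide`) give `rank H_X = rank H_Z = 12` for `S16`, hence
  **`SylowS4.statement8_instance_k`**: the `G_a1G_b`-subcode and `LP[a′,b′]` both have `k = 8` (`n = 32`).
* **§I (distance)** — syndrome certificates (`decide`: no `1`, `2` or `3` columns of `H_X`, resp. `H_Z`, of `S16`
  sum to zero) and weight-4 logicals with anticommuting witnesses give `S16_dZ = 4`, `S16_dX = 4`,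
  `S16_isCode : [[32,8,4]]`, hence ★★ **`SylowS4.statement8_instance_isCode`**: the `G_a1G_b`-subcode of
  `LP[a,b]` over `S₄` AND the abelian `LP[a′,b′]` over `ℤ₄×ℤ₂×ℤ₂` are both `[[32, 8, 4]]` codes
  (`CSSCode.IsCode 32 8 4`).

All statements proved (no named facts, no instances, no `sorry`).

## References (locators read on the page via `lit read arxiv:2306.16400`, held corpus-tex copy)

* [LinPryadko2024] H.-K. Lin, L. P. Pryadko, *Quantum two-block group algebra codes*, Phys. Rev. A 109 (2024)
  022407 = arXiv:2306.16400: §IV.C Statement 8 (chunk p0010 L58–63) and the remark after it (L64–78, `G' =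
  G_a × G_b` for disjoint subgroups); App. VIII.B proof of Statement 8 (chunk p0018 L65–100: `G_a = H_a ⋊ N`,
  triples, "product-preserving equivalence classes", the displayed product, "the abelian property of N is used
  to ensure the consistency of the definition. It is easy to verify the group axioms"); §IV.F (label
  `sec:special-central`, p0011 L84–95: "such codes can be seen as F-linear quasi-abelian LP codes").
* Evidence outside the kernel (same example, all 36 class pairs): qec HOME `lit/evidence/lp24_statement8_grouplaw_lit3g7.py`
  (sha16 53b5510b16a127f4; output a1d19cb80b1db3c1: 18 of 36 class pairs ill-defined; 0 of 9 once `α ∈ A₃`).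
-/

namespace Literature.InformationTheory.QuantumCodes

open Matrix

namespace TwoBlockGA

/-! ## §A. The printed triple product is not well defined on the printed classes (`G_a = S₃ ⊇ A₃ = N = G_b`) -/

namespace PrintedTripleLaw

variable {G : Type*} [Group G]

/-- The printed product of triples `(α₁,γ₁,β₁)·(α₂,γ₂,β₂) = (α₁α₂, α₂⁻¹γ₁α₂·β₁γ₂β₁⁻¹, β₁β₂)`.
[cite: LinPryadko2024, App. VIII.B proof of Statement 8, displayed group product (arXiv:2306.16400 chunk p0018 L84–88)] -/
def mul (t₁ t₂ : G × G × G) : G × G × G :=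
  (t₁.1 * t₂.1, t₂.1⁻¹ * t₁.2.1 * t₂.1 * (t₁.2.2 * t₂.2.1 * t₁.2.2⁻¹), t₁.2.2 * t₂.2.2)

/-- The printed equivalence: `(α,γ,β) ~ (αx, x⁻¹γy⁻¹, yβ)` for `x, y ∈ N`.
[cite: LinPryadko2024, App. VIII.B "with all triplets in the form (αx, x⁻¹γy⁻¹, yβ), x,y ∈ N united into product-preserving equivalence classes" (arXiv:2306.16400 chunk p0018 L79–83)] -/
def Rel (N : Subgroup G) (t t' : G × G × G) : Prop :=
  ∃ x ∈ N, ∃ y ∈ N, t'.1 = t.1 * x ∧ t'.2.1 = x⁻¹ * t.2.1 * y⁻¹ ∧ t'.2.2 = y * t.2.2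

/-- The class invariant `(α,γ,β) ↦ αγβ ∈ G` ("product-preserving equivalence classes": a triple stands for the
group element `αγβ` of the double coset `G_a1G_b`). [cite: LinPryadko2024, App. VIII.B "any element of the double coset G_a 1 G_b can be written as a triplet, (α,γ,β)" (arXiv:2306.16400 chunk p0018 L79–81)] -/
def toGroup (t : G × G × G) : G := t.1 * t.2.1 * t.2.2

/-- Equivalent triples stand for the same group element. [cite: LinPryadko2024, App. VIII.B (arXiv:2306.16400 chunk p0018 L79–83)] -/
theorem toGroup_eq_of_rel {N : Subgroup G} {t t' : G × G × G} (h : Rel N t t') : toGroup t' = toGroup t := by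
  obtain ⟨x, -, y, -, h1, h2, h3⟩ := h
  simp only [toGroup, h1, h2, h3]
  group

/-- Conversely two triples with the same `α γ β` and `α`'s in one `N`-coset, `β`'s in one `N`-coset are
equivalent; in particular the classes are the fibres of `toGroup` over `G_a1G_b`. We only need the easy direction
above and this special case: `(1,1,1) ~ (1, c⁻¹, c)` for `c ∈ N`. [cite: LinPryadko2024, App. VIII.B (arXiv:2306.16400 chunk p0018 L79–83)] -/
theorem rel_one_conj {N : Subgroup G} {c : G} (hc : c ∈ N) : Rel N ((1 : G), (1 : G), (1 : G)) (1, c⁻¹, c) :=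
  ⟨1, N.one_mem, c, hc, by simp, by simp, by simp⟩

/-- **If the printed product were a function of the classes, replacing the first factor by an equivalent triple
would not change the class of the product.** With `(1,1,1) ~ (1,c⁻¹,c)` and second factor `(τ,1,1)` the two
products stand for `τ` and `τ·(τ⁻¹c⁻¹τ)·c`; these agree iff `τ⁻¹c⁻¹τ = c⁻¹`, i.e. iff `τ` commutes with `c`.
[cite: LinPryadko2024, App. VIII.B "the abelian property of N is used to ensure the consistency of the definition" (arXiv:2306.16400 chunk p0018 L88–90)] -/
theorem toGroup_mul_one_conj (c τ : G) :
    toGroup (mul ((1 : G), c⁻¹, c) (τ, 1, 1)) = τ * (τ⁻¹ * c⁻¹ * τ) * c ∧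
      toGroup (mul ((1 : G), (1 : G), (1 : G)) (τ, 1, 1)) = τ := by
  constructor <;> (simp only [toGroup, mul]; group)

open Equiv in
/-- The 3-cycle `c = (0 1 2)` and the transposition `τ = (0 1)` of `S₃ = Perm (Fin 3)`.
[cite: LinPryadko2024, App. VIII.B (arXiv:2306.16400 chunk p0018 L65–100) — test data, not in the source] -/
def c3 : Perm (Fin 3) := swap 0 2 * swap 0 1

open Equiv in
/-- The transposition `τ = (0 1)`. [cite: LinPryadko2024, App. VIII.B (arXiv:2306.16400 chunk p0018 L65–100) — test data, not in the source] -/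
def tau : Perm (Fin 3) := swap 0 1

open Equiv in
/-- `c ∈ A₃`. [cite: LinPryadko2024, §IV.C Statement 8 hypothesis "N abelian and normal in both support groups" (arXiv:2306.16400 chunk p0010 L58–60)] -/
theorem c3_mem : c3 ∈ alternatingGroup (Fin 3) := Perm.mem_alternatingGroup.mpr (by decide)

open Equiv in
/-- `N = A₃` is abelian (it is normal in `S₃ = G_a` by Mathlib's `alternatingGroup.normal`, and normal in
`G_b = A₃` trivially): the hypotheses of Statement 8 hold for `G_a = S₃`, `G_b = N = A₃`.
[cite: LinPryadko2024, §IV.C Statement 8 hypothesis (arXiv:2306.16400 chunk p0010 L58–60)] -/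
theorem A3_comm : ∀ x ∈ alternatingGroup (Fin 3), ∀ y ∈ alternatingGroup (Fin 3), x * y = y * x := by
  intro x hx y hy
  rw [Perm.mem_alternatingGroup] at hx hy
  revert x y
  decide

open Equiv in
/-- ★ **The printed product is not well defined on the printed classes** (`G_a = S₃`, `N = G_b = A₃`): the
triples `(1,1,1)` and `(1,c⁻¹,c)` are equivalent, but their products with `(τ,1,1)` stand for the distinct group
elements `τ ≠ τc²` (equivalent triples always stand for the same element, `toGroup_eq_of_rel`). The defect is the
factor `α₂⁻¹y⁻¹α₂·y` (`α₂ = τ`, `y = c`), trivial iff `α₂` centralises `N`.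
[cite: LinPryadko2024, App. VIII.B proof of Statement 8, displayed product and "It is easy to verify the group axioms" (arXiv:2306.16400 chunk p0018 L84–95)] -/
theorem not_wellDefined_S3 :
    Rel (alternatingGroup (Fin 3)) ((1 : Perm (Fin 3)), (1 : Perm (Fin 3)), (1 : Perm (Fin 3))) (1, c3⁻¹, c3) ∧
      toGroup (mul ((1 : Perm (Fin 3)), (1 : Perm (Fin 3)), (1 : Perm (Fin 3))) (tau, 1, 1)) ≠
        toGroup (mul ((1 : Perm (Fin 3)), c3⁻¹, c3) (tau, 1, 1)) := by
  refine ⟨rel_one_conj c3_mem, ?_⟩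
  rw [(toGroup_mul_one_conj c3 tau).1, (toGroup_mul_one_conj c3 tau).2]
  decide

/-- Hence no binary operation on the classes induces the printed product: any `f` on triples that is constant on
classes in its first argument differs from `mul` somewhere (namely at the witness above).
[cite: LinPryadko2024, App. VIII.B (arXiv:2306.16400 chunk p0018 L84–95)] -/
theorem no_class_function_S3 (f : (Equiv.Perm (Fin 3) × Equiv.Perm (Fin 3) × Equiv.Perm (Fin 3)) →
      (Equiv.Perm (Fin 3) × Equiv.Perm (Fin 3) × Equiv.Perm (Fin 3)) → Equiv.Perm (Fin 3))
    (hf : ∀ t t' s, Rel (alternatingGroup (Fin 3)) t t' → f t s = f t' s) :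
    ∃ t s, f t s ≠ toGroup (mul t s) := by
  by_contra hall
  simp only [not_exists, ne_eq, not_not] at hall
  obtain ⟨hrel, hne⟩ := not_wellDefined_S3
  exact hne (by rw [← hall, ← hall, hf _ _ _ hrel])

end PrintedTripleLaw

/-! ## §B. Statement 8 for central amalgams -/

variable {G : Type*} [Group G] {G' : Type*} [Group G']

/-- A **central amalgam** of the subgroups `G_a`, `G_b ≤ G`: a group `G'` with homomorphisms `ιa : G_a → G'`,
`ιb : G_b → G'` whose images commute elementwise ("the elements from `H_a` and `H_b` are forced to commute"),
which are glued EXACTLY along `G_a ∩ G_b` (`ιa α · ιb β = 1 ↔ αβ = 1` in `G`), and which generate `G'`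
(every element is `ιa α · ιb β`). For disjoint subgroups `G' = G_a × G_b` (`isCentralAmalgam_prod`); for
elementwise commuting subgroups `G' = G_a ⊔ G_b ≤ G` (`isCentralAmalgam_sup`); in general `G'` is the central
product over `N = G_a ∩ G_b`, which must then be central (`central_left`).
[cite: LinPryadko2024, App. VIII.B proof of Statement 8 (arXiv:2306.16400 chunk p0018 L84–100) and §IV.C "with disjoint subgroups … G' = G_a × G_b" (chunk p0010 L64–67)] -/
structure IsCentralAmalgam (Ha Hb : Subgroup G) (ιa : Ha →* G') (ιb : Hb →* G') : Prop where
  /-- the two images commute elementwise -/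
  comm : ∀ (α : Ha) (β : Hb), ιa α * ιb β = ιb β * ιa α
  /-- glued exactly along `G_a ∩ G_b` -/
  glue : ∀ (α : Ha) (β : Hb), ιa α * ιb β = 1 ↔ (α : G) * β = 1
  /-- generation -/
  surj : ∀ g : G', ∃ (α : Ha) (β : Hb), ιa α * ιb β = g

namespace IsCentralAmalgam

variable {Ha Hb : Subgroup G} {ιa : Ha →* G'} {ιb : Hb →* G'} (h : IsCentralAmalgam Ha Hb ιa ιb)
include h

/-- **Fibre condition**: `ιa α₁ · ιb β₁ = ιa α₂ · ιb β₂ ↔ α₁β₁ = α₂β₂` in `G` — the "product-preserving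
equivalence classes" realised by a group. [cite: LinPryadko2024, App. VIII.B "product-preserving equivalence classes" (arXiv:2306.16400 chunk p0018 L81–83)] -/
theorem eq_iff (α₁ α₂ : Ha) (β₁ β₂ : Hb) :
    ιa α₁ * ιb β₁ = ιa α₂ * ιb β₂ ↔ (α₁ : G) * β₁ = α₂ * β₂ := by
  have h1 : ιa α₁ * ιb β₁ = ιa α₂ * ιb β₂ ↔ ιa (α₂⁻¹ * α₁) * ιb (β₁ * β₂⁻¹) = 1 := by
    rw [map_mul, map_mul, map_inv, map_inv]
    constructor
    · intro heq
      calc (ιa α₂)⁻¹ * ιa α₁ * (ιb β₁ * (ιb β₂)⁻¹) = (ιa α₂)⁻¹ * (ιa α₁ * ιb β₁) * (ιb β₂)⁻¹ := by group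
        _ = 1 := by rw [heq]; group
    · intro heq
      calc ιa α₁ * ιb β₁ = ιa α₂ * ((ιa α₂)⁻¹ * ιa α₁ * (ιb β₁ * (ιb β₂)⁻¹)) * ιb β₂ := by group
        _ = ιa α₂ * ιb β₂ := by rw [heq]; group
  have h2 : ((α₂⁻¹ * α₁ : Ha) : G) * ((β₁ * β₂⁻¹ : Hb) : G) = 1 ↔ (α₁ : G) * β₁ = α₂ * β₂ := by
    simp only [Subgroup.coe_mul, Subgroup.coe_inv]
    constructor
    · intro heq
      calc (α₁ : G) * β₁ = α₂ * ((α₂ : G)⁻¹ * α₁ * (β₁ * (β₂ : G)⁻¹)) * β₂ := by group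
        _ = α₂ * β₂ := by rw [heq]; group
    · intro heq
      calc (α₂ : G)⁻¹ * α₁ * (β₁ * (β₂ : G)⁻¹) = (α₂ : G)⁻¹ * (α₁ * β₁) * (β₂ : G)⁻¹ := by group
        _ = 1 := by rw [heq]; group
  rw [h1, h.glue, h2]

/-- `ιa` is injective. [cite: LinPryadko2024, App. VIII.B (arXiv:2306.16400 chunk p0018 L65–100)] -/
theorem injective_left : Function.Injective ιa := by
  intro α₁ α₂ heq
  have := (h.eq_iff α₁ α₂ 1 1).1 (by simpa using heq)
  exact Subtype.ext (by simpa using this)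

/-- `ιb` is injective. [cite: LinPryadko2024, App. VIII.B (arXiv:2306.16400 chunk p0018 L65–100)] -/
theorem injective_right : Function.Injective ιb := by
  intro β₁ β₂ heq
  have := (h.eq_iff 1 1 β₁ β₂).1 (by simpa using heq)
  exact Subtype.ext (by simpa using this)

/-- The two homomorphisms agree on `N = G_a ∩ G_b`. [cite: LinPryadko2024, App. VIII.B (the middle entry γ ∈ N is shared) (arXiv:2306.16400 chunk p0018 L79–83)] -/
theorem agree (n : G) (hna : n ∈ Ha) (hnb : n ∈ Hb) : ιa ⟨n, hna⟩ = ιb ⟨n, hnb⟩ := by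
  have := (h.eq_iff ⟨n, hna⟩ 1 1 ⟨n, hnb⟩).2 (by simp)
  simpa using this

/-- **`N` is central in `G_a`** — forced by the hypotheses: `ιa(n)` equals `ιb(n)`, which commutes with `ιa(G_a)`.
[cite: LinPryadko2024, App. VIII.B "the abelian property of N is used to ensure the consistency of the definition" (arXiv:2306.16400 chunk p0018 L88–90) — consistency in fact needs centrality] -/
theorem central_left (n : G) (hna : n ∈ Ha) (hnb : n ∈ Hb) (α : Ha) : (α : G) * n = n * α := by
  have key : ιa (α * ⟨n, hna⟩) = ιa (⟨n, hna⟩ * α) := by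
    rw [map_mul, map_mul, h.agree n hna hnb, h.comm]
  have := congrArg Subtype.val (h.injective_left key)
  simpa using this

/-- **`N` is central in `G_b`.** [cite: LinPryadko2024, App. VIII.B (arXiv:2306.16400 chunk p0018 L88–90)] -/
theorem central_right (n : G) (hna : n ∈ Ha) (hnb : n ∈ Hb) (β : Hb) : (β : G) * n = n * β := by
  have key : ιb (β * ⟨n, hnb⟩) = ιb (⟨n, hnb⟩ * β) := by
    rw [map_mul, map_mul, ← h.agree n hna hnb, h.comm]
  have := congrArg Subtype.val (h.injective_right key)
  simpa using this

/-- `ιa α · ιb β` lies in the image of `ιa` iff `β ∈ G_a` (i.e. `β ∈ N`).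
[cite: LinPryadko2024, App. VIII.B (arXiv:2306.16400 chunk p0018 L79–100)] -/
theorem exists_left_iff (α : Ha) (β : Hb) : (∃ α' : Ha, ιa α' = ιa α * ιb β) ↔ (β : G) ∈ Ha := by
  constructor
  · rintro ⟨α', hα'⟩
    have := (h.eq_iff α' α 1 β).1 (by simpa using hα')
    rw [Subgroup.coe_one, mul_one] at this
    have hβ : (β : G) = (α : G)⁻¹ * α' := by rw [this]; group
    rw [hβ]
    exact Ha.mul_mem (Ha.inv_mem α.2) α'.2
  · intro hβ
    refine ⟨α * ⟨β, hβ⟩, ?_⟩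
    rw [map_mul, h.agree β hβ β.2]

/-- `ιa α · ιb β` lies in the image of `ιb` iff `α ∈ G_b`. [cite: LinPryadko2024, App. VIII.B (arXiv:2306.16400 chunk p0018 L79–100)] -/
theorem exists_right_iff (α : Ha) (β : Hb) : (∃ β' : Hb, ιb β' = ιa α * ιb β) ↔ (α : G) ∈ Hb := by
  constructor
  · rintro ⟨β', hβ'⟩
    have := (h.eq_iff 1 α β' β).1 (by simpa using hβ')
    rw [Subgroup.coe_one, one_mul] at this
    have hα : (α : G) = β' * (β : G)⁻¹ := by rw [this]; group
    rw [hα]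
    exact Hb.mul_mem β'.2 (Hb.inv_mem β.2)
  · intro hα
    refine ⟨⟨α, hα⟩ * β, ?_⟩
    rw [map_mul, ← h.agree α α.2 hα]

/-! ### The bijection `G' ≃ G_a 1 G_b` -/

/-- A chosen decomposition `g = ιa α · ιb β`. [cite: LinPryadko2024, App. VIII.B (arXiv:2306.16400 chunk p0018 L79–83)] -/
noncomputable def decomp (g : G') : Ha × Hb :=
  (Classical.choose (h.surj g), Classical.choose (Classical.choose_spec (h.surj g)))

/-- `ιa (decomp g).1 · ιb (decomp g).2 = g`. [cite: LinPryadko2024, App. VIII.B (arXiv:2306.16400 chunk p0018 L79–83)] -/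
theorem decomp_spec (g : G') : ιa (h.decomp g).1 * ιb (h.decomp g).2 = g :=
  Classical.choose_spec (Classical.choose_spec (h.surj g))

/-- The map `G' → G_a1G_b`, `ιa α · ιb β ↦ αβ` (well defined by `eq_iff`).
[cite: LinPryadko2024, App. VIII.B (arXiv:2306.16400 chunk p0018 L79–83)] -/
noncomputable def toDC (g : G') : {x // dcMk Ha Hb x = dcMk Ha Hb 1} := mulMapOne Ha Hb (h.decomp g)

/-- `toDC (ιa α · ιb β) = αβ`. [cite: LinPryadko2024, App. VIII.B (arXiv:2306.16400 chunk p0018 L79–83)] -/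
theorem coe_toDC (α : Ha) (β : Hb) : (h.toDC (ιa α * ιb β) : G) = α * β := by
  rw [toDC, coe_mulMapOne]
  exact (h.eq_iff _ _ _ _).1 (h.decomp_spec (ιa α * ιb β))

/-- `toDC` is a bijection onto the identity double coset. [cite: LinPryadko2024, Statement 8 "a group G' of rank |G_a 1 G_b|" (arXiv:2306.16400 chunk p0010 L61–63)] -/
theorem toDC_bijective : Function.Bijective h.toDC := by
  constructor
  · intro g₁ g₂ heq
    obtain ⟨α₁, β₁, rfl⟩ := h.surj g₁
    obtain ⟨α₂, β₂, rfl⟩ := h.surj g₂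
    have := congrArg Subtype.val heq
    rw [coe_toDC, coe_toDC] at this
    exact (h.eq_iff _ _ _ _).2 this
  · rintro ⟨y, hy⟩
    obtain ⟨g, hg, k, hk, rfl⟩ := (dcMk_eq_iff Ha Hb 1 y).1 hy.symm
    exact ⟨ιa ⟨g, hg⟩ * ιb ⟨k, hk⟩, Subtype.ext (by rw [coe_toDC]; simp)⟩

/-- **`G' ≃ G_a1G_b`** (definition). [cite: LinPryadko2024, Statement 8 "a group G' of rank |G_a 1 G_b|" (arXiv:2306.16400 chunk p0010 L61–63)] -/
noncomputable def dcEquiv : G' ≃ {x // dcMk Ha Hb x = dcMk Ha Hb 1} := Equiv.ofBijective _ h.toDC_bijective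

/-- `dcEquiv (ιa α · ιb β) = αβ`. [cite: LinPryadko2024, App. VIII.B (arXiv:2306.16400 chunk p0018 L79–83)] -/
theorem coe_dcEquiv (α : Ha) (β : Hb) : (h.dcEquiv (ιa α * ιb β) : G) = α * β := h.coe_toDC α β

/-- The order of a central amalgam is `|G_a 1 G_b|`. [cite: LinPryadko2024, Statement 8 "a group G' of rank |G_a 1 G_b|" (arXiv:2306.16400 chunk p0010 L61–63)] -/
theorem card_eq [Fintype G'] [Fintype {x // dcMk Ha Hb x = dcMk Ha Hb 1}] :
    Fintype.card G' = Fintype.card {x // dcMk Ha Hb x = dcMk Ha Hb 1} :=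
  Fintype.card_congr h.dcEquiv

end IsCentralAmalgam

omit [Group G] in
/-- `{y // π y = i} ⊕ {y // π y = i} ≃ {q : G ⊕ G // (Sum.elim π π) q = i}` — the two qubit blocks of a fibre.
[cite: LinPryadko2024, §IV.C (the block of the double coset contains both qubit halves) (arXiv:2306.16400 chunk p0010 L1–6)] -/
def sumFiberEquiv {ι : Type*} (π : G → ι) (i : ι) :
    {y // π y = i} ⊕ {y // π y = i} ≃ {q : G ⊕ G // Sum.elim π π q = i} where
  toFun := Sum.elim (fun y => ⟨Sum.inl y.1, y.2⟩) (fun y => ⟨Sum.inr y.1, y.2⟩)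
  invFun q := match q with
    | ⟨Sum.inl y, hy⟩ => Sum.inl ⟨y, hy⟩
    | ⟨Sum.inr y, hy⟩ => Sum.inr ⟨y, hy⟩
  left_inv := by rintro (y | y) <;> rfl
  right_inv := by rintro ⟨y | y, hy⟩ <;> rfl

omit [Group G] in
/-- `sumFiberEquiv (inl y) = L y`. [cite: LinPryadko2024, §IV.C (arXiv:2306.16400 chunk p0010 L1–6)] -/
@[simp] theorem coe_sumFiberEquiv_inl {ι : Type*} (π : G → ι) (i : ι) (y : {y // π y = i}) :
    (sumFiberEquiv π i (Sum.inl y) : G ⊕ G) = Sum.inl (y : G) := rfl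

omit [Group G] in
/-- `sumFiberEquiv (inr y) = R y`. [cite: LinPryadko2024, §IV.C (arXiv:2306.16400 chunk p0010 L1–6)] -/
@[simp] theorem coe_sumFiberEquiv_inr {ι : Type*} (π : G → ι) (i : ι) (y : {y // π y = i}) :
    (sumFiberEquiv π i (Sum.inr y) : G ⊕ G) = Sum.inr (y : G) := rfl

/-! ### Transported coefficient vectors and the main identity -/

section Push

variable {Ha Hb : Subgroup G} (ιa : Ha →* G') (ιb : Hb →* G')

/-- `a' = ιa_* a`: the coefficient vector on `G'` equal to `a(α)` at `ιa α` and `0` off the image of `ιa`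
("a natural map for the group algebra elements a and b"). [cite: LinPryadko2024, App. VIII.B "this map also gives a natural map for the group algebra elements a and b" (arXiv:2306.16400 chunk p0018 L96–100)] -/
noncomputable def pushLeft (a : G → ZMod 2) : G' → ZMod 2 := fun g =>
  by classical exact if hg : ∃ α : Ha, ιa α = g then a ((Classical.choose hg : Ha) : G) else 0

/-- `b' = ιb_* b`. [cite: LinPryadko2024, App. VIII.B (arXiv:2306.16400 chunk p0018 L96–100)] -/
noncomputable def pushRight (b : G → ZMod 2) : G' → ZMod 2 := fun g =>
  by classical exact if hg : ∃ β : Hb, ιb β = g then b ((Classical.choose hg : Hb) : G) else 0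

variable {ιa ιb}

/-- `a'(ιa α) = a(α)` for injective `ιa`. [cite: LinPryadko2024, App. VIII.B (arXiv:2306.16400 chunk p0018 L96–100)] -/
theorem pushLeft_apply (hinj : Function.Injective ιa) (a : G → ZMod 2) (α : Ha) : pushLeft ιa a (ιa α) = a α := by
  classical
  unfold pushLeft
  have hg : ∃ α' : Ha, ιa α' = ιa α := ⟨α, rfl⟩
  rw [dif_pos hg, hinj (Classical.choose_spec hg)]

/-- `a' = 0` off the image of `ιa`. [cite: LinPryadko2024, App. VIII.B (arXiv:2306.16400 chunk p0018 L96–100)] -/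
theorem pushLeft_eq_zero (a : G → ZMod 2) {g : G'} (hg : ¬∃ α : Ha, ιa α = g) : pushLeft ιa a g = 0 := by
  classical
  unfold pushLeft
  rw [dif_neg hg]

/-- `b'(ιb β) = b(β)` for injective `ιb`. [cite: LinPryadko2024, App. VIII.B (arXiv:2306.16400 chunk p0018 L96–100)] -/
theorem pushRight_apply (hinj : Function.Injective ιb) (b : G → ZMod 2) (β : Hb) : pushRight ιb b (ιb β) = b β := by
  classical
  unfold pushRight
  have hg : ∃ β' : Hb, ιb β' = ιb β := ⟨β, rfl⟩
  rw [dif_pos hg, hinj (Classical.choose_spec hg)]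

/-- `b' = 0` off the image of `ιb`. [cite: LinPryadko2024, App. VIII.B (arXiv:2306.16400 chunk p0018 L96–100)] -/
theorem pushRight_eq_zero (b : G → ZMod 2) {g : G'} (hg : ¬∃ β : Hb, ιb β = g) : pushRight ιb b g = 0 := by
  classical
  unfold pushRight
  rw [dif_neg hg]

/-- For `G' = G_a × G_b`: `pushLeft inl a = a ⊗ 1` (`prodInl` of `TwoBlockGAHypergraphProduct.lean`).
[cite: LinPryadko2024, §IV.C "A = A₁ ⊗ I_{n_b}" (arXiv:2306.16400 chunk p0010 L69–72)] -/
theorem pushLeft_inl [DecidableEq Hb] (a : G → ZMod 2) :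
    pushLeft (MonoidHom.inl Ha Hb) a = prodInl fun α : Ha => a α := by
  funext g
  by_cases hg : ∃ α : Ha, MonoidHom.inl Ha Hb α = g
  · obtain ⟨α, rfl⟩ := hg
    rw [pushLeft_apply (fun x y hxy => by simpa using hxy)]
    simp
  · rw [pushLeft_eq_zero a hg, prodInl_apply]
    split_ifs with h2
    · exact absurd ⟨g.1, Prod.ext rfl h2.symm⟩ hg
    · rfl

/-- For `G' = G_a × G_b`: `pushRight inr b = 1 ⊗ b` (`prodInr`). [cite: LinPryadko2024, §IV.C "B = I_{n_a} ⊗ B₁" (arXiv:2306.16400 chunk p0010 L69–72)] -/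
theorem pushRight_inr [DecidableEq Ha] (b : G → ZMod 2) :
    pushRight (MonoidHom.inr Ha Hb) b = prodInr fun β : Hb => b β := by
  funext g
  by_cases hg : ∃ β : Hb, MonoidHom.inr Ha Hb β = g
  · obtain ⟨β, rfl⟩ := hg
    rw [pushRight_apply (fun x y hxy => by simpa using hxy)]
    simp
  · rw [pushRight_eq_zero b hg, prodInr_apply]
    split_ifs with h1
    · exact absurd ⟨g.2, Prod.ext h1.symm rfl⟩ hg
    · rfl

end Push

section Main

variable {Ha Hb : Subgroup G} {ιa : Ha →* G'} {ιb : Hb →* G'} (h : IsCentralAmalgam Ha Hb ιa ιb) {a b : G → ZMod 2}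
include h

/-- Left-block entries: `a'(g₁g₂⁻¹) = a(x₁x₂⁻¹)` where `xᵢ = dcEquiv gᵢ` (uses `comm`, `agree`, and the
centrality of `N` in `G_a` forced by the amalgam; off `N` both sides vanish because `supp a ⊆ G_a`).
[cite: LinPryadko2024, App. VIII.B "the multiplication by an element of G_a from the left … giving the expected results" (arXiv:2306.16400 chunk p0018 L96–100)] -/
theorem pushLeft_mul_inv (ha : ∀ g, a g ≠ 0 → g ∈ Ha) (g₁ g₂ : G') :
    pushLeft ιa a (g₁ * g₂⁻¹) = a ((h.dcEquiv g₁ : G) * ((h.dcEquiv g₂ : G))⁻¹) := by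
  obtain ⟨α₁, β₁, rfl⟩ := h.surj g₁
  obtain ⟨α₂, β₂, rfl⟩ := h.surj g₂
  rw [h.coe_dcEquiv, h.coe_dcEquiv]
  -- `g₁ g₂⁻¹ = ιa(α₁α₂⁻¹) ιb(β₁β₂⁻¹)`
  have hprod : ιa α₁ * ιb β₁ * (ιa α₂ * ιb β₂)⁻¹ = ιa (α₁ * α₂⁻¹) * ιb (β₁ * β₂⁻¹) := by
    have hc := h.comm α₂⁻¹ (β₁ * β₂⁻¹)
    rw [map_inv, map_mul, map_inv] at hc
    rw [map_mul, map_mul, map_inv, map_inv, _root_.mul_inv_rev]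
    calc ιa α₁ * ιb β₁ * ((ιb β₂)⁻¹ * (ιa α₂)⁻¹) = ιa α₁ * ((ιb β₁ * (ιb β₂)⁻¹) * (ιa α₂)⁻¹) := by group
      _ = ιa α₁ * ((ιa α₂)⁻¹ * (ιb β₁ * (ιb β₂)⁻¹)) := by rw [← hc]
      _ = ιa α₁ * (ιa α₂)⁻¹ * (ιb β₁ * (ιb β₂)⁻¹) := by group
  rw [hprod]
  by_cases hN : ((β₁ * β₂⁻¹ : Hb) : G) ∈ Ha
  · -- in `N`: `a'(ιa(α₁α₂⁻¹ n)) = a(α₁α₂⁻¹n) = a(α₁ n α₂⁻¹)`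
    obtain ⟨α', hα'⟩ := (h.exists_left_iff (α₁ * α₂⁻¹) (β₁ * β₂⁻¹)).2 hN
    rw [← hα', pushLeft_apply h.injective_left]
    have hval : (α' : G) = (α₁ : G) * (α₂ : G)⁻¹ * ((β₁ : G) * (β₂ : G)⁻¹) := by
      have := (h.eq_iff α' (α₁ * α₂⁻¹) 1 (β₁ * β₂⁻¹)).1 (by simpa using hα')
      simpa using this
    have hcen := h.central_left _ hN (β₁ * β₂⁻¹).2 α₂⁻¹
    simp only [Subgroup.coe_mul, Subgroup.coe_inv] at hcen
    rw [hval]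
    congr 1
    rw [mul_assoc, hcen]
    group
  · -- off `N`: both sides vanish
    have hl : ¬∃ α' : Ha, ιa α' = ιa (α₁ * α₂⁻¹) * ιb (β₁ * β₂⁻¹) := fun hex =>
      hN ((h.exists_left_iff _ _).1 hex)
    rw [pushLeft_eq_zero a hl]
    symm
    by_contra hne
    apply hN
    have hmem := ha _ hne
    have : (β₁ : G) * (β₂ : G)⁻¹ = (α₁ : G)⁻¹ * ((α₁ : G) * β₁ * ((α₂ : G) * β₂)⁻¹) * α₂ := by group
    rw [Subgroup.coe_mul, Subgroup.coe_inv, this]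
    exact Ha.mul_mem (Ha.mul_mem (Ha.inv_mem α₁.2) hmem) α₂.2

/-- Right-block entries: `b'(g₂⁻¹g₁) = b(x₂⁻¹x₁)`. [cite: LinPryadko2024, App. VIII.B "an element of G_b from the right giving the expected results" (arXiv:2306.16400 chunk p0018 L96–100)] -/
theorem pushRight_inv_mul (hb : ∀ g, b g ≠ 0 → g ∈ Hb) (g₁ g₂ : G') :
    pushRight ιb b (g₂⁻¹ * g₁) = b (((h.dcEquiv g₂ : G))⁻¹ * (h.dcEquiv g₁ : G)) := by
  obtain ⟨α₁, β₁, rfl⟩ := h.surj g₁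
  obtain ⟨α₂, β₂, rfl⟩ := h.surj g₂
  rw [h.coe_dcEquiv, h.coe_dcEquiv]
  have hprod : (ιa α₂ * ιb β₂)⁻¹ * (ιa α₁ * ιb β₁) = ιa (α₂⁻¹ * α₁) * ιb (β₂⁻¹ * β₁) := by
    have hc := h.comm (α₂⁻¹ * α₁) β₂⁻¹
    rw [map_mul, map_inv, map_inv] at hc
    rw [map_mul, map_mul, map_inv, map_inv, _root_.mul_inv_rev]
    calc (ιb β₂)⁻¹ * (ιa α₂)⁻¹ * (ιa α₁ * ιb β₁) = (ιb β₂)⁻¹ * ((ιa α₂)⁻¹ * ιa α₁) * ιb β₁ := by group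
      _ = (ιa α₂)⁻¹ * ιa α₁ * (ιb β₂)⁻¹ * ιb β₁ := by rw [← hc]
      _ = (ιa α₂)⁻¹ * ιa α₁ * ((ιb β₂)⁻¹ * ιb β₁) := by group
  rw [hprod]
  by_cases hN : ((α₂⁻¹ * α₁ : Ha) : G) ∈ Hb
  · obtain ⟨β', hβ'⟩ := (h.exists_right_iff (α₂⁻¹ * α₁) (β₂⁻¹ * β₁)).2 hN
    rw [← hβ', pushRight_apply h.injective_right]
    have hval : (β' : G) = (α₂ : G)⁻¹ * (α₁ : G) * ((β₂ : G)⁻¹ * (β₁ : G)) := by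
      have := (h.eq_iff 1 (α₂⁻¹ * α₁) β' (β₂⁻¹ * β₁)).1 (by simpa using hβ')
      simpa using this
    have hcen := h.central_right _ (α₂⁻¹ * α₁).2 hN β₂⁻¹
    simp only [Subgroup.coe_mul, Subgroup.coe_inv] at hcen
    rw [hval]
    congr 1
    rw [← mul_assoc, ← hcen]
    group
  · have hr : ¬∃ β' : Hb, ιb β' = ιa (α₂⁻¹ * α₁) * ιb (β₂⁻¹ * β₁) := fun hex =>
      hN ((h.exists_right_iff _ _).1 hex)
    rw [pushRight_eq_zero b hr]
    symm
    by_contra hne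
    apply hN
    have hmem := hb _ hne
    have : (α₂ : G)⁻¹ * (α₁ : G) = β₂ * (((α₂ : G) * β₂)⁻¹ * ((α₁ : G) * β₁)) * (β₁ : G)⁻¹ := by group
    rw [Subgroup.coe_mul, Subgroup.coe_inv, this]
    exact Hb.mul_mem (Hb.mul_mem β₂.2 hmem) (Hb.inv_mem β₁.2)

variable [Fintype G] [Fintype G'] [instDD : ∀ H K : Subgroup G, DecidableEq (DoubleCoset.Quotient (H : Set G) K)]

/-- **`H_X(LP[a',b'])` over `G'` IS `H_X` of the identity-double-coset subcode of `LP[a,b]`** along `dcEquiv`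
(checks) and `dcEquiv ⊕ dcEquiv` (qubits). [cite: LinPryadko2024, §IV.C Statement 8 (arXiv:2306.16400 chunk p0010 L58–63; proof p0018 L65–100)] -/
theorem HX_eq_submatrix_dcSubcode_one (ha : ∀ g, a g ≠ 0 → g ∈ Ha) (hb : ∀ g, b g ≠ 0 → g ∈ Hb) :
    (css (pushLeft ιa a) (pushRight ιb b)).HX = (dcSubcode ha hb (dcMk Ha Hb 1)).HX.submatrix h.dcEquiv
      ((Equiv.sumCongr h.dcEquiv h.dcEquiv).trans (sumFiberEquiv (dcMk Ha Hb) (dcMk Ha Hb 1))) := by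
  ext g₁ (g₂ | g₂)
  · simp only [css_HX, HX_apply_inl, submatrix_apply, CSSCode.fiberCode_HX, Equiv.trans_apply,
      Equiv.sumCongr_apply, Sum.map_inl, coe_sumFiberEquiv_inl]
    exact pushLeft_mul_inv h ha g₁ g₂
  · simp only [css_HX, HX_apply_inr, submatrix_apply, CSSCode.fiberCode_HX, Equiv.trans_apply,
      Equiv.sumCongr_apply, Sum.map_inr, coe_sumFiberEquiv_inr]
    exact pushRight_inv_mul h hb g₁ g₂

/-- **`H_Z` likewise.** [cite: LinPryadko2024, §IV.C Statement 8 (arXiv:2306.16400 chunk p0010 L58–63; proof p0018 L65–100)] -/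
theorem HZ_eq_submatrix_dcSubcode_one (ha : ∀ g, a g ≠ 0 → g ∈ Ha) (hb : ∀ g, b g ≠ 0 → g ∈ Hb) :
    (css (pushLeft ιa a) (pushRight ιb b)).HZ = (dcSubcode ha hb (dcMk Ha Hb 1)).HZ.submatrix h.dcEquiv
      ((Equiv.sumCongr h.dcEquiv h.dcEquiv).trans (sumFiberEquiv (dcMk Ha Hb) (dcMk Ha Hb 1))) := by
  ext g₁ (g₂ | g₂)
  · simp only [css_HZ, HZ_apply_inl, submatrix_apply, CSSCode.fiberCode_HZ, Equiv.trans_apply,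
      Equiv.sumCongr_apply, Sum.map_inl, coe_sumFiberEquiv_inl]
    exact pushRight_inv_mul h hb g₂ g₁
  · simp only [css_HZ, HZ_apply_inr, submatrix_apply, CSSCode.fiberCode_HZ, Equiv.trans_apply,
      Equiv.sumCongr_apply, Sum.map_inr, coe_sumFiberEquiv_inr]
    exact pushLeft_mul_inv h ha g₂ g₁

/-- ★ **Lin–Pryadko 2024 Statement 8, central-amalgam form (any finite group, `𝔽₂`)**: for every central
amalgam `G'` of subgroups `G_a ⊇ supp a`, `G_b ⊇ supp b`, the subcode of `LP[a,b]` supported in the double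
coset `G_a1G_b` has the `d^X`, `d^Z` and `k` of the 2BGA code `LP[a', b']` over `G'` (`|G'| = |G_a1G_b|`,
`IsCentralAmalgam.card_eq`). Covers `G_a ∩ G_b = {1}` (`G' = G_a × G_b`), abelian `G`, and every pair whose
intersection is central in both; for `N` normal-abelian but NOT central the printed construction of `G'` is
not well defined (§A) and no claim is made. [cite: LinPryadko2024, §IV.C Statement 8 "the subcode of LP[a,b] supported in the double-coset G_a1G_b is equivalent to a 2BGA code over a group G' of rank |G_a 1 G_b|" (arXiv:2306.16400 chunk p0010 L58–63)] -/
theorem LinPryadko2024_statement8_central (ha : ∀ g, a g ≠ 0 → g ∈ Ha) (hb : ∀ g, b g ≠ 0 → g ∈ Hb) :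
    (css (pushLeft ιa a) (pushRight ιb b)).dX = (dcSubcode ha hb (dcMk Ha Hb 1)).dX ∧
    (css (pushLeft ιa a) (pushRight ιb b)).dZ = (dcSubcode ha hb (dcMk Ha Hb 1)).dZ ∧
    (css (pushLeft ιa a) (pushRight ιb b)).k = (dcSubcode ha hb (dcMk Ha Hb 1)).k :=
  ⟨CSSCode.dX_eq_of_submatrix (HX_eq_submatrix_dcSubcode_one h ha hb) (HZ_eq_submatrix_dcSubcode_one h ha hb),
   CSSCode.dZ_eq_of_submatrix (HX_eq_submatrix_dcSubcode_one h ha hb) (HZ_eq_submatrix_dcSubcode_one h ha hb),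
   CSSCode.k_eq_of_submatrix (HX_eq_submatrix_dcSubcode_one h ha hb) (HZ_eq_submatrix_dcSubcode_one h ha hb)⟩

/-- Statement 8 (central-amalgam form) for the census predicate. [cite: LinPryadko2024, §IV.C Statement 8 (arXiv:2306.16400 chunk p0010 L58–63)] -/
theorem LinPryadko2024_statement8_central_isCode_iff [DecidableEq G] [DecidableEq G'] (ha : ∀ g, a g ≠ 0 → g ∈ Ha)
    (hb : ∀ g, b g ≠ 0 → g ∈ Hb) (n k d : ℕ) :
    (css (pushLeft ιa a) (pushRight ιb b)).IsCode n k d ↔ (dcSubcode ha hb (dcMk Ha Hb 1)).IsCode n k d :=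
  CSSCode.isCode_iff_of_submatrix (HX_eq_submatrix_dcSubcode_one h ha hb) (HZ_eq_submatrix_dcSubcode_one h ha hb) n k d

end Main

/-! ### Two families of central amalgams -/

/-- **Disjoint subgroups: `G' = G_a × G_b`** with the two inclusions is a central amalgam
(then `pushLeft inl a = a⊗1`, `pushRight inr b = 1⊗b`: the hypergraph-product case).
[cite: LinPryadko2024, §IV.C "with disjoint subgroups, G_a ∩ G_b = {1}, the group in Statement 8 is just a direct product of the two subgroups, G' = G_a × G_b" (arXiv:2306.16400 chunk p0010 L64–67)] -/
theorem isCentralAmalgam_prod {Ha Hb : Subgroup G} (hdis : Disjoint Ha Hb) :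
    IsCentralAmalgam Ha Hb (MonoidHom.inl Ha Hb) (MonoidHom.inr Ha Hb) where
  comm α β := by ext <;> simp
  glue α β := by
    simp only [MonoidHom.inl_apply, MonoidHom.inr_apply, Prod.mk_mul_mk, mul_one, one_mul, Prod.mk_eq_one]
    constructor
    · rintro ⟨rfl, rfl⟩; simp
    · intro hab
      have hα : (α : G) = (β : G)⁻¹ := eq_inv_of_mul_eq_one_left hab
      have hα1 : (α : G) = 1 :=
        Subgroup.disjoint_def.mp hdis α.2 (by rw [hα]; exact Hb.inv_mem β.2)
      have hβ1 : (β : G) = 1 := by rwa [hα1, one_mul] at hab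
      exact ⟨Subtype.ext hα1, Subtype.ext hβ1⟩
  surj g := ⟨g.1, g.2, by ext <;> simp⟩

open scoped Pointwise in
/-- **Elementwise commuting subgroups (e.g. `G` abelian): `G' = G_a ⊔ G_b ≤ G`** with the two inclusions is a
central amalgam. [cite: LinPryadko2024, §IV.C after Statement 7 "in the case of an abelian group G, a code equivalent to any double-coset subcode … can be constructed as a 2BGA code over a subgroup of G" (arXiv:2306.16400 chunk p0010 L53–56)] -/
theorem isCentralAmalgam_sup {Ha Hb : Subgroup G} (hcomm : ∀ α ∈ Ha, ∀ β ∈ Hb, α * β = β * α) :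
    IsCentralAmalgam Ha Hb (Subgroup.inclusion (le_sup_left : Ha ≤ Ha ⊔ Hb))
      (Subgroup.inclusion (le_sup_right : Hb ≤ Ha ⊔ Hb)) where
  comm α β := Subtype.ext (by simpa using hcomm α α.2 β β.2)
  glue α β := by
    rw [← Subtype.coe_inj]
    simp
  surj g := by
    have hle : Ha ≤ Subgroup.normalizer (Hb : Set G) := fun α hα =>
      Subgroup.mem_normalizer_iff.mpr fun β => by
        constructor
        · intro hβ
          rw [hcomm α hα β hβ, mul_inv_cancel_right]
          exact hβ
        · intro hβ
          have hγ := hcomm α hα (α * β * α⁻¹) hβ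
          have : β = α⁻¹ * (α * β * α⁻¹) * α := by group
          rw [this, mul_assoc, ← hγ, ← mul_assoc, inv_mul_cancel, one_mul]
          exact hβ
    have hmem : (g : G) ∈ ((Ha : Set G) * (Hb : Set G)) := by
      rw [← Subgroup.coe_mul_of_left_le_normalizer_right Ha Hb hle]
      exact g.2
    obtain ⟨x, hx, y, hy, hxy⟩ := Set.mem_mul.mp hmem
    exact ⟨⟨x, hx⟩, ⟨y, hy⟩, Subtype.ext (by simpa using hxy)⟩

/-! ### §C. The central product `G_a ∘_N G_b` exists (for `N` central) and the central amalgam is unique -/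

section CentralProduct

variable (Ha Hb : Subgroup G)

/-- The **antidiagonal** `{(n, n⁻¹) : n ∈ G_a ∩ G_b} ⊆ G_a × G_b`, written as `{(α, β) : αβ = 1}`.
[cite: LinPryadko2024, App. VIII.B proof of Statement 8 "triplets in the form (αx, x⁻¹γy⁻¹, yβ) … united into product-preserving equivalence classes" (arXiv:2306.16400 chunk p0018 L81–83)] -/
def antidiag : Set (Ha × Hb) := {p | (p.1 : G) * p.2 = 1}

/-- unfolding `antidiag`. [cite: LinPryadko2024, App. VIII.B proof of Statement 8 (arXiv:2306.16400 chunk p0018 L79–100)] -/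
theorem mem_antidiag_iff (p : Ha × Hb) : p ∈ antidiag Ha Hb ↔ (p.1 : G) * p.2 = 1 := Iff.rfl

/-- The **central product** `G_a ∘_N G_b := (G_a × G_b) ⧸ ⟪(n, n⁻¹) : n ∈ N⟫` (quotient by the normal closure of
the antidiagonal; for `N` central in both factors the antidiagonal is already a normal subgroup,
`normalClosure_antidiag_eq`). This is the group `G'` of Statement 8 ("the elements from `H_a` and `H_b` are
forced to commute", classes "product-preserving").
[cite: LinPryadko2024, §IV.C Statement 8 and App. VIII.B (arXiv:2306.16400 chunk p0010 L58–63, p0018 L79–100)] -/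
abbrev CentralProduct : Type _ := (Ha × Hb) ⧸ Subgroup.normalClosure (antidiag Ha Hb)

/-- `G_a → G_a ∘_N G_b`. [cite: LinPryadko2024, App. VIII.B (arXiv:2306.16400 chunk p0018 L79–100)] -/
def cpInl : Ha →* CentralProduct Ha Hb :=
  (QuotientGroup.mk' (Subgroup.normalClosure (antidiag Ha Hb))).comp (MonoidHom.inl Ha Hb)

/-- `G_b → G_a ∘_N G_b`. [cite: LinPryadko2024, App. VIII.B (arXiv:2306.16400 chunk p0018 L79–100)] -/
def cpInr : Hb →* CentralProduct Ha Hb :=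
  (QuotientGroup.mk' (Subgroup.normalClosure (antidiag Ha Hb))).comp (MonoidHom.inr Ha Hb)

/-- `cpInl α = [(α,1)]`. [cite: LinPryadko2024, App. VIII.B proof of Statement 8 (arXiv:2306.16400 chunk p0018 L79–100)] -/
theorem cpInl_apply (α : Ha) : cpInl Ha Hb α = ((α, (1 : Hb)) : CentralProduct Ha Hb) := rfl

/-- `cpInr β = [(1,β)]`. [cite: LinPryadko2024, App. VIII.B proof of Statement 8 (arXiv:2306.16400 chunk p0018 L79–100)] -/
theorem cpInr_apply (β : Hb) : cpInr Ha Hb β = (((1 : Ha), β) : CentralProduct Ha Hb) := rfl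

/-- `cpInl α · cpInr β = [(α,β)]`. [cite: LinPryadko2024, App. VIII.B proof of Statement 8 (arXiv:2306.16400 chunk p0018 L79–100)] -/
theorem cpInl_mul_cpInr (α : Ha) (β : Hb) : cpInl Ha Hb α * cpInr Ha Hb β = ((α, β) : CentralProduct Ha Hb) := by
  rw [cpInl_apply, cpInr_apply, ← QuotientGroup.mk_mul, Prod.mk_mul_mk, mul_one, one_mul]

/-- "the elements from `H_a` and `H_b` are forced to commute". [cite: LinPryadko2024, App. VIII.B proof of Statement 8 (arXiv:2306.16400 chunk p0018 L79–100)] -/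
theorem cpInl_comm_cpInr (α : Ha) (β : Hb) : cpInl Ha Hb α * cpInr Ha Hb β = cpInr Ha Hb β * cpInl Ha Hb α := by
  rw [cpInl_apply, cpInr_apply, ← QuotientGroup.mk_mul, ← QuotientGroup.mk_mul, Prod.mk_mul_mk, Prod.mk_mul_mk,
    mul_one, one_mul, mul_one, one_mul]

/-- every element of the central product is `cpInl α · cpInr β`. [cite: LinPryadko2024, App. VIII.B proof of Statement 8 (arXiv:2306.16400 chunk p0018 L79–100)] -/
theorem cpInl_mul_cpInr_surjective (g : CentralProduct Ha Hb) : ∃ (α : Ha) (β : Hb), cpInl Ha Hb α * cpInr Ha Hb β = g := by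
  obtain ⟨⟨α, β⟩, rfl⟩ := QuotientGroup.mk_surjective g
  exact ⟨α, β, cpInl_mul_cpInr Ha Hb α β⟩

variable {Ha Hb}

/-- An element of the antidiagonal has both coordinates in `N = G_a ∩ G_b`. [folklore] -/
private theorem fst_mem_of_mem_antidiag {p : Ha × Hb} (hp : p ∈ antidiag Ha Hb) : (p.1 : G) ∈ Hb := by
  have h1 : (p.1 : G) = (p.2 : G)⁻¹ := eq_inv_of_mul_eq_one_left hp
  rw [h1]; exact Hb.inv_mem p.2.2

/-- [folklore] -/
private theorem snd_mem_of_mem_antidiag {p : Ha × Hb} (hp : p ∈ antidiag Ha Hb) : (p.2 : G) ∈ Ha := by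
  have h2 : (p.2 : G) = (p.1 : G)⁻¹ := eq_inv_of_mul_eq_one_right hp
  rw [h2]; exact Ha.inv_mem p.1.2

/-- For `N = G_a ∩ G_b` central in `G_a`, the antidiagonal is a subgroup of `G_a × G_b` (isomorphic to `N`):
the printed classes `(αx, x⁻¹…y⁻¹, yβ) ~ (α, …, β)`. [cite: LinPryadko2024, App. VIII.B proof of Statement 8 (arXiv:2306.16400 chunk p0018 L79–100)] -/
def antidiagSubgroup (hcen_a : ∀ n ∈ Ha, n ∈ Hb → ∀ α ∈ Ha, α * n = n * α) : Subgroup (Ha × Hb) where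
  carrier := antidiag Ha Hb
  one_mem' := by simp [antidiag]
  mul_mem' := by
    intro p q hp hq
    simp only [mem_antidiag_iff, Prod.fst_mul, Prod.snd_mul, Subgroup.coe_mul] at hp hq ⊢
    -- `p.2 ∈ N` commutes with `q.1 ∈ G_a`
    have hc : (q.1 : G) * p.2 = p.2 * q.1 :=
      hcen_a _ (snd_mem_of_mem_antidiag hp) p.2.2 _ q.1.2
    calc (p.1 : G) * q.1 * (p.2 * q.2) = p.1 * (q.1 * p.2) * q.2 := by group
      _ = p.1 * (p.2 * q.1) * q.2 := by rw [hc]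
      _ = (p.1 * p.2) * (q.1 * q.2) := by group
      _ = 1 := by rw [hp, hq, one_mul]
  inv_mem' := by
    intro p hp
    simp only [mem_antidiag_iff, Prod.fst_inv, Prod.snd_inv, Subgroup.coe_inv] at hp ⊢
    have h2 : (p.2 : G) = (p.1 : G)⁻¹ := eq_inv_of_mul_eq_one_right hp
    rw [h2, inv_inv, inv_mul_cancel]

/-- unfolding `antidiagSubgroup`. [cite: LinPryadko2024, App. VIII.B proof of Statement 8 (arXiv:2306.16400 chunk p0018 L79–100)] -/
theorem mem_antidiagSubgroup_iff (hcen_a : ∀ n ∈ Ha, n ∈ Hb → ∀ α ∈ Ha, α * n = n * α) (p : Ha × Hb) :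
    p ∈ antidiagSubgroup hcen_a ↔ (p.1 : G) * p.2 = 1 := Iff.rfl

/-- … and it is normal when `N` is central in `G_b` as well. [cite: LinPryadko2024, App. VIII.B proof of Statement 8 (arXiv:2306.16400 chunk p0018 L79–100)] -/
theorem antidiagSubgroup_normal (hcen_a : ∀ n ∈ Ha, n ∈ Hb → ∀ α ∈ Ha, α * n = n * α)
    (hcen_b : ∀ n ∈ Ha, n ∈ Hb → ∀ β ∈ Hb, β * n = n * β) : (antidiagSubgroup hcen_a).Normal := by
  refine ⟨fun p hp g => ?_⟩
  rw [mem_antidiagSubgroup_iff] at hp ⊢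
  simp only [Prod.fst_mul, Prod.snd_mul, Prod.fst_inv, Prod.snd_inv, Subgroup.coe_mul, Subgroup.coe_inv]
  have h1 : (g.1 : G) * p.1 = p.1 * g.1 := hcen_a _ p.1.2 (fst_mem_of_mem_antidiag hp) _ g.1.2
  have h2 : (g.2 : G) * p.2 = p.2 * g.2 := hcen_b _ (snd_mem_of_mem_antidiag hp) p.2.2 _ g.2.2
  rw [h1, h2, mul_inv_cancel_right, mul_inv_cancel_right, hp]

/-- For `N` central in both factors the kernel of the central product IS the antidiagonal `{(n,n⁻¹)}`
(no closure needed), so `|G_a ∘_N G_b| = |G_a||G_b|/|N| = |G_a1G_b|` (`IsCentralAmalgam.card_eq`).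
[cite: LinPryadko2024, App. VIII.B proof of Statement 8 (arXiv:2306.16400 chunk p0018 L79–100)] -/
theorem normalClosure_antidiag_eq (hcen_a : ∀ n ∈ Ha, n ∈ Hb → ∀ α ∈ Ha, α * n = n * α)
    (hcen_b : ∀ n ∈ Ha, n ∈ Hb → ∀ β ∈ Hb, β * n = n * β) :
    Subgroup.normalClosure (antidiag Ha Hb) = antidiagSubgroup hcen_a := by
  haveI := antidiagSubgroup_normal hcen_a hcen_b
  exact le_antisymm (Subgroup.normalClosure_le_normal fun p hp => hp) Subgroup.subset_normalClosure

/-- ★ **The central product is a central amalgam** whenever `N = G_a ∩ G_b` is central in `G_a` and in `G_b`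
(and only then: `IsCentralAmalgam.central_left/right`). Hence Statement 8 holds, with
`G' = G_a ∘_N G_b` of order `|G_a1G_b|`, for every such pair (`LinPryadko2024_statement8_of_central`).
[cite: LinPryadko2024, §IV.C Statement 8 and App. VIII.B (arXiv:2306.16400 chunk p0010 L58–63, p0018 L79–100)] -/
theorem isCentralAmalgam_centralProduct (hcen_a : ∀ n ∈ Ha, n ∈ Hb → ∀ α ∈ Ha, α * n = n * α)
    (hcen_b : ∀ n ∈ Ha, n ∈ Hb → ∀ β ∈ Hb, β * n = n * β) :
    IsCentralAmalgam Ha Hb (cpInl Ha Hb) (cpInr Ha Hb) where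
  comm := cpInl_comm_cpInr Ha Hb
  glue α β := by
    rw [cpInl_mul_cpInr, QuotientGroup.eq_one_iff, normalClosure_antidiag_eq hcen_a hcen_b,
      mem_antidiagSubgroup_iff]
  surj := cpInl_mul_cpInr_surjective Ha Hb

/-- Conversely-packaged: a central amalgam of `G_a`, `G_b` exists (namely the central product) iff
`N = G_a ∩ G_b` is central in both (the consistency condition of the printed construction, §A). [cite: LinPryadko2024, App. VIII.B proof of Statement 8 (arXiv:2306.16400 chunk p0018 L79–100)] -/
theorem isCentralAmalgam_centralProduct_iff :
    IsCentralAmalgam Ha Hb (cpInl Ha Hb) (cpInr Ha Hb) ↔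
      (∀ n ∈ Ha, n ∈ Hb → ∀ α ∈ Ha, α * n = n * α) ∧ (∀ n ∈ Ha, n ∈ Hb → ∀ β ∈ Hb, β * n = n * β) := by
  constructor
  · intro h
    exact ⟨fun n hna hnb α hα => h.central_left n hna hnb ⟨α, hα⟩,
      fun n hna hnb β hβ => h.central_right n hna hnb ⟨β, hβ⟩⟩
  · rintro ⟨ha, hb⟩
    exact isCentralAmalgam_centralProduct ha hb

variable [Fintype G] [Fintype (CentralProduct Ha Hb)]
  [instDD : ∀ H K : Subgroup G, DecidableEq (DoubleCoset.Quotient (H : Set G) K)] {a b : G → ZMod 2}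

/-- `|G_a ∘_N G_b| = |G_a1G_b|`. [cite: LinPryadko2024, §IV.C Statement 8 "a group G' of rank |G_a 1 G_b|" (arXiv:2306.16400 chunk p0010 L58–63)] -/
theorem card_centralProduct (hcen_a : ∀ n ∈ Ha, n ∈ Hb → ∀ α ∈ Ha, α * n = n * α)
    (hcen_b : ∀ n ∈ Ha, n ∈ Hb → ∀ β ∈ Hb, β * n = n * β) :
    Fintype.card (CentralProduct Ha Hb) = Fintype.card {x // dcMk Ha Hb x = dcMk Ha Hb 1} :=
  (isCentralAmalgam_centralProduct hcen_a hcen_b).card_eq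

/-- ★ **Lin–Pryadko 2024 Statement 8 for `N` central (any finite group, `𝔽₂`), with the explicit group
`G' = G_a ∘_N G_b`**: if `N = G_a ∩ G_b` is central in both support groups, the subcode of `LP[a,b]` supported
in `G_a1G_b` has the `d^X`, `d^Z`, `k` of the 2BGA code `LP[a',b']` over the central product (`|G'| = |G_a1G_b|`,
`card_centralProduct`). The printed hypothesis is "abelian and normal in both"; for non-central such `N` the
printed `G'` is ill-defined (§A) and nothing is claimed. [cite: LinPryadko2024, §IV.C Statement 8 (arXiv:2306.16400 chunk p0010 L58–63; proof App. VIII.B p0018 L65–100)] -/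
theorem LinPryadko2024_statement8_of_central (hcen_a : ∀ n ∈ Ha, n ∈ Hb → ∀ α ∈ Ha, α * n = n * α)
    (hcen_b : ∀ n ∈ Ha, n ∈ Hb → ∀ β ∈ Hb, β * n = n * β)
    (ha : ∀ g, a g ≠ 0 → g ∈ Ha) (hb : ∀ g, b g ≠ 0 → g ∈ Hb) :
    (css (pushLeft (cpInl Ha Hb) a) (pushRight (cpInr Ha Hb) b)).dX = (dcSubcode ha hb (dcMk Ha Hb 1)).dX ∧
    (css (pushLeft (cpInl Ha Hb) a) (pushRight (cpInr Ha Hb) b)).dZ = (dcSubcode ha hb (dcMk Ha Hb 1)).dZ ∧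
    (css (pushLeft (cpInl Ha Hb) a) (pushRight (cpInr Ha Hb) b)).k = (dcSubcode ha hb (dcMk Ha Hb 1)).k :=
  LinPryadko2024_statement8_central (isCentralAmalgam_centralProduct hcen_a hcen_b) ha hb

/-- Census form. [cite: LinPryadko2024, §IV.C Statement 8 (arXiv:2306.16400 chunk p0010 L58–63)] -/
theorem LinPryadko2024_statement8_of_central_isCode_iff [DecidableEq G] [DecidableEq (CentralProduct Ha Hb)]
    (hcen_a : ∀ n ∈ Ha, n ∈ Hb → ∀ α ∈ Ha, α * n = n * α)
    (hcen_b : ∀ n ∈ Ha, n ∈ Hb → ∀ β ∈ Hb, β * n = n * β)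
    (ha : ∀ g, a g ≠ 0 → g ∈ Ha) (hb : ∀ g, b g ≠ 0 → g ∈ Hb) (n k d : ℕ) :
    (css (pushLeft (cpInl Ha Hb) a) (pushRight (cpInr Ha Hb) b)).IsCode n k d ↔
      (dcSubcode ha hb (dcMk Ha Hb 1)).IsCode n k d :=
  LinPryadko2024_statement8_central_isCode_iff (isCentralAmalgam_centralProduct hcen_a hcen_b) ha hb n k d

end CentralProduct

/-! ### Uniqueness: any two central amalgams of `G_a`, `G_b` are isomorphic over `G_a`, `G_b` -/

namespace IsCentralAmalgam

variable {G'' : Type*} [Group G''] {Ha Hb : Subgroup G}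
  {ιa : Ha →* G'} {ιb : Hb →* G'} {ιa' : Ha →* G''} {ιb' : Hb →* G''}

/-- transfer of the fibre condition between two central amalgams [folklore] -/
private theorem map_wd (h : IsCentralAmalgam Ha Hb ιa ιb) (h' : IsCentralAmalgam Ha Hb ιa' ιb') {α₁ α₂ : Ha}
    {β₁ β₂ : Hb} (he : ιa α₁ * ιb β₁ = ιa α₂ * ιb β₂) : ιa' α₁ * ιb' β₁ = ιa' α₂ * ιb' β₂ :=
  (h'.eq_iff α₁ α₂ β₁ β₂).mpr ((h.eq_iff α₁ α₂ β₁ β₂).mp he)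

/-- The comparison homomorphism `G' → G''`, `ιa α · ιb β ↦ ιa' α · ιb' β`. [cite: LinPryadko2024, §IV.C Statement 8 "a 2BGA code over a group G'" (arXiv:2306.16400 chunk p0010 L58–63; App. VIII.B p0018 L79–100)] -/
noncomputable def compare (h : IsCentralAmalgam Ha Hb ιa ιb) (h' : IsCentralAmalgam Ha Hb ιa' ιb') :
    G' →* G'' :=
  MonoidHom.mk' (fun g => ιa' (h.decomp g).1 * ιb' (h.decomp g).2) fun g₁ g₂ => by
    obtain ⟨α₁, β₁, rfl⟩ := h.surj g₁
    obtain ⟨α₂, β₂, rfl⟩ := h.surj g₂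
    have e1 := h.decomp_spec (ιa α₁ * ιb β₁)
    have e2 := h.decomp_spec (ιa α₂ * ιb β₂)
    have e12 := h.decomp_spec (ιa α₁ * ιb β₁ * (ιa α₂ * ιb β₂))
    have hprod : ιa α₁ * ιb β₁ * (ιa α₂ * ιb β₂) = ιa (α₁ * α₂) * ιb (β₁ * β₂) := by
      rw [map_mul, map_mul, mul_assoc, mul_assoc, ← mul_assoc (ιb β₁), ← h.comm α₂ β₁, mul_assoc]
    rw [hprod] at e12 ⊢
    rw [map_wd h h' e12, map_wd h h' e1, map_wd h h' e2, map_mul, map_mul, mul_assoc, mul_assoc,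
      ← mul_assoc (ιa' α₂), h'.comm α₂ β₁, mul_assoc]

/-- `compare (ιa α · ιb β) = ιa' α · ιb' β`. [cite: LinPryadko2024, §IV.C Statement 8 "a 2BGA code over a group G'" (arXiv:2306.16400 chunk p0010 L58–63; App. VIII.B p0018 L79–100)] -/
theorem compare_apply (h : IsCentralAmalgam Ha Hb ιa ιb) (h' : IsCentralAmalgam Ha Hb ιa' ιb') (α : Ha)
    (β : Hb) : h.compare h' (ιa α * ιb β) = ιa' α * ιb' β := by
  simp only [compare, MonoidHom.mk'_apply]
  exact map_wd h h' (h.decomp_spec (ιa α * ιb β))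

/-- `compare ∘ ιa = ιa'`. [cite: LinPryadko2024, §IV.C Statement 8 "a 2BGA code over a group G'" (arXiv:2306.16400 chunk p0010 L58–63; App. VIII.B p0018 L79–100)] -/
theorem compare_comp_left (h : IsCentralAmalgam Ha Hb ιa ιb) (h' : IsCentralAmalgam Ha Hb ιa' ιb') :
    (h.compare h').comp ιa = ιa' := by
  ext α
  have := compare_apply h h' α 1
  simpa using this

/-- `compare ∘ ιb = ιb'`. [cite: LinPryadko2024, §IV.C Statement 8 "a 2BGA code over a group G'" (arXiv:2306.16400 chunk p0010 L58–63; App. VIII.B p0018 L79–100)] -/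
theorem compare_comp_right (h : IsCentralAmalgam Ha Hb ιa ιb) (h' : IsCentralAmalgam Ha Hb ιa' ιb') :
    (h.compare h').comp ιb = ιb' := by
  ext β
  have := compare_apply h h' 1 β
  simpa using this

/-- `compare` is a bijection. [cite: LinPryadko2024, §IV.C Statement 8 "a 2BGA code over a group G'" (arXiv:2306.16400 chunk p0010 L58–63; App. VIII.B p0018 L79–100)] -/
theorem compare_bijective (h : IsCentralAmalgam Ha Hb ιa ιb) (h' : IsCentralAmalgam Ha Hb ιa' ιb') :
    Function.Bijective (h.compare h') := by
  constructor
  · intro g₁ g₂ hg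
    obtain ⟨α₁, β₁, rfl⟩ := h.surj g₁
    obtain ⟨α₂, β₂, rfl⟩ := h.surj g₂
    rw [compare_apply, compare_apply] at hg
    exact map_wd h' h hg
  · intro g''
    obtain ⟨α, β, rfl⟩ := h'.surj g''
    exact ⟨ιa α * ιb β, compare_apply h h' α β⟩

/-- ★ **Uniqueness of the central amalgam**: any two central amalgams of `G_a`, `G_b` are isomorphic by an
isomorphism commuting with the structure maps (`compare_comp_left/right`); in particular every central amalgam
is the central product `G_a ∘_N G_b` (`isCentralAmalgam_centralProduct`). [cite: LinPryadko2024, §IV.C Statement 8 "a 2BGA code over a group G'" (arXiv:2306.16400 chunk p0010 L58–63; App. VIII.B p0018 L79–100)] -/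
noncomputable def mulEquiv (h : IsCentralAmalgam Ha Hb ιa ιb) (h' : IsCentralAmalgam Ha Hb ιa' ιb') :
    G' ≃* G'' :=
  MulEquiv.ofBijective (h.compare h') (compare_bijective h h')

/-- `mulEquiv (ιa α · ιb β) = ιa' α · ιb' β`. [cite: LinPryadko2024, §IV.C Statement 8 "a 2BGA code over a group G'" (arXiv:2306.16400 chunk p0010 L58–63; App. VIII.B p0018 L79–100)] -/
theorem mulEquiv_apply (h : IsCentralAmalgam Ha Hb ιa ιb) (h' : IsCentralAmalgam Ha Hb ιa' ιb') (α : Ha)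
    (β : Hb) : h.mulEquiv h' (ιa α * ιb β) = ιa' α * ιb' β :=
  compare_apply h h' α β

end IsCentralAmalgam

/-! ### §D. Statement 8 without "forced to commute": EXACT AMALGAMS
The identification `G_a1G_b ≃ G'`, `αβ ↦ ιa α · ιb β`, and the equality of check matrices need only that
`G'` is generated as the product set `ιa(G_a)·ιb(G_b)` and that the two copies are glued EXACTLY along
`N = G_a ∩ G_b` — NOT that they commute. This covers, besides every central amalgam (§B–§C), every pair of
support groups whose product set `G_aG_b` is a subgroup of `G` (then `G' = G_aG_b ≤ G` with the inclusions,
`isAmalgam_inclusion`, e.g. when one support group normalises the other, `isAmalgam_sup_of_le_normalizer`),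
with NO hypothesis on `N`. -/

/-- An **exact amalgam** of the subgroups `G_a`, `G_b ≤ G`: a group `G'` with homomorphisms `ιa : G_a → G'`,
`ιb : G_b → G'`, glued EXACTLY along `G_a ∩ G_b` (`ιa α · ιb β = 1 ↔ αβ = 1` in `G`) and with `G' = ιa(G_a)·ιb(G_b)`
as a SET. No commutation is required (compare `IsCentralAmalgam`, which adds the printed "forced to commute").
[cite: LinPryadko2024, §IV.C Statement 8 "a 2BGA code over a group G' of rank |G_a 1 G_b|" (arXiv:2306.16400 chunk p0010 L58–63); App. VIII.B "product-preserving equivalence classes" (chunk p0018 L81–83)] -/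
structure IsAmalgam (Ha Hb : Subgroup G) (ιa : Ha →* G') (ιb : Hb →* G') : Prop where
  /-- glued exactly along `G_a ∩ G_b` -/
  glue : ∀ (α : Ha) (β : Hb), ιa α * ιb β = 1 ↔ (α : G) * β = 1
  /-- `G'` is the product set of the two images -/
  surj : ∀ g : G', ∃ (α : Ha) (β : Hb), ιa α * ιb β = g

/-- A central amalgam is an exact amalgam. [cite: LinPryadko2024, App. VIII.B (arXiv:2306.16400 chunk p0018 L79–100)] -/
theorem IsCentralAmalgam.isAmalgam {Ha Hb : Subgroup G} {ιa : Ha →* G'} {ιb : Hb →* G'}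
    (h : IsCentralAmalgam Ha Hb ιa ιb) : IsAmalgam Ha Hb ιa ιb :=
  ⟨h.glue, h.surj⟩

namespace IsAmalgam

variable {Ha Hb : Subgroup G} {ιa : Ha →* G'} {ιb : Hb →* G'} (h : IsAmalgam Ha Hb ιa ιb)
include h

/-- **Fibre condition** `ιa α₁ · ιb β₁ = ιa α₂ · ιb β₂ ↔ α₁β₁ = α₂β₂` — from `glue` alone.
[cite: LinPryadko2024, App. VIII.B "product-preserving equivalence classes" (arXiv:2306.16400 chunk p0018 L81–83)] -/
theorem eq_iff (α₁ α₂ : Ha) (β₁ β₂ : Hb) :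
    ιa α₁ * ιb β₁ = ιa α₂ * ιb β₂ ↔ (α₁ : G) * β₁ = α₂ * β₂ := by
  have h1 : ιa α₁ * ιb β₁ = ιa α₂ * ιb β₂ ↔ ιa (α₂⁻¹ * α₁) * ιb (β₁ * β₂⁻¹) = 1 := by
    rw [map_mul, map_mul, map_inv, map_inv]
    constructor
    · intro heq
      calc (ιa α₂)⁻¹ * ιa α₁ * (ιb β₁ * (ιb β₂)⁻¹) = (ιa α₂)⁻¹ * (ιa α₁ * ιb β₁) * (ιb β₂)⁻¹ := by group
        _ = 1 := by rw [heq]; group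
    · intro heq
      calc ιa α₁ * ιb β₁ = ιa α₂ * ((ιa α₂)⁻¹ * ιa α₁ * (ιb β₁ * (ιb β₂)⁻¹)) * ιb β₂ := by group
        _ = ιa α₂ * ιb β₂ := by rw [heq]; group
  have h2 : ((α₂⁻¹ * α₁ : Ha) : G) * ((β₁ * β₂⁻¹ : Hb) : G) = 1 ↔ (α₁ : G) * β₁ = α₂ * β₂ := by
    simp only [Subgroup.coe_mul, Subgroup.coe_inv]
    constructor
    · intro heq
      calc (α₁ : G) * β₁ = α₂ * ((α₂ : G)⁻¹ * α₁ * (β₁ * (β₂ : G)⁻¹)) * β₂ := by group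
        _ = α₂ * β₂ := by rw [heq]; group
    · intro heq
      calc (α₂ : G)⁻¹ * α₁ * (β₁ * (β₂ : G)⁻¹) = (α₂ : G)⁻¹ * (α₁ * β₁) * (β₂ : G)⁻¹ := by group
        _ = 1 := by rw [heq]; group
  rw [h1, h.glue, h2]

/-- `ιa α = ιb β ↔ α = β` in `G`: the two copies meet exactly in `N`. [cite: LinPryadko2024, App. VIII.B (arXiv:2306.16400 chunk p0018 L79–83)] -/
theorem left_eq_right_iff (α : Ha) (β : Hb) : ιa α = ιb β ↔ (α : G) = β := by
  have := h.eq_iff α 1 1 β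
  simpa using this

/-- `ιa` is injective. [cite: LinPryadko2024, App. VIII.B (arXiv:2306.16400 chunk p0018 L65–100)] -/
theorem injective_left : Function.Injective ιa := by
  intro α₁ α₂ heq
  have := (h.eq_iff α₁ α₂ 1 1).1 (by simpa using heq)
  exact Subtype.ext (by simpa using this)

/-- `ιb` is injective. [cite: LinPryadko2024, App. VIII.B (arXiv:2306.16400 chunk p0018 L65–100)] -/
theorem injective_right : Function.Injective ιb := by
  intro β₁ β₂ heq
  have := (h.eq_iff 1 1 β₁ β₂).1 (by simpa using heq)
  exact Subtype.ext (by simpa using this)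

/-- The two homomorphisms agree on `N`. [cite: LinPryadko2024, App. VIII.B (arXiv:2306.16400 chunk p0018 L79–83)] -/
theorem agree (n : G) (hna : n ∈ Ha) (hnb : n ∈ Hb) : ιa ⟨n, hna⟩ = ιb ⟨n, hnb⟩ :=
  (h.left_eq_right_iff ⟨n, hna⟩ ⟨n, hnb⟩).2 rfl

/-- `ιa α = ιb α` for `α ∈ G_a ∩ G_b` (rewriting form). [cite: LinPryadko2024, App. VIII.B (arXiv:2306.16400 chunk p0018 L79–83)] -/
theorem agree_left (α : Ha) (hα : (α : G) ∈ Hb) : ιa α = ιb ⟨α, hα⟩ :=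
  (h.left_eq_right_iff α ⟨α, hα⟩).2 rfl

/-- `ιb β = ιa β` for `β ∈ G_a ∩ G_b` (rewriting form). [cite: LinPryadko2024, App. VIII.B (arXiv:2306.16400 chunk p0018 L79–83)] -/
theorem agree_right (β : Hb) (hβ : (β : G) ∈ Ha) : ιb β = ιa ⟨β, hβ⟩ :=
  ((h.left_eq_right_iff ⟨β, hβ⟩ β).2 rfl).symm

/-- **Sandwich criterion (left)**: `ιa α · ιb β · ιa α'` lies in `ιa(G_a)` iff `β ∈ G_a`.
[cite: LinPryadko2024, App. VIII.B "the multiplication by an element of G_a from the left … giving the expected results" (arXiv:2306.16400 chunk p0018 L96–100)] -/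
theorem exists_left_sandwich_iff (α α' : Ha) (β : Hb) :
    (∃ γ : Ha, ιa γ = ιa α * ιb β * ιa α') ↔ (β : G) ∈ Ha := by
  constructor
  · rintro ⟨γ, hγ⟩
    have key : ιa (α⁻¹ * γ * α'⁻¹) = ιb β := by
      rw [map_mul, map_mul, map_inv, map_inv, hγ]; group
    have := (h.left_eq_right_iff _ _).1 key
    rw [← this]
    exact (α⁻¹ * γ * α'⁻¹).2
  · intro hβ
    refine ⟨α * ⟨β, hβ⟩ * α', ?_⟩
    rw [map_mul, map_mul, h.agree β hβ β.2]

/-- **Sandwich criterion (right)**: `ιb β · ιa α · ιb β'` lies in `ιb(G_b)` iff `α ∈ G_b`.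
[cite: LinPryadko2024, App. VIII.B "an element of G_b from the right giving the expected results" (arXiv:2306.16400 chunk p0018 L96–100)] -/
theorem exists_right_sandwich_iff (β β' : Hb) (α : Ha) :
    (∃ δ : Hb, ιb δ = ιb β * ιa α * ιb β') ↔ (α : G) ∈ Hb := by
  constructor
  · rintro ⟨δ, hδ⟩
    have key : ιa α = ιb (β⁻¹ * δ * β'⁻¹) := by
      rw [map_mul, map_mul, map_inv, map_inv, hδ]; group
    have := (h.left_eq_right_iff _ _).1 key
    rw [this]
    exact (β⁻¹ * δ * β'⁻¹).2
  · intro hα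
    refine ⟨β * ⟨α, hα⟩ * β', ?_⟩
    rw [map_mul, map_mul, ← h.agree α α.2 hα]

/-! #### The bijection `G' ≃ G_a1G_b` (as for central amalgams, from `eq_iff` and `surj`) -/

/-- A chosen decomposition `g = ιa α · ιb β`. [cite: LinPryadko2024, App. VIII.B (arXiv:2306.16400 chunk p0018 L79–83)] -/
noncomputable def decomp (g : G') : Ha × Hb :=
  (Classical.choose (h.surj g), Classical.choose (Classical.choose_spec (h.surj g)))

/-- `ιa (decomp g).1 · ιb (decomp g).2 = g`. [cite: LinPryadko2024, App. VIII.B (arXiv:2306.16400 chunk p0018 L79–83)] -/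
theorem decomp_spec (g : G') : ιa (h.decomp g).1 * ιb (h.decomp g).2 = g :=
  Classical.choose_spec (Classical.choose_spec (h.surj g))

/-- `G' → G_a1G_b`, `ιa α · ιb β ↦ αβ`. [cite: LinPryadko2024, App. VIII.B (arXiv:2306.16400 chunk p0018 L79–83)] -/
noncomputable def toDC (g : G') : {x // dcMk Ha Hb x = dcMk Ha Hb 1} := mulMapOne Ha Hb (h.decomp g)

/-- `toDC (ιa α · ιb β) = αβ`. [cite: LinPryadko2024, App. VIII.B (arXiv:2306.16400 chunk p0018 L79–83)] -/
theorem coe_toDC (α : Ha) (β : Hb) : (h.toDC (ιa α * ιb β) : G) = α * β := by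
  rw [toDC, coe_mulMapOne]
  exact (h.eq_iff _ _ _ _).1 (h.decomp_spec (ιa α * ιb β))

/-- `toDC` is a bijection. [cite: LinPryadko2024, Statement 8 "a group G' of rank |G_a 1 G_b|" (arXiv:2306.16400 chunk p0010 L61–63)] -/
theorem toDC_bijective : Function.Bijective h.toDC := by
  constructor
  · intro g₁ g₂ heq
    obtain ⟨α₁, β₁, rfl⟩ := h.surj g₁
    obtain ⟨α₂, β₂, rfl⟩ := h.surj g₂
    have := congrArg Subtype.val heq
    rw [coe_toDC, coe_toDC] at this
    exact (h.eq_iff _ _ _ _).2 this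
  · rintro ⟨y, hy⟩
    obtain ⟨g, hg, k, hk, rfl⟩ := (dcMk_eq_iff Ha Hb 1 y).1 hy.symm
    exact ⟨ιa ⟨g, hg⟩ * ιb ⟨k, hk⟩, Subtype.ext (by rw [coe_toDC]; simp)⟩

/-- **`G' ≃ G_a1G_b`.** [cite: LinPryadko2024, Statement 8 "a group G' of rank |G_a 1 G_b|" (arXiv:2306.16400 chunk p0010 L61–63)] -/
noncomputable def dcEquiv : G' ≃ {x // dcMk Ha Hb x = dcMk Ha Hb 1} := Equiv.ofBijective _ h.toDC_bijective

/-- `dcEquiv (ιa α · ιb β) = αβ`. [cite: LinPryadko2024, App. VIII.B (arXiv:2306.16400 chunk p0018 L79–83)] -/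
theorem coe_dcEquiv (α : Ha) (β : Hb) : (h.dcEquiv (ιa α * ιb β) : G) = α * β := h.coe_toDC α β

/-- `|G'| = |G_a1G_b|`. [cite: LinPryadko2024, Statement 8 "a group G' of rank |G_a 1 G_b|" (arXiv:2306.16400 chunk p0010 L61–63)] -/
theorem card_eq [Fintype G'] [Fintype {x // dcMk Ha Hb x = dcMk Ha Hb 1}] :
    Fintype.card G' = Fintype.card {x // dcMk Ha Hb x = dcMk Ha Hb 1} :=
  Fintype.card_congr h.dcEquiv

/-! #### Check-matrix entries without commutation -/

variable {a b : G → ZMod 2}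

/-- Left-block entries: `a'(g₁g₂⁻¹) = a(x₁x₂⁻¹)`, `xᵢ = dcEquiv gᵢ`; here `g₁g₂⁻¹ = ιa α₁ · ιb(β₁β₂⁻¹) · ιa α₂⁻¹`
is handled by the sandwich criterion instead of commutation.
[cite: LinPryadko2024, App. VIII.B "the multiplication by an element of G_a from the left … giving the expected results" (arXiv:2306.16400 chunk p0018 L96–100)] -/
theorem pushLeft_mul_inv (ha : ∀ g, a g ≠ 0 → g ∈ Ha) (g₁ g₂ : G') :
    pushLeft ιa a (g₁ * g₂⁻¹) = a ((h.dcEquiv g₁ : G) * ((h.dcEquiv g₂ : G))⁻¹) := by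
  obtain ⟨α₁, β₁, rfl⟩ := h.surj g₁
  obtain ⟨α₂, β₂, rfl⟩ := h.surj g₂
  rw [h.coe_dcEquiv, h.coe_dcEquiv]
  have hprod : ιa α₁ * ιb β₁ * (ιa α₂ * ιb β₂)⁻¹ = ιa α₁ * ιb (β₁ * β₂⁻¹) * ιa α₂⁻¹ := by
    rw [map_mul, map_inv, map_inv, _root_.mul_inv_rev]; group
  have hx : (α₁ : G) * β₁ * ((α₂ : G) * β₂)⁻¹ = α₁ * ((β₁ : G) * (β₂ : G)⁻¹) * (α₂ : G)⁻¹ := by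
    rw [_root_.mul_inv_rev]; group
  rw [hprod, hx]
  by_cases hN : ((β₁ * β₂⁻¹ : Hb) : G) ∈ Ha
  · obtain ⟨γ, hγ⟩ := (h.exists_left_sandwich_iff α₁ α₂⁻¹ (β₁ * β₂⁻¹)).2 hN
    rw [← hγ, pushLeft_apply h.injective_left]
    have hval : (γ : G) = α₁ * ((β₁ : G) * (β₂ : G)⁻¹) * (α₂ : G)⁻¹ := by
      have e : ιa γ = ιa (α₁ * ⟨_, hN⟩ * α₂⁻¹) := by
        rw [hγ, h.agree_right _ hN, ← map_mul, ← map_mul]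
      have := congrArg Subtype.val (h.injective_left e)
      simpa using this
    rw [hval]
  · have hl : ¬∃ γ : Ha, ιa γ = ιa α₁ * ιb (β₁ * β₂⁻¹) * ιa α₂⁻¹ := fun hex =>
      hN ((h.exists_left_sandwich_iff _ _ _).1 hex)
    rw [pushLeft_eq_zero a hl]
    symm
    by_contra hne
    apply hN
    have hmem := ha _ hne
    have : ((β₁ : G) * (β₂ : G)⁻¹) = (α₁ : G)⁻¹ * (α₁ * ((β₁ : G) * (β₂ : G)⁻¹) * (α₂ : G)⁻¹) * α₂ := by group
    rw [Subgroup.coe_mul, Subgroup.coe_inv, this]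
    exact Ha.mul_mem (Ha.mul_mem (Ha.inv_mem α₁.2) hmem) α₂.2

/-- Right-block entries: `b'(g₂⁻¹g₁) = b(x₂⁻¹x₁)`, via `g₂⁻¹g₁ = ιb β₂⁻¹ · ιa(α₂⁻¹α₁) · ιb β₁`.
[cite: LinPryadko2024, App. VIII.B "an element of G_b from the right giving the expected results" (arXiv:2306.16400 chunk p0018 L96–100)] -/
theorem pushRight_inv_mul (hb : ∀ g, b g ≠ 0 → g ∈ Hb) (g₁ g₂ : G') :
    pushRight ιb b (g₂⁻¹ * g₁) = b (((h.dcEquiv g₂ : G))⁻¹ * (h.dcEquiv g₁ : G)) := by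
  obtain ⟨α₁, β₁, rfl⟩ := h.surj g₁
  obtain ⟨α₂, β₂, rfl⟩ := h.surj g₂
  rw [h.coe_dcEquiv, h.coe_dcEquiv]
  have hprod : (ιa α₂ * ιb β₂)⁻¹ * (ιa α₁ * ιb β₁) = ιb β₂⁻¹ * ιa (α₂⁻¹ * α₁) * ιb β₁ := by
    rw [map_mul, map_inv, map_inv, _root_.mul_inv_rev]; group
  have hx : ((α₂ : G) * β₂)⁻¹ * ((α₁ : G) * β₁) = (β₂ : G)⁻¹ * ((α₂ : G)⁻¹ * (α₁ : G)) * β₁ := by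
    rw [_root_.mul_inv_rev]; group
  rw [hprod, hx]
  by_cases hN : ((α₂⁻¹ * α₁ : Ha) : G) ∈ Hb
  · obtain ⟨δ, hδ⟩ := (h.exists_right_sandwich_iff β₂⁻¹ β₁ (α₂⁻¹ * α₁)).2 hN
    rw [← hδ, pushRight_apply h.injective_right]
    have hval : (δ : G) = (β₂ : G)⁻¹ * ((α₂ : G)⁻¹ * (α₁ : G)) * β₁ := by
      have e : ιb δ = ιb (β₂⁻¹ * ⟨_, hN⟩ * β₁) := by
        rw [hδ, h.agree_left _ hN, ← map_mul, ← map_mul]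
      have := congrArg Subtype.val (h.injective_right e)
      simpa using this
    rw [hval]
  · have hr : ¬∃ δ : Hb, ιb δ = ιb β₂⁻¹ * ιa (α₂⁻¹ * α₁) * ιb β₁ := fun hex =>
      hN ((h.exists_right_sandwich_iff _ _ _).1 hex)
    rw [pushRight_eq_zero b hr]
    symm
    by_contra hne
    apply hN
    have hmem := hb _ hne
    have : ((α₂ : G)⁻¹ * (α₁ : G)) = β₂ * ((β₂ : G)⁻¹ * ((α₂ : G)⁻¹ * (α₁ : G)) * β₁) * (β₁ : G)⁻¹ := by group
    rw [Subgroup.coe_mul, Subgroup.coe_inv, this]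
    exact Hb.mul_mem (Hb.mul_mem β₂.2 hmem) (Hb.inv_mem β₁.2)

variable [Fintype G] [Fintype G'] [instDD : ∀ H K : Subgroup G, DecidableEq (DoubleCoset.Quotient (H : Set G) K)]

/-- **`H_X(LP[a',b'])` over an exact amalgam IS `H_X` of the identity-double-coset subcode** (no commutation).
[cite: LinPryadko2024, §IV.C Statement 8 (arXiv:2306.16400 chunk p0010 L58–63; proof p0018 L65–100)] -/
theorem HX_eq_submatrix_dcSubcode_one (ha : ∀ g, a g ≠ 0 → g ∈ Ha) (hb : ∀ g, b g ≠ 0 → g ∈ Hb) :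
    (css (pushLeft ιa a) (pushRight ιb b)).HX = (dcSubcode ha hb (dcMk Ha Hb 1)).HX.submatrix h.dcEquiv
      ((Equiv.sumCongr h.dcEquiv h.dcEquiv).trans (sumFiberEquiv (dcMk Ha Hb) (dcMk Ha Hb 1))) := by
  ext g₁ (g₂ | g₂)
  · simp only [css_HX, HX_apply_inl, submatrix_apply, CSSCode.fiberCode_HX, Equiv.trans_apply,
      Equiv.sumCongr_apply, Sum.map_inl, coe_sumFiberEquiv_inl]
    exact h.pushLeft_mul_inv ha g₁ g₂
  · simp only [css_HX, HX_apply_inr, submatrix_apply, CSSCode.fiberCode_HX, Equiv.trans_apply,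
      Equiv.sumCongr_apply, Sum.map_inr, coe_sumFiberEquiv_inr]
    exact h.pushRight_inv_mul hb g₁ g₂

/-- **`H_Z` likewise.** [cite: LinPryadko2024, §IV.C Statement 8 (arXiv:2306.16400 chunk p0010 L58–63; proof p0018 L65–100)] -/
theorem HZ_eq_submatrix_dcSubcode_one (ha : ∀ g, a g ≠ 0 → g ∈ Ha) (hb : ∀ g, b g ≠ 0 → g ∈ Hb) :
    (css (pushLeft ιa a) (pushRight ιb b)).HZ = (dcSubcode ha hb (dcMk Ha Hb 1)).HZ.submatrix h.dcEquiv
      ((Equiv.sumCongr h.dcEquiv h.dcEquiv).trans (sumFiberEquiv (dcMk Ha Hb) (dcMk Ha Hb 1))) := by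
  ext g₁ (g₂ | g₂)
  · simp only [css_HZ, HZ_apply_inl, submatrix_apply, CSSCode.fiberCode_HZ, Equiv.trans_apply,
      Equiv.sumCongr_apply, Sum.map_inl, coe_sumFiberEquiv_inl]
    exact h.pushRight_inv_mul hb g₂ g₁
  · simp only [css_HZ, HZ_apply_inr, submatrix_apply, CSSCode.fiberCode_HZ, Equiv.trans_apply,
      Equiv.sumCongr_apply, Sum.map_inr, coe_sumFiberEquiv_inr]
    exact h.pushLeft_mul_inv ha g₂ g₁

end IsAmalgam

section Amalgam

variable {Ha Hb : Subgroup G} {ιa : Ha →* G'} {ιb : Hb →* G'} {a b : G → ZMod 2}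
  [Fintype G] [Fintype G'] [instDD : ∀ H K : Subgroup G, DecidableEq (DoubleCoset.Quotient (H : Set G) K)]

/-- ★ **Lin–Pryadko 2024 Statement 8 for EXACT AMALGAMS (any finite group, `𝔽₂`; no commutation, no hypothesis
on `N`)**: for every group `G' = ιa(G_a)·ιb(G_b)` glued exactly along `N = G_a ∩ G_b`, the subcode of `LP[a,b]`
supported in `G_a1G_b` has the `d^X`, `d^Z`, `k` of the 2BGA code `LP[a',b']` over `G'`, `|G'| = |G_a1G_b|`
(`IsAmalgam.card_eq`). Instances: `G' = G_aG_b ≤ G` whenever that product set is a subgroup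
(`isAmalgam_inclusion`, `isAmalgam_sup_of_le_normalizer(')`) — any `N`; every central amalgam (§B, §C). What
remains unproved (in print and here) is the printed case "`N` abelian, normal in both" when `N` is not central
AND `G_aG_b` is not a subgroup: it asks for a group of order `|G_a||G_b|/|N|` factorising exactly as `G_a·G_b`
over `N`, which the printed construction does not supply (§A).
[cite: LinPryadko2024, §IV.C Statement 8 "the subcode of LP[a,b] supported in the double-coset G_a1G_b is equivalent to a 2BGA code over a group G' of rank |G_a 1 G_b|" (arXiv:2306.16400 chunk p0010 L58–63)] -/
theorem LinPryadko2024_statement8_amalgam (h : IsAmalgam Ha Hb ιa ιb) (ha : ∀ g, a g ≠ 0 → g ∈ Ha)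
    (hb : ∀ g, b g ≠ 0 → g ∈ Hb) :
    (css (pushLeft ιa a) (pushRight ιb b)).dX = (dcSubcode ha hb (dcMk Ha Hb 1)).dX ∧
    (css (pushLeft ιa a) (pushRight ιb b)).dZ = (dcSubcode ha hb (dcMk Ha Hb 1)).dZ ∧
    (css (pushLeft ιa a) (pushRight ιb b)).k = (dcSubcode ha hb (dcMk Ha Hb 1)).k :=
  ⟨CSSCode.dX_eq_of_submatrix (h.HX_eq_submatrix_dcSubcode_one ha hb) (h.HZ_eq_submatrix_dcSubcode_one ha hb),
   CSSCode.dZ_eq_of_submatrix (h.HX_eq_submatrix_dcSubcode_one ha hb) (h.HZ_eq_submatrix_dcSubcode_one ha hb),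
   CSSCode.k_eq_of_submatrix (h.HX_eq_submatrix_dcSubcode_one ha hb) (h.HZ_eq_submatrix_dcSubcode_one ha hb)⟩

/-- Census form. [cite: LinPryadko2024, §IV.C Statement 8 (arXiv:2306.16400 chunk p0010 L58–63)] -/
theorem LinPryadko2024_statement8_amalgam_isCode_iff [DecidableEq G] [DecidableEq G'] (h : IsAmalgam Ha Hb ιa ιb)
    (ha : ∀ g, a g ≠ 0 → g ∈ Ha) (hb : ∀ g, b g ≠ 0 → g ∈ Hb) (n k d : ℕ) :
    (css (pushLeft ιa a) (pushRight ιb b)).IsCode n k d ↔ (dcSubcode ha hb (dcMk Ha Hb 1)).IsCode n k d :=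
  CSSCode.isCode_iff_of_submatrix (h.HX_eq_submatrix_dcSubcode_one ha hb) (h.HZ_eq_submatrix_dcSubcode_one ha hb)
    n k d

end Amalgam

/-! #### Exact amalgams inside `G`: the product set `G_aG_b` is a subgroup -/

/-- **`G' = H ≤ G` with `G_a, G_b ≤ H = G_a·G_b`**: the two inclusions form an exact amalgam — for ANY
intersection `N` (abelian or not, normal or not). [cite: LinPryadko2024, §IV.C Statement 8 (arXiv:2306.16400 chunk p0010 L58–63) — the case in which the double coset `G_a1G_b` is itself a group] -/
theorem isAmalgam_inclusion {Ha Hb H : Subgroup G} (ha : Ha ≤ H) (hb : Hb ≤ H)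
    (hH : ∀ x ∈ H, ∃ α ∈ Ha, ∃ β ∈ Hb, α * β = x) :
    IsAmalgam Ha Hb (Subgroup.inclusion ha) (Subgroup.inclusion hb) where
  glue α β := by
    rw [← Subtype.coe_inj]
    simp
  surj x := by
    obtain ⟨α, hα, β, hβ, e⟩ := hH x x.2
    exact ⟨⟨α, hα⟩, ⟨β, hβ⟩, Subtype.ext (by simpa using e)⟩

open scoped Pointwise in
/-- **`G_a` normalises `G_b` ⇒ `G' = G_a ⊔ G_b = G_aG_b ≤ G`** is an exact amalgam.
[cite: LinPryadko2024, §IV.C Statement 8 (arXiv:2306.16400 chunk p0010 L58–63)] -/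
theorem isAmalgam_sup_of_le_normalizer {Ha Hb : Subgroup G} (hle : Ha ≤ Subgroup.normalizer (Hb : Set G)) :
    IsAmalgam Ha Hb (Subgroup.inclusion (le_sup_left : Ha ≤ Ha ⊔ Hb))
      (Subgroup.inclusion (le_sup_right : Hb ≤ Ha ⊔ Hb)) := by
  refine isAmalgam_inclusion le_sup_left le_sup_right fun x hx => ?_
  have hmem : x ∈ ((Ha : Set G) * (Hb : Set G)) := by
    rw [← Subgroup.coe_mul_of_left_le_normalizer_right Ha Hb hle]
    exact hx
  obtain ⟨α, hα, β, hβ, e⟩ := Set.mem_mul.mp hmem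
  exact ⟨α, hα, β, hβ, e⟩

open scoped Pointwise in
/-- **`G_b` normalises `G_a` ⇒ `G' = G_a ⊔ G_b = G_aG_b ≤ G`** is an exact amalgam (e.g. `G_a = S₃ ⊇ A₃ = G_b`,
the witness of §A: Statement 8 holds there with `G' = S₃`). [cite: LinPryadko2024, §IV.C Statement 8 (arXiv:2306.16400 chunk p0010 L58–63)] -/
theorem isAmalgam_sup_of_le_normalizer' {Ha Hb : Subgroup G} (hle : Hb ≤ Subgroup.normalizer (Ha : Set G)) :
    IsAmalgam Ha Hb (Subgroup.inclusion (le_sup_left : Ha ≤ Ha ⊔ Hb))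
      (Subgroup.inclusion (le_sup_right : Hb ≤ Ha ⊔ Hb)) := by
  refine isAmalgam_inclusion le_sup_left le_sup_right fun x hx => ?_
  have hmem : x ∈ ((Ha : Set G) * (Hb : Set G)) := by
    rw [← Subgroup.coe_mul_of_right_le_normalizer_left Ha Hb hle]
    exact hx
  obtain ⟨α, hα, β, hβ, e⟩ := Set.mem_mul.mp hmem
  exact ⟨α, hα, β, hβ, e⟩

/-- **`G = G_aG_b` (one double coset, the "connected" case)**: `G' = G` itself, `ιa`, `ιb` the subgroup
inclusions. [cite: LinPryadko2024, §IV.C Statement 8 with the remark after Statement 7 (arXiv:2306.16400 chunk p0010 L47–63)] -/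
theorem isAmalgam_subtype {Ha Hb : Subgroup G} (hG : ∀ x : G, ∃ α ∈ Ha, ∃ β ∈ Hb, α * β = x) :
    IsAmalgam Ha Hb Ha.subtype Hb.subtype where
  glue α β := by simp
  surj x := by
    obtain ⟨α, hα, β, hβ, e⟩ := hG x
    exact ⟨⟨α, hα⟩, ⟨β, hβ⟩, by simpa using e⟩

section SubgroupForm

variable {Ha Hb H : Subgroup G} {a b : G → ZMod 2}

/-- On `H`, the transported coefficient vector is the restriction: `pushLeft incl a x = a x` for `x ∈ H`.
[cite: LinPryadko2024, §IV.C Statement 8 (arXiv:2306.16400 chunk p0010 L58–63)] -/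
theorem pushLeft_inclusion_apply (haH : Ha ≤ H) (ha : ∀ g, a g ≠ 0 → g ∈ Ha) (x : H) :
    pushLeft (Subgroup.inclusion haH) a x = a x := by
  by_cases hx : (x : G) ∈ Ha
  · have : Subgroup.inclusion haH ⟨x, hx⟩ = x := Subtype.ext rfl
    have key := pushLeft_apply (Subgroup.inclusion_injective haH) a ⟨x, hx⟩
    rw [this] at key
    exact key
  · have hne : ¬∃ α : Ha, Subgroup.inclusion haH α = x := by
      rintro ⟨α, hα⟩
      apply hx
      rw [← hα]
      exact α.2
    rw [pushLeft_eq_zero a hne]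
    symm
    by_contra h0
    exact hx (ha _ h0)

/-- `pushRight incl b x = b x` for `x ∈ H`. [cite: LinPryadko2024, §IV.C Statement 8 (arXiv:2306.16400 chunk p0010 L58–63)] -/
theorem pushRight_inclusion_apply (hbH : Hb ≤ H) (hb : ∀ g, b g ≠ 0 → g ∈ Hb) (x : H) :
    pushRight (Subgroup.inclusion hbH) b x = b x := by
  by_cases hx : (x : G) ∈ Hb
  · have : Subgroup.inclusion hbH ⟨x, hx⟩ = x := Subtype.ext rfl
    have key := pushRight_apply (Subgroup.inclusion_injective hbH) b ⟨x, hx⟩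
    rw [this] at key
    exact key
  · have hne : ¬∃ β : Hb, Subgroup.inclusion hbH β = x := by
      rintro ⟨β, hβ⟩
      apply hx
      rw [← hβ]
      exact β.2
    rw [pushRight_eq_zero b hne]
    symm
    by_contra h0
    exact hx (hb _ h0)

variable [Fintype G] [Fintype H] [instDD : ∀ H K : Subgroup G, DecidableEq (DoubleCoset.Quotient (H : Set G) K)]

/-- ★ **Statement 8 when `G_aG_b` is a subgroup `H` of `G` (any `N`)**: the `G_a1G_b`-subcode of `LP[a,b]` has
the `d^X`, `d^Z`, `k` of the 2BGA code `LP[a|_H, b|_H]` over `H` (`pushLeft/pushRight` along the inclusions =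
restriction to `H`). [cite: LinPryadko2024, §IV.C Statement 8 (arXiv:2306.16400 chunk p0010 L58–63)] -/
theorem LinPryadko2024_statement8_of_subgroup (haH : Ha ≤ H) (hbH : Hb ≤ H)
    (hH : ∀ x ∈ H, ∃ α ∈ Ha, ∃ β ∈ Hb, α * β = x)
    (ha : ∀ g, a g ≠ 0 → g ∈ Ha) (hb : ∀ g, b g ≠ 0 → g ∈ Hb) :
    (css (pushLeft (Subgroup.inclusion haH) a) (pushRight (Subgroup.inclusion hbH) b)).dX =
        (dcSubcode ha hb (dcMk Ha Hb 1)).dX ∧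
    (css (pushLeft (Subgroup.inclusion haH) a) (pushRight (Subgroup.inclusion hbH) b)).dZ =
        (dcSubcode ha hb (dcMk Ha Hb 1)).dZ ∧
    (css (pushLeft (Subgroup.inclusion haH) a) (pushRight (Subgroup.inclusion hbH) b)).k =
        (dcSubcode ha hb (dcMk Ha Hb 1)).k :=
  LinPryadko2024_statement8_amalgam (isAmalgam_inclusion haH hbH hH) ha hb

end SubgroupForm

/-! ### §E. A pair satisfying the PRINTED hypotheses of Statement 8 that admits NO exact amalgam at all
`G = S₄`, `G_a = C_{S₄}((02)(13))`, `G_b = C_{S₄}((01)(23))` — two Sylow `2`-subgroups (`≅ D₈`), meeting in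
`N = V₄` (abelian, normal in both, NOT central), with `|G_aG_b| = 16 ∤ 24` (so `G_aG_b` is not a subgroup).
Conjugation induces on `N ∖ {1} = {v₁,v₂,v₃}` the transposition `(v₁ v₃)` from `G_a` and `(v₂ v₃)` from `G_b`;
in an exact amalgam `G'` the element `ιb(t_b)·ιa(t_a)` would be some `ιa(α)·ιb(β)`, but the two induced
permutations of `{v₁,v₂,v₃}` differ (`v₁ ↦ v₂` versus `v₁ ↦ v₁` or `v₃`). Hence NO group `G'` — printed,
central, or otherwise — contains copies of `G_a`, `G_b` glued along `N` with `G' = G_aG_b`: for this pair the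
conclusion of Statement 8 cannot come from ANY amalgam, and whether its `G_a1G_b`-subcode is nevertheless
equivalent to some 2BGA code of order 16 is not decided here (qec HOME `lit/evidence/` carries a search). -/

namespace SylowS4

open Equiv

/-- `v₁ = (01)(23)`. [cite: LinPryadko2024, §IV.C Statement 8 hypotheses "N ≡ G_a ∩ G_b abelian and normal in both support groups" (arXiv:2306.16400 chunk p0010 L58–63)] -/
def v1 : Perm (Fin 4) := swap 0 1 * swap 2 3
/-- `v₂ = (02)(13)`. [cite: LinPryadko2024, §IV.C Statement 8 (arXiv:2306.16400 chunk p0010 L58–63)] -/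
def v2 : Perm (Fin 4) := swap 0 2 * swap 1 3
/-- `v₃ = (03)(12)`. [cite: LinPryadko2024, §IV.C Statement 8 (arXiv:2306.16400 chunk p0010 L58–63)] -/
def v3 : Perm (Fin 4) := swap 0 3 * swap 1 2
/-- `t_a = (02) ∈ G_a ∖ N`. [cite: LinPryadko2024, §IV.C Statement 8 (arXiv:2306.16400 chunk p0010 L58–63)] -/
def ta : Perm (Fin 4) := swap 0 2
/-- `t_b = (01) ∈ G_b ∖ N`. [cite: LinPryadko2024, §IV.C Statement 8 (arXiv:2306.16400 chunk p0010 L58–63)] -/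
def tb : Perm (Fin 4) := swap 0 1

/-- `G_a := C_{S₄}(v₂)`, a Sylow `2`-subgroup (`≅ D₈`: `V₄`, `(02)`, `(13)`, `(0123)^{±1}`).
[cite: LinPryadko2024, §IV.C Statement 8 (arXiv:2306.16400 chunk p0010 L58–63)] -/
def Ga : Subgroup (Perm (Fin 4)) := Subgroup.centralizer {v2}
/-- `G_b := C_{S₄}(v₁)`, another Sylow `2`-subgroup. [cite: LinPryadko2024, §IV.C Statement 8 (arXiv:2306.16400 chunk p0010 L58–63)] -/
def Gb : Subgroup (Perm (Fin 4)) := Subgroup.centralizer {v1}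

/-- membership in `G_a` is commuting with `v₂`. [cite: LinPryadko2024, §IV.C Statement 8 (arXiv:2306.16400 chunk p0010 L58–63)] -/
theorem mem_Ga_iff (g : Perm (Fin 4)) : g ∈ Ga ↔ v2 * g = g * v2 := by
  simp [Ga, Subgroup.mem_centralizer_iff]

/-- membership in `G_b` is commuting with `v₁`. [cite: LinPryadko2024, §IV.C Statement 8 (arXiv:2306.16400 chunk p0010 L58–63)] -/
theorem mem_Gb_iff (g : Perm (Fin 4)) : g ∈ Gb ↔ v1 * g = g * v1 := by
  simp [Gb, Subgroup.mem_centralizer_iff]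

/-- `v₁ ∈ G_a`. [cite: LinPryadko2024, §IV.C Statement 8 (arXiv:2306.16400 chunk p0010 L58–63)] -/
theorem v1_mem_Ga : v1 ∈ Ga := (mem_Ga_iff _).2 (by decide)
/-- `v₂ ∈ G_a`. [cite: LinPryadko2024, §IV.C Statement 8 (arXiv:2306.16400 chunk p0010 L58–63)] -/
theorem v2_mem_Ga : v2 ∈ Ga := (mem_Ga_iff _).2 (by decide)
/-- `v₃ ∈ G_a`. [cite: LinPryadko2024, §IV.C Statement 8 (arXiv:2306.16400 chunk p0010 L58–63)] -/
theorem v3_mem_Ga : v3 ∈ Ga := (mem_Ga_iff _).2 (by decide)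
/-- `t_a ∈ G_a`. [cite: LinPryadko2024, §IV.C Statement 8 (arXiv:2306.16400 chunk p0010 L58–63)] -/
theorem ta_mem_Ga : ta ∈ Ga := (mem_Ga_iff _).2 (by decide)
/-- `v₁ ∈ G_b`. [cite: LinPryadko2024, §IV.C Statement 8 (arXiv:2306.16400 chunk p0010 L58–63)] -/
theorem v1_mem_Gb : v1 ∈ Gb := (mem_Gb_iff _).2 (by decide)
/-- `v₂ ∈ G_b`. [cite: LinPryadko2024, §IV.C Statement 8 (arXiv:2306.16400 chunk p0010 L58–63)] -/
theorem v2_mem_Gb : v2 ∈ Gb := (mem_Gb_iff _).2 (by decide)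
/-- `v₃ ∈ G_b`. [cite: LinPryadko2024, §IV.C Statement 8 (arXiv:2306.16400 chunk p0010 L58–63)] -/
theorem v3_mem_Gb : v3 ∈ Gb := (mem_Gb_iff _).2 (by decide)
/-- `t_b ∈ G_b`. [cite: LinPryadko2024, §IV.C Statement 8 (arXiv:2306.16400 chunk p0010 L58–63)] -/
theorem tb_mem_Gb : tb ∈ Gb := (mem_Gb_iff _).2 (by decide)

/-- **The printed hypotheses hold.** `N = G_a ∩ G_b = V₄ = {1, v₁, v₂, v₃}`.
[cite: LinPryadko2024, §IV.C Statement 8 "the intersection subgroup N ≡ G_a ∩ G_b" (arXiv:2306.16400 chunk p0010 L58–63)] -/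
theorem mem_inter_iff (g : Perm (Fin 4)) : (g ∈ Ga ∧ g ∈ Gb) ↔ (g = 1 ∨ g = v1 ∨ g = v2 ∨ g = v3) := by
  rw [mem_Ga_iff, mem_Gb_iff]
  revert g
  decide

/-- `N` is abelian. [cite: LinPryadko2024, §IV.C Statement 8 "N … is abelian" (arXiv:2306.16400 chunk p0010 L58–63)] -/
theorem inter_comm (g h : Perm (Fin 4)) (hg : g ∈ Ga ∧ g ∈ Gb) (hh : h ∈ Ga ∧ h ∈ Gb) : g * h = h * g := by
  rw [mem_inter_iff] at hg hh
  rcases hg with rfl | rfl | rfl | rfl <;> rcases hh with rfl | rfl | rfl | rfl <;> decide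

/-- `N` is normal in `G_a`. [cite: LinPryadko2024, §IV.C Statement 8 "normal in both support groups" (arXiv:2306.16400 chunk p0010 L58–63)] -/
theorem inter_normal_left (p n : Perm (Fin 4)) (hp : p ∈ Ga) (hn : n ∈ Ga ∧ n ∈ Gb) :
    p * n * p⁻¹ ∈ Ga ∧ p * n * p⁻¹ ∈ Gb := by
  rw [mem_inter_iff] at hn ⊢
  rw [mem_Ga_iff] at hp
  revert hp; revert p
  rcases hn with rfl | rfl | rfl | rfl <;> decide

/-- `N` is normal in `G_b`. [cite: LinPryadko2024, §IV.C Statement 8 "normal in both support groups" (arXiv:2306.16400 chunk p0010 L58–63)] -/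
theorem inter_normal_right (p n : Perm (Fin 4)) (hp : p ∈ Gb) (hn : n ∈ Ga ∧ n ∈ Gb) :
    p * n * p⁻¹ ∈ Ga ∧ p * n * p⁻¹ ∈ Gb := by
  rw [mem_inter_iff] at hn ⊢
  rw [mem_Gb_iff] at hp
  revert hp; revert p
  rcases hn with rfl | rfl | rfl | rfl <;> decide

/-- … but `N` is central in neither: `t_a v₁ ≠ v₁ t_a`, `t_b v₂ ≠ v₂ t_b`.
[cite: LinPryadko2024, §IV.C Statement 8 (arXiv:2306.16400 chunk p0010 L58–63)] -/
theorem inter_not_central : ta * v1 ≠ v1 * ta ∧ tb * v2 ≠ v2 * tb := by decide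

/-- The product set `G_aG_b` is not a subgroup: `t_a t_b ∈ G_aG_b` but `(t_a t_b)² ∉ G_aG_b`
(indeed `|G_aG_b| = 8·8/4 = 16 ∤ 24`). [cite: LinPryadko2024, §IV.C Statement 8 (arXiv:2306.16400 chunk p0010 L58–63)] -/
theorem sq_not_mem_prod : ¬ ∃ α, α ∈ Ga ∧ ∃ β, β ∈ Gb ∧ α * β = (ta * tb) * (ta * tb) := by
  simp only [mem_Ga_iff, mem_Gb_iff]
  decide

/-- the two conjugations used: `t_a v₁ t_a⁻¹ = v₃`, `t_b v₃ t_b⁻¹ = v₂`, and `v₁ ≠ v₂`. [folklore] -/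
private theorem conj_facts : ta * v1 * ta⁻¹ = v3 ∧ tb * v3 * tb⁻¹ = v2 ∧ v1 ≠ v2 := by decide

/-- ★ **No exact amalgam exists for `(G_a, G_b)`** — in particular no central amalgam and no group produced by
any reading of the printed construction: for every group `G'` and homomorphisms `ιa : G_a → G'`, `ιb : G_b → G'`,
`¬ IsAmalgam G_a G_b ιa ιb`. Proof: `ιb(t_b)ιa(t_a) = ιa(α)ιb(β)` (generation) conjugates `ι(v₁)` to `ι(v₂)`
on the left side but to `ι(α v₁ α⁻¹)` on the right side (`β ∈ C(v₁)`), and `α v₁ α⁻¹ = v₂` is impossible for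
`α ∈ C(v₂)` since `v₁ ≠ v₂`. [cite: LinPryadko2024, §IV.C Statement 8 "equivalent to a 2BGA code over a group G' of rank |G_a 1 G_b|" (arXiv:2306.16400 chunk p0010 L58–63) — the hypotheses hold here (`mem_inter_iff`, `inter_comm`, `inter_normal_left/right`), no `G' ⊇ G_a, G_b` exists] -/
theorem not_isAmalgam {G' : Type*} [Group G'] (ιa : Ga →* G') (ιb : Gb →* G') : ¬ IsAmalgam Ga Gb ιa ιb := by
  intro h
  obtain ⟨hc1, hc2, hne⟩ := conj_facts
  obtain ⟨α, β, hαβ⟩ := h.surj (ιb ⟨tb, tb_mem_Gb⟩ * ιa ⟨ta, ta_mem_Ga⟩)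
  -- left side: conjugation by `ιb t_b · ιa t_a` sends `ιa v₁` to `ιa v₂`
  have hA : ιa ⟨ta, ta_mem_Ga⟩ * ιa ⟨v1, v1_mem_Ga⟩ * (ιa ⟨ta, ta_mem_Ga⟩)⁻¹ = ιa ⟨v3, v3_mem_Ga⟩ := by
    rw [← map_inv, ← map_mul, ← map_mul]
    congr 1
    exact Subtype.ext (by simpa using hc1)
  have hB : ιb ⟨tb, tb_mem_Gb⟩ * ιb ⟨v3, v3_mem_Gb⟩ * (ιb ⟨tb, tb_mem_Gb⟩)⁻¹ = ιb ⟨v2, v2_mem_Gb⟩ := by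
    rw [← map_inv, ← map_mul, ← map_mul]
    congr 1
    exact Subtype.ext (by simpa using hc2)
  have lhs : (ιb ⟨tb, tb_mem_Gb⟩ * ιa ⟨ta, ta_mem_Ga⟩) * ιa ⟨v1, v1_mem_Ga⟩ *
      (ιb ⟨tb, tb_mem_Gb⟩ * ιa ⟨ta, ta_mem_Ga⟩)⁻¹ = ιa ⟨v2, v2_mem_Ga⟩ := by
    calc (ιb ⟨tb, tb_mem_Gb⟩ * ιa ⟨ta, ta_mem_Ga⟩) * ιa ⟨v1, v1_mem_Ga⟩ * (ιb ⟨tb, tb_mem_Gb⟩ * ιa ⟨ta, ta_mem_Ga⟩)⁻¹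
        = ιb ⟨tb, tb_mem_Gb⟩ * (ιa ⟨ta, ta_mem_Ga⟩ * ιa ⟨v1, v1_mem_Ga⟩ * (ιa ⟨ta, ta_mem_Ga⟩)⁻¹) *
            (ιb ⟨tb, tb_mem_Gb⟩)⁻¹ := by group
      _ = ιb ⟨tb, tb_mem_Gb⟩ * ιb ⟨v3, v3_mem_Gb⟩ * (ιb ⟨tb, tb_mem_Gb⟩)⁻¹ := by
            rw [hA, h.agree v3 v3_mem_Ga v3_mem_Gb]
      _ = ιa ⟨v2, v2_mem_Ga⟩ := by rw [hB, ← h.agree v2 v2_mem_Ga v2_mem_Gb]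
  -- right side: conjugation by `ιa α · ιb β` sends `ιa v₁` to `ιa (α v₁ α⁻¹)` (`β` centralises `v₁`)
  have hβ : ιb β * ιb ⟨v1, v1_mem_Gb⟩ * (ιb β)⁻¹ = ιb ⟨v1, v1_mem_Gb⟩ := by
    rw [← map_inv, ← map_mul, ← map_mul]
    congr 1
    apply Subtype.ext
    have := (mem_Gb_iff _).1 β.2
    simp only [Subgroup.coe_mul, Subgroup.coe_inv]
    rw [← this, mul_inv_cancel_right]
  have rhs : (ιa α * ιb β) * ιa ⟨v1, v1_mem_Ga⟩ * (ιa α * ιb β)⁻¹ = ιa (α * ⟨v1, v1_mem_Ga⟩ * α⁻¹) := by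
    calc (ιa α * ιb β) * ιa ⟨v1, v1_mem_Ga⟩ * (ιa α * ιb β)⁻¹
        = ιa α * (ιb β * ιa ⟨v1, v1_mem_Ga⟩ * (ιb β)⁻¹) * (ιa α)⁻¹ := by group
      _ = ιa α * ιa ⟨v1, v1_mem_Ga⟩ * (ιa α)⁻¹ := by rw [h.agree v1 v1_mem_Ga v1_mem_Gb, hβ]
      _ = ιa (α * ⟨v1, v1_mem_Ga⟩ * α⁻¹) := by rw [map_mul, map_mul, map_inv]
  rw [hαβ, lhs] at rhs
  have key := congrArg Subtype.val (h.injective_left rhs)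
  simp only [Subgroup.coe_mul, Subgroup.coe_inv] at key
  -- `α ∈ C(v₂)`: `v₂ = α v₁ α⁻¹ ⇒ v₁ = α⁻¹ v₂ α = v₂`
  have hα := (mem_Ga_iff _).1 α.2
  apply hne
  calc v1 = (α : Perm (Fin 4))⁻¹ * ((α : Perm (Fin 4)) * v1 * (α : Perm (Fin 4))⁻¹) * α := by group
    _ = (α : Perm (Fin 4))⁻¹ * v2 * α := by rw [← key]
    _ = (α : Perm (Fin 4))⁻¹ * (v2 * α) := by rw [mul_assoc]
    _ = v2 := by rw [hα, ← mul_assoc, inv_mul_cancel, one_mul]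

/-- Corollary: in particular `(G_a, G_b)` has no CENTRAL amalgam (the object of §B), although `N` is abelian and
normal in both. [cite: LinPryadko2024, §IV.C Statement 8 (arXiv:2306.16400 chunk p0010 L58–63)] -/
theorem not_isCentralAmalgam {G' : Type*} [Group G'] (ιa : Ga →* G') (ιb : Gb →* G') :
    ¬ IsCentralAmalgam Ga Gb ιa ιb := fun h => not_isAmalgam ιa ιb h.isAmalgam

end SylowS4

/-! #### §E′. The printed data literally: coefficient vectors `a`, `b` whose SUPPORT GROUPS are `G_a`, `G_b` -/

namespace SylowS4

open Equiv

/-- `a = 1 + (13) + (01)(23) + (02) ∈ 𝔽₂[S₄]` (a weight-4 element with `⟨supp a⟩ = G_a`; with `b` below the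
`G_a1G_b`-subcode of `LP[a,b]` is a `[[32,8,4]]` code — qec HOME `lit/evidence/`, not claimed in the kernel).
[cite: LinPryadko2024, §IV.C Statement 8 "support groups" (arXiv:2306.16400 chunk p0010 L58–63)] -/
def aS (g : Perm (Fin 4)) : ZMod 2 := if g = 1 ∨ g = swap 1 3 ∨ g = v1 ∨ g = ta then 1 else 0

/-- `b = 1 + (23) + (02)(13) + (03)(12) ∈ 𝔽₂[S₄]`, `⟨supp b⟩ = G_b`. [cite: LinPryadko2024, §IV.C Statement 8 "support groups" (arXiv:2306.16400 chunk p0010 L58–63)] -/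
def bS (g : Perm (Fin 4)) : ZMod 2 := if g = 1 ∨ g = swap 2 3 ∨ g = v2 ∨ g = v3 then 1 else 0

/-- `supp a ⊆ G_a` (the hypothesis `ha` of `dcSubcode`). [cite: LinPryadko2024, §IV.C Statement 8 (arXiv:2306.16400 chunk p0010 L58–63)] -/
theorem aS_supp (g : Perm (Fin 4)) (hg : aS g ≠ 0) : g ∈ Ga := by
  rw [mem_Ga_iff]
  unfold aS at hg
  split_ifs at hg with h
  · rcases h with rfl | rfl | rfl | rfl <;> decide
  · exact absurd rfl hg

/-- `supp b ⊆ G_b`. [cite: LinPryadko2024, §IV.C Statement 8 (arXiv:2306.16400 chunk p0010 L58–63)] -/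
theorem bS_supp (g : Perm (Fin 4)) (hg : bS g ≠ 0) : g ∈ Gb := by
  rw [mem_Gb_iff]
  unfold bS at hg
  split_ifs at hg with h
  · rcases h with rfl | rfl | rfl | rfl <;> decide
  · exact absurd rfl hg

/-- the eight elements of `G_a` as words in `supp a`. [folklore] -/
private theorem mem_Ga_cases (g : Perm (Fin 4)) (hg : g ∈ Ga) :
    g = 1 ∨ g = v1 ∨ g = swap 1 3 * ta ∨ g = v1 * (swap 1 3 * ta) ∨ g = ta ∨ g = swap 1 3 ∨ g = ta * v1 ∨
      g = v1 * ta := by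
  have := (mem_Ga_iff g).1 hg
  clear hg
  revert this; revert g
  decide

/-- the eight elements of `G_b` as words in `supp b`. [folklore] -/
private theorem mem_Gb_cases (g : Perm (Fin 4)) (hg : g ∈ Gb) :
    g = 1 ∨ g = v2 ∨ g = v3 ∨ g = v2 * v3 ∨ g = swap 2 3 ∨ g = swap 2 3 * v2 ∨ g = swap 2 3 * v3 ∨
      g = swap 2 3 * (v2 * v3) := by
  have := (mem_Gb_iff g).1 hg
  clear hg
  revert this; revert g
  decide

/-- ★ **`⟨supp a⟩ = G_a`**: the support group of `a` IS the Sylow subgroup `G_a` of §E.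
[cite: LinPryadko2024, §IV.C Statement 8 "support groups" (arXiv:2306.16400 chunk p0010 L58–63)] -/
theorem suppGroup_aS : suppGroup aS = Ga := by
  apply le_antisymm
  · exact (Subgroup.closure_le _).2 fun g hg => aS_supp g hg
  · intro g hg
    have h13 : swap (1 : Fin 4) 3 ∈ suppGroup aS := mem_suppGroup_of_ne_zero (by decide)
    have hv1 : v1 ∈ suppGroup aS := mem_suppGroup_of_ne_zero (by decide)
    have hta : ta ∈ suppGroup aS := mem_suppGroup_of_ne_zero (by decide)
    rcases mem_Ga_cases g hg with rfl | rfl | rfl | rfl | rfl | rfl | rfl | rfl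
    · exact one_mem _
    · exact hv1
    · exact mul_mem h13 hta
    · exact mul_mem hv1 (mul_mem h13 hta)
    · exact hta
    · exact h13
    · exact mul_mem hta hv1
    · exact mul_mem hv1 hta

/-- ★ **`⟨supp b⟩ = G_b`.** [cite: LinPryadko2024, §IV.C Statement 8 "support groups" (arXiv:2306.16400 chunk p0010 L58–63)] -/
theorem suppGroup_bS : suppGroup bS = Gb := by
  apply le_antisymm
  · exact (Subgroup.closure_le _).2 fun g hg => bS_supp g hg
  · intro g hg
    have h23 : swap (2 : Fin 4) 3 ∈ suppGroup bS := mem_suppGroup_of_ne_zero (by decide)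
    have hv2 : v2 ∈ suppGroup bS := mem_suppGroup_of_ne_zero (by decide)
    have hv3 : v3 ∈ suppGroup bS := mem_suppGroup_of_ne_zero (by decide)
    rcases mem_Gb_cases g hg with rfl | rfl | rfl | rfl | rfl | rfl | rfl | rfl
    · exact one_mem _
    · exact hv2
    · exact hv3
    · exact mul_mem hv2 hv3
    · exact h23
    · exact mul_mem h23 hv2
    · exact mul_mem h23 hv3
    · exact mul_mem h23 (mul_mem hv2 hv3)

/-- Hence, verbatim in the printed vocabulary: for `LP[a,b]` over `S₄` with these `a`, `b`, the intersection of
the SUPPORT GROUPS is abelian and normal in both support groups (Statement 8's hypotheses), and no exact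
amalgam of the support groups exists (`not_isAmalgam`). [cite: LinPryadko2024, §IV.C Statement 8 (arXiv:2306.16400 chunk p0010 L58–63)] -/
theorem statement8_hypotheses_no_amalgam :
    suppGroup aS = Ga ∧ suppGroup bS = Gb ∧
    (∀ g h, (g ∈ Ga ∧ g ∈ Gb) → (h ∈ Ga ∧ h ∈ Gb) → g * h = h * g) ∧
    (∀ p n, p ∈ Ga → (n ∈ Ga ∧ n ∈ Gb) → (p * n * p⁻¹ ∈ Ga ∧ p * n * p⁻¹ ∈ Gb)) ∧
    (∀ p n, p ∈ Gb → (n ∈ Ga ∧ n ∈ Gb) → (p * n * p⁻¹ ∈ Ga ∧ p * n * p⁻¹ ∈ Gb)) ∧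
    (∀ (G' : Type) [Group G'] (ιa : Ga →* G') (ιb : Gb →* G'), ¬ IsAmalgam Ga Gb ιa ιb) :=
  ⟨suppGroup_aS, suppGroup_bS, inter_comm, inter_normal_left, inter_normal_right,
    fun _ _ ιa ιb => not_isAmalgam ιa ιb⟩

end SylowS4

/-! ### §F. Kernel certificate: for the pair of §E, Statement 8's CONCLUSION nevertheless holds — the
`G_a1G_b`-subcode of `LP[a,b]` IS (permutation-equivalent to) the ABELIAN two-block code `LP[a′,b′]` over
`G′ = ℤ₄ × ℤ₂ × ℤ₂`, `|G′| = 16 = |G_a1G_b|`, a group containing neither `G_a` nor `G_b`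
Explicit relabelling of the 16 checks and 32 qubits of the subcode (`dTab`, `qTabL`, `qTabR`), explicit
`a′ = {e, (0,1,1), (1,0,1), (3,1,0)}`, `b′ = {e, (0,1,0), (2,0,0), (2,1,1)}` (as `aTab`, `bTab` in the index
`n = 4i+2j+k` of `(i,j,k) ∈ ℤ₄×ℤ₂×ℤ₂`), and explicit change-of-basis matrices (`uX`, `vX`, `uZ`, `vZ`) between
the two stabiliser bases, all checked by `decide`; found by a search over the semiregular abelian subgroups of
the subcode's automorphism group (qec HOME `lit/evidence/lp24_st8_s4sylow_lit3g7/`). -/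

end TwoBlockGA

namespace CSSCode

variable {RX RZ RX' RZ' Q : Type*} [Fintype Q] [DecidableEq Q] [Fintype RX] [Fintype RZ] [Fintype RX'] [Fintype RZ']

omit [DecidableEq Q] [Fintype Q] in
/-- `A = U·B ⇒ rs A ≤ rs B`. [cite: LinPryadko2024, §IV.B Thm 6 "equivalent" = same stabiliser spaces up to qubit relabelling (arXiv:2306.16400 chunk p0009 L66–74)] -/
theorem rowSpace_le_of_eq_mul {R R' : Type*} [Fintype R] [Fintype R'] {A : Matrix R Q (ZMod 2)}
    {B : Matrix R' Q (ZMod 2)} (U : Matrix R R' (ZMod 2)) (h : A = U * B) : rowSpace A ≤ rowSpace B := by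
  intro v hv
  obtain ⟨c, rfl⟩ := (mem_rowSpace_iff A v).1 hv
  exact (mem_rowSpace_iff B _).2 ⟨c ᵥ* U, by rw [h, Matrix.vecMul_vecMul]⟩

omit [DecidableEq Q] in
/-- ★ **Same stabiliser spaces ⇒ same `k`, `d^X`, `d^Z`** (two presentations of one code on the same qubits).
[cite: LinPryadko2024, §IV.B Thm 6 (arXiv:2306.16400 chunk p0009 L66–74)] -/
theorem params_eq_of_rowSpace_eq (C : CSSCode RX RZ Q) (C' : CSSCode RX' RZ' Q)
    (hX : rowSpace C.HX = rowSpace C'.HX) (hZ : rowSpace C.HZ = rowSpace C'.HZ) :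
    C.k = C'.k ∧ C.dX = C'.dX ∧ C.dZ = C'.dZ := by
  have hkZ : C.kerZ = C'.kerZ := pcCode_eq_of_rowSpace_eq hZ
  have hkX : C.kerX = C'.kerX := pcCode_eq_of_rowSpace_eq hX
  have hrX : C.rowSpX = C'.rowSpX := hX
  have hrZ : C.rowSpZ = C'.rowSpZ := hZ
  refine ⟨?_, ?_, ?_⟩
  · rw [CSSCode.k, CSSCode.k, hkZ, hrX]
  · rw [CSSCode.dX, CSSCode.dX, hkZ, hrX]
  · rw [CSSCode.dZ_eq, CSSCode.dZ_eq, hkX, hrZ]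

end CSSCode

namespace TwoBlockGA

namespace SylowS4

open Equiv Matrix

/-- the 16 elements of the identity double coset `G_aG_b ⊂ S₄` (check-row labels of `S16`); data of the
relabelling certificate. [cite: LinPryadko2024, §IV.C Statement 8 (arXiv:2306.16400 chunk p0010 L58–63)] -/
def dTab : Fin 16 → Perm (Fin 4) :=
  ![1, swap 2 3, swap 1 3 * swap 3 2, swap 1 3, swap 0 1, swap 0 1 * swap 2 3, swap 0 1 * swap 1 2, swap 0 1 * swap 1 2 * swap 2 3, swap 0 2, swap 0 2 * swap 2 3, swap 0 2 * swap 1 3, swap 0 2 * swap 2 1 * swap 1 3, swap 0 3 * swap 3 2 * swap 2 1, swap 0 3 * swap 3 1, swap 0 3 * swap 3 1 * swap 1 2, swap 0 3 * swap 1 2]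

/-- left-qubit labels: `inl m ↦ L_(qTabL m)` (certificate data). [cite: LinPryadko2024, §IV.C Statement 8 (arXiv:2306.16400 chunk p0010 L58–63)] -/
def qTabL : Fin 16 → Perm (Fin 4) :=
  ![1, swap 0 1, swap 2 3, swap 0 1 * swap 2 3, swap 0 2 * swap 2 3, swap 0 1 * swap 1 2 * swap 2 3, swap 1 3, swap 0 3 * swap 3 1, swap 0 3 * swap 1 2, swap 0 2 * swap 2 1 * swap 1 3, swap 0 3 * swap 3 1 * swap 1 2, swap 0 2 * swap 1 3, swap 0 1 * swap 1 2, swap 0 2, swap 0 3 * swap 3 2 * swap 2 1, swap 1 3 * swap 3 2]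

/-- right-qubit labels: `inr m ↦ R_(qTabR m)` (certificate data). [cite: LinPryadko2024, §IV.C Statement 8 (arXiv:2306.16400 chunk p0010 L58–63)] -/
def qTabR : Fin 16 → Perm (Fin 4) :=
  ![1, swap 0 1, swap 2 3, swap 0 1 * swap 2 3, swap 0 1 * swap 1 2, swap 0 2, swap 0 3 * swap 3 2 * swap 2 1, swap 1 3 * swap 3 2, swap 0 3 * swap 1 2, swap 0 2 * swap 2 1 * swap 1 3, swap 0 3 * swap 3 1 * swap 1 2, swap 0 2 * swap 1 3, swap 0 2 * swap 2 3, swap 0 1 * swap 1 2 * swap 2 3, swap 1 3, swap 0 3 * swap 3 1]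

/-- `a′` as a table on the index `4i+2j+k` of `ℤ₄×ℤ₂×ℤ₂` (certificate data). [cite: LinPryadko2024, §IV.C Statement 8 (arXiv:2306.16400 chunk p0010 L58–63)] -/
def aTab : Fin 16 → ZMod 2 := ![1, 0, 0, 1, 0, 1, 0, 0, 0, 0, 0, 0, 0, 0, 1, 0]

/-- `b′` as a table (certificate data). [cite: LinPryadko2024, §IV.C Statement 8 (arXiv:2306.16400 chunk p0010 L58–63)] -/
def bTab : Fin 16 → ZMod 2 := ![1, 0, 1, 0, 0, 0, 0, 0, 1, 0, 0, 1, 0, 0, 0, 0]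

/-- the subcode's `H_X`, left block, in the certificate labelling (certificate data). [cite: LinPryadko2024, §IV.C Statement 8 (arXiv:2306.16400 chunk p0010 L58–63)] -/
def tXL : Matrix (Fin 16) (Fin 16) (ZMod 2) :=
  !![1, 0, 0, 1, 0, 0, 1, 0, 0, 0, 0, 0, 0, 1, 0, 0;
    0, 1, 1, 0, 1, 0, 0, 0, 0, 0, 0, 0, 0, 0, 0, 1;
    0, 0, 1, 0, 0, 0, 0, 0, 0, 1, 0, 0, 1, 0, 0, 1;
    1, 0, 0, 0, 0, 1, 1, 0, 0, 0, 0, 1, 0, 0, 0, 0;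
    0, 1, 1, 0, 0, 0, 0, 1, 0, 0, 0, 0, 1, 0, 0, 0;
    1, 0, 0, 1, 0, 1, 0, 0, 0, 0, 0, 0, 0, 0, 1, 0;
    0, 1, 0, 0, 0, 0, 0, 0, 0, 0, 1, 0, 1, 0, 0, 1;
    0, 0, 0, 1, 0, 1, 1, 0, 1, 0, 0, 0, 0, 0, 0, 0;
    1, 0, 0, 0, 0, 0, 0, 0, 0, 0, 0, 1, 0, 1, 1, 0;
    0, 0, 1, 0, 1, 0, 0, 1, 0, 1, 0, 0, 0, 0, 0, 0;
    0, 0, 0, 0, 0, 0, 1, 0, 1, 0, 0, 1, 0, 1, 0, 0;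
    0, 0, 0, 0, 1, 0, 0, 0, 0, 1, 1, 0, 0, 0, 0, 1;
    0, 0, 0, 1, 0, 0, 0, 0, 1, 0, 0, 0, 0, 1, 1, 0;
    0, 1, 0, 0, 1, 0, 0, 1, 0, 0, 1, 0, 0, 0, 0, 0;
    0, 0, 0, 0, 0, 0, 0, 1, 0, 1, 1, 0, 1, 0, 0, 0;
    0, 0, 0, 0, 0, 1, 0, 0, 1, 0, 0, 1, 0, 0, 1, 0]

/-- the subcode's `H_X`, right block (certificate data). [cite: LinPryadko2024, §IV.C Statement 8 (arXiv:2306.16400 chunk p0010 L58–63)] -/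
def tXR : Matrix (Fin 16) (Fin 16) (ZMod 2) :=
  !![1, 0, 1, 0, 0, 0, 0, 0, 1, 0, 0, 1, 0, 0, 0, 0;
    1, 0, 1, 0, 0, 0, 0, 0, 0, 1, 1, 0, 0, 0, 0, 0;
    0, 0, 0, 0, 1, 0, 0, 1, 0, 0, 0, 0, 1, 0, 1, 0;
    0, 0, 0, 0, 0, 1, 0, 1, 0, 0, 0, 0, 0, 1, 1, 0;
    0, 1, 0, 1, 0, 0, 0, 0, 0, 1, 1, 0, 0, 0, 0, 0;
    0, 1, 0, 1, 0, 0, 0, 0, 1, 0, 0, 1, 0, 0, 0, 0;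
    0, 0, 0, 0, 1, 0, 0, 1, 0, 0, 0, 0, 0, 1, 0, 1;
    0, 0, 0, 0, 1, 0, 1, 0, 0, 0, 0, 0, 0, 1, 1, 0;
    0, 0, 0, 0, 0, 1, 1, 0, 0, 0, 0, 0, 1, 0, 1, 0;
    0, 0, 0, 0, 0, 1, 0, 1, 0, 0, 0, 0, 1, 0, 0, 1;
    1, 0, 0, 1, 0, 0, 0, 0, 0, 1, 0, 1, 0, 0, 0, 0;
    0, 1, 1, 0, 0, 0, 0, 0, 0, 1, 0, 1, 0, 0, 0, 0;
    0, 0, 0, 0, 0, 1, 1, 0, 0, 0, 0, 0, 0, 1, 0, 1;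
    0, 0, 0, 0, 1, 0, 1, 0, 0, 0, 0, 0, 1, 0, 0, 1;
    0, 1, 1, 0, 0, 0, 0, 0, 1, 0, 1, 0, 0, 0, 0, 0;
    1, 0, 0, 1, 0, 0, 0, 0, 1, 0, 1, 0, 0, 0, 0, 0]

/-- the subcode's `H_Z`, left block (certificate data). [cite: LinPryadko2024, §IV.C Statement 8 (arXiv:2306.16400 chunk p0010 L58–63)] -/
def tZL : Matrix (Fin 16) (Fin 16) (ZMod 2) :=
  !![1, 0, 1, 0, 0, 0, 0, 0, 1, 0, 0, 1, 0, 0, 0, 0;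
    1, 0, 1, 0, 0, 0, 0, 0, 0, 1, 1, 0, 0, 0, 0, 0;
    0, 0, 0, 0, 1, 0, 1, 0, 0, 0, 0, 0, 1, 0, 0, 1;
    0, 0, 0, 0, 0, 1, 1, 0, 0, 0, 0, 0, 0, 1, 0, 1;
    0, 1, 0, 1, 0, 0, 0, 0, 0, 1, 1, 0, 0, 0, 0, 0;
    0, 1, 0, 1, 0, 0, 0, 0, 1, 0, 0, 1, 0, 0, 0, 0;
    0, 0, 0, 0, 0, 1, 0, 1, 0, 0, 0, 0, 1, 0, 0, 1;
    0, 0, 0, 0, 0, 1, 1, 0, 0, 0, 0, 0, 1, 0, 1, 0;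
    0, 0, 0, 0, 1, 0, 1, 0, 0, 0, 0, 0, 0, 1, 1, 0;
    0, 0, 0, 0, 1, 0, 0, 1, 0, 0, 0, 0, 0, 1, 0, 1;
    1, 0, 0, 1, 0, 0, 0, 0, 0, 1, 0, 1, 0, 0, 0, 0;
    0, 1, 1, 0, 0, 0, 0, 0, 0, 1, 0, 1, 0, 0, 0, 0;
    0, 0, 0, 0, 0, 1, 0, 1, 0, 0, 0, 0, 0, 1, 1, 0;
    0, 0, 0, 0, 1, 0, 0, 1, 0, 0, 0, 0, 1, 0, 1, 0;
    0, 1, 1, 0, 0, 0, 0, 0, 1, 0, 1, 0, 0, 0, 0, 0;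
    1, 0, 0, 1, 0, 0, 0, 0, 1, 0, 1, 0, 0, 0, 0, 0]

/-- the subcode's `H_Z`, right block (certificate data). [cite: LinPryadko2024, §IV.C Statement 8 (arXiv:2306.16400 chunk p0010 L58–63)] -/
def tZR : Matrix (Fin 16) (Fin 16) (ZMod 2) :=
  !![1, 0, 0, 1, 0, 1, 0, 0, 0, 0, 0, 0, 0, 0, 1, 0;
    0, 1, 1, 0, 0, 0, 0, 1, 0, 0, 0, 0, 1, 0, 0, 0;
    0, 0, 1, 0, 1, 0, 0, 1, 0, 1, 0, 0, 0, 0, 0, 0;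
    1, 0, 0, 0, 0, 0, 0, 0, 0, 0, 0, 1, 0, 1, 1, 0;
    0, 1, 1, 0, 1, 0, 0, 0, 0, 0, 0, 0, 0, 0, 0, 1;
    1, 0, 0, 1, 0, 0, 1, 0, 0, 0, 0, 0, 0, 1, 0, 0;
    0, 1, 0, 0, 1, 0, 0, 1, 0, 0, 1, 0, 0, 0, 0, 0;
    0, 0, 0, 1, 0, 0, 0, 0, 1, 0, 0, 0, 0, 1, 1, 0;
    1, 0, 0, 0, 0, 1, 1, 0, 0, 0, 0, 1, 0, 0, 0, 0;
    0, 0, 1, 0, 0, 0, 0, 0, 0, 1, 0, 0, 1, 0, 0, 1;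
    0, 0, 0, 0, 0, 1, 0, 0, 1, 0, 0, 1, 0, 0, 1, 0;
    0, 0, 0, 0, 0, 0, 0, 1, 0, 1, 1, 0, 1, 0, 0, 0;
    0, 0, 0, 1, 0, 1, 1, 0, 1, 0, 0, 0, 0, 0, 0, 0;
    0, 1, 0, 0, 0, 0, 0, 0, 0, 0, 1, 0, 1, 0, 0, 1;
    0, 0, 0, 0, 1, 0, 0, 0, 0, 1, 1, 0, 0, 0, 0, 1;
    0, 0, 0, 0, 0, 0, 1, 0, 1, 0, 0, 1, 0, 1, 0, 0]

/-- change of basis: subcode `X`-rows in terms of `LP[a′,b′]` `X`-rows (certificate data). [cite: LinPryadko2024, §IV.C Statement 8 (arXiv:2306.16400 chunk p0010 L58–63)] -/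
def uX : Matrix (Fin 16) (Fin 16) (ZMod 2) :=
  !![1, 0, 0, 0, 0, 0, 0, 0, 0, 0, 0, 0, 0, 0, 0, 0;
    0, 0, 1, 0, 0, 0, 0, 0, 0, 0, 0, 0, 0, 0, 0, 0;
    0, 0, 0, 0, 0, 0, 0, 0, 0, 0, 0, 0, 1, 0, 0, 0;
    0, 0, 0, 0, 0, 1, 0, 0, 0, 0, 0, 0, 0, 0, 0, 0;
    0, 1, 0, 0, 0, 0, 0, 0, 0, 0, 0, 0, 0, 0, 0, 0;
    0, 0, 0, 1, 0, 0, 0, 0, 0, 0, 0, 0, 0, 0, 0, 0;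
    1, 1, 1, 1, 1, 1, 0, 0, 0, 0, 0, 0, 0, 0, 1, 0;
    0, 0, 0, 0, 0, 0, 1, 0, 0, 0, 0, 0, 0, 0, 0, 0;
    0, 0, 0, 0, 0, 0, 0, 0, 0, 0, 0, 0, 0, 0, 1, 0;
    0, 0, 0, 0, 0, 0, 0, 1, 0, 0, 0, 0, 0, 0, 0, 0;
    1, 1, 0, 0, 1, 1, 1, 1, 0, 0, 1, 0, 0, 0, 0, 0;
    0, 0, 1, 1, 1, 1, 1, 1, 1, 0, 0, 0, 0, 0, 0, 0;
    1, 1, 1, 1, 0, 0, 1, 1, 0, 0, 0, 0, 1, 0, 0, 0;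
    0, 0, 0, 0, 1, 0, 0, 0, 0, 0, 0, 0, 0, 0, 0, 0;
    0, 0, 0, 0, 0, 0, 0, 0, 0, 0, 1, 0, 0, 0, 0, 0;
    0, 0, 0, 0, 0, 0, 0, 0, 1, 0, 0, 0, 0, 0, 0, 0]

/-- change of basis: `LP[a′,b′]` `X`-rows in terms of subcode `X`-rows (certificate data). [cite: LinPryadko2024, §IV.C Statement 8 (arXiv:2306.16400 chunk p0010 L58–63)] -/
def vX : Matrix (Fin 16) (Fin 16) (ZMod 2) :=
  !![1, 0, 0, 0, 0, 0, 0, 0, 0, 0, 0, 0, 0, 0, 0, 0;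
    0, 0, 0, 0, 1, 0, 0, 0, 0, 0, 0, 0, 0, 0, 0, 0;
    0, 1, 0, 0, 0, 0, 0, 0, 0, 0, 0, 0, 0, 0, 0, 0;
    0, 0, 0, 0, 0, 1, 0, 0, 0, 0, 0, 0, 0, 0, 0, 0;
    1, 1, 0, 1, 1, 1, 1, 0, 1, 0, 0, 0, 0, 0, 0, 0;
    0, 0, 0, 1, 0, 0, 0, 0, 0, 0, 0, 0, 0, 0, 0, 0;
    0, 0, 0, 0, 0, 0, 0, 1, 0, 0, 0, 0, 0, 0, 0, 0;
    0, 0, 0, 0, 0, 0, 0, 0, 0, 1, 0, 0, 0, 0, 0, 0;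
    1, 0, 0, 0, 1, 0, 1, 1, 1, 1, 0, 1, 0, 0, 0, 0;
    0, 0, 0, 0, 0, 0, 0, 0, 0, 0, 0, 1, 0, 0, 0, 0;
    0, 1, 0, 0, 0, 1, 1, 1, 1, 1, 1, 0, 0, 0, 0, 0;
    0, 0, 0, 0, 0, 0, 0, 0, 0, 0, 1, 0, 0, 0, 0, 0;
    0, 0, 1, 0, 0, 0, 0, 0, 0, 0, 0, 0, 0, 0, 0, 0;
    1, 1, 1, 0, 1, 1, 0, 1, 0, 1, 0, 0, 0, 0, 0, 0;
    0, 0, 0, 0, 0, 0, 0, 0, 1, 0, 0, 0, 0, 0, 0, 0;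
    0, 0, 0, 0, 0, 0, 1, 0, 0, 0, 0, 0, 0, 0, 0, 0]

/-- change of basis, `Z` side (certificate data). [cite: LinPryadko2024, §IV.C Statement 8 (arXiv:2306.16400 chunk p0010 L58–63)] -/
def uZ : Matrix (Fin 16) (Fin 16) (ZMod 2) :=
  !![1, 0, 0, 0, 0, 0, 0, 0, 0, 0, 0, 0, 0, 0, 0, 0;
    0, 0, 1, 0, 0, 0, 0, 0, 0, 0, 0, 0, 0, 0, 0, 0;
    0, 0, 0, 0, 1, 0, 0, 0, 0, 0, 0, 0, 0, 0, 0, 0;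
    1, 1, 1, 1, 0, 0, 1, 1, 0, 0, 0, 0, 1, 0, 0, 0;
    0, 1, 0, 0, 0, 0, 0, 0, 0, 0, 0, 0, 0, 0, 0, 0;
    0, 0, 0, 1, 0, 0, 0, 0, 0, 0, 0, 0, 0, 0, 0, 0;
    0, 0, 0, 0, 0, 0, 0, 1, 0, 0, 0, 0, 0, 0, 0, 0;
    0, 0, 0, 0, 0, 0, 0, 0, 0, 0, 0, 0, 0, 0, 1, 0;
    0, 0, 0, 0, 0, 0, 1, 0, 0, 0, 0, 0, 0, 0, 0, 0;
    1, 1, 1, 1, 1, 1, 0, 0, 0, 0, 0, 0, 0, 0, 1, 0;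
    1, 1, 0, 0, 1, 1, 1, 1, 0, 0, 1, 0, 0, 0, 0, 0;
    0, 0, 1, 1, 1, 1, 1, 1, 1, 0, 0, 0, 0, 0, 0, 0;
    0, 0, 0, 0, 0, 1, 0, 0, 0, 0, 0, 0, 0, 0, 0, 0;
    0, 0, 0, 0, 0, 0, 0, 0, 0, 0, 0, 0, 1, 0, 0, 0;
    0, 0, 0, 0, 0, 0, 0, 0, 0, 0, 1, 0, 0, 0, 0, 0;
    0, 0, 0, 0, 0, 0, 0, 0, 1, 0, 0, 0, 0, 0, 0, 0]

/-- change of basis, `Z` side, converse (certificate data). [cite: LinPryadko2024, §IV.C Statement 8 (arXiv:2306.16400 chunk p0010 L58–63)] -/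
def vZ : Matrix (Fin 16) (Fin 16) (ZMod 2) :=
  !![1, 0, 0, 0, 0, 0, 0, 0, 0, 0, 0, 0, 0, 0, 0, 0;
    0, 0, 0, 0, 1, 0, 0, 0, 0, 0, 0, 0, 0, 0, 0, 0;
    0, 1, 0, 0, 0, 0, 0, 0, 0, 0, 0, 0, 0, 0, 0, 0;
    0, 0, 0, 0, 0, 1, 0, 0, 0, 0, 0, 0, 0, 0, 0, 0;
    0, 0, 1, 0, 0, 0, 0, 0, 0, 0, 0, 0, 0, 0, 0, 0;
    1, 1, 1, 0, 1, 1, 0, 1, 0, 1, 0, 0, 0, 0, 0, 0;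
    0, 0, 0, 0, 0, 0, 0, 0, 1, 0, 0, 0, 0, 0, 0, 0;
    0, 0, 0, 0, 0, 0, 1, 0, 0, 0, 0, 0, 0, 0, 0, 0;
    1, 0, 0, 0, 1, 0, 1, 1, 1, 1, 0, 1, 0, 0, 0, 0;
    0, 0, 0, 0, 0, 0, 0, 0, 0, 0, 0, 1, 0, 0, 0, 0;
    0, 1, 0, 0, 0, 1, 1, 1, 1, 1, 1, 0, 0, 0, 0, 0;
    0, 0, 0, 0, 0, 0, 0, 0, 0, 0, 1, 0, 0, 0, 0, 0;
    1, 1, 0, 1, 1, 1, 1, 0, 1, 0, 0, 0, 0, 0, 0, 0;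
    0, 0, 0, 1, 0, 0, 0, 0, 0, 0, 0, 0, 0, 0, 0, 0;
    0, 0, 0, 0, 0, 0, 0, 1, 0, 0, 0, 0, 0, 0, 0, 0;
    0, 0, 0, 0, 0, 0, 0, 0, 0, 1, 0, 0, 0, 0, 0, 0]

/-- `H_X(LP[a′,b′])`, left block, in the index labelling (certificate data). [cite: LinPryadko2024, §IV.C Statement 8 (arXiv:2306.16400 chunk p0010 L58–63)] -/
def cXL : Matrix (Fin 16) (Fin 16) (ZMod 2) :=
  !![1, 0, 0, 1, 0, 0, 1, 0, 0, 0, 0, 0, 0, 1, 0, 0;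
    0, 1, 1, 0, 0, 0, 0, 1, 0, 0, 0, 0, 1, 0, 0, 0;
    0, 1, 1, 0, 1, 0, 0, 0, 0, 0, 0, 0, 0, 0, 0, 1;
    1, 0, 0, 1, 0, 1, 0, 0, 0, 0, 0, 0, 0, 0, 1, 0;
    0, 1, 0, 0, 1, 0, 0, 1, 0, 0, 1, 0, 0, 0, 0, 0;
    1, 0, 0, 0, 0, 1, 1, 0, 0, 0, 0, 1, 0, 0, 0, 0;
    0, 0, 0, 1, 0, 1, 1, 0, 1, 0, 0, 0, 0, 0, 0, 0;
    0, 0, 1, 0, 1, 0, 0, 1, 0, 1, 0, 0, 0, 0, 0, 0;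
    0, 0, 0, 0, 0, 1, 0, 0, 1, 0, 0, 1, 0, 0, 1, 0;
    0, 0, 0, 0, 1, 0, 0, 0, 0, 1, 1, 0, 0, 0, 0, 1;
    0, 0, 0, 0, 0, 0, 0, 1, 0, 1, 1, 0, 1, 0, 0, 0;
    0, 0, 0, 0, 0, 0, 1, 0, 1, 0, 0, 1, 0, 1, 0, 0;
    0, 0, 1, 0, 0, 0, 0, 0, 0, 1, 0, 0, 1, 0, 0, 1;
    0, 0, 0, 1, 0, 0, 0, 0, 1, 0, 0, 0, 0, 1, 1, 0;
    1, 0, 0, 0, 0, 0, 0, 0, 0, 0, 0, 1, 0, 1, 1, 0;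
    0, 1, 0, 0, 0, 0, 0, 0, 0, 0, 1, 0, 1, 0, 0, 1]

/-- `H_X(LP[a′,b′])`, right block (certificate data). [cite: LinPryadko2024, §IV.C Statement 8 (arXiv:2306.16400 chunk p0010 L58–63)] -/
def cXR : Matrix (Fin 16) (Fin 16) (ZMod 2) :=
  !![1, 0, 1, 0, 0, 0, 0, 0, 1, 0, 0, 1, 0, 0, 0, 0;
    0, 1, 0, 1, 0, 0, 0, 0, 0, 1, 1, 0, 0, 0, 0, 0;
    1, 0, 1, 0, 0, 0, 0, 0, 0, 1, 1, 0, 0, 0, 0, 0;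
    0, 1, 0, 1, 0, 0, 0, 0, 1, 0, 0, 1, 0, 0, 0, 0;
    0, 0, 0, 0, 1, 0, 1, 0, 0, 0, 0, 0, 1, 0, 0, 1;
    0, 0, 0, 0, 0, 1, 0, 1, 0, 0, 0, 0, 0, 1, 1, 0;
    0, 0, 0, 0, 1, 0, 1, 0, 0, 0, 0, 0, 0, 1, 1, 0;
    0, 0, 0, 0, 0, 1, 0, 1, 0, 0, 0, 0, 1, 0, 0, 1;
    1, 0, 0, 1, 0, 0, 0, 0, 1, 0, 1, 0, 0, 0, 0, 0;
    0, 1, 1, 0, 0, 0, 0, 0, 0, 1, 0, 1, 0, 0, 0, 0;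
    0, 1, 1, 0, 0, 0, 0, 0, 1, 0, 1, 0, 0, 0, 0, 0;
    1, 0, 0, 1, 0, 0, 0, 0, 0, 1, 0, 1, 0, 0, 0, 0;
    0, 0, 0, 0, 1, 0, 0, 1, 0, 0, 0, 0, 1, 0, 1, 0;
    0, 0, 0, 0, 0, 1, 1, 0, 0, 0, 0, 0, 0, 1, 0, 1;
    0, 0, 0, 0, 0, 1, 1, 0, 0, 0, 0, 0, 1, 0, 1, 0;
    0, 0, 0, 0, 1, 0, 0, 1, 0, 0, 0, 0, 0, 1, 0, 1]

/-- `H_Z(LP[a′,b′])`, left block (certificate data). [cite: LinPryadko2024, §IV.C Statement 8 (arXiv:2306.16400 chunk p0010 L58–63)] -/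
def cZL : Matrix (Fin 16) (Fin 16) (ZMod 2) :=
  !![1, 0, 1, 0, 0, 0, 0, 0, 1, 0, 0, 1, 0, 0, 0, 0;
    0, 1, 0, 1, 0, 0, 0, 0, 0, 1, 1, 0, 0, 0, 0, 0;
    1, 0, 1, 0, 0, 0, 0, 0, 0, 1, 1, 0, 0, 0, 0, 0;
    0, 1, 0, 1, 0, 0, 0, 0, 1, 0, 0, 1, 0, 0, 0, 0;
    0, 0, 0, 0, 1, 0, 1, 0, 0, 0, 0, 0, 1, 0, 0, 1;
    0, 0, 0, 0, 0, 1, 0, 1, 0, 0, 0, 0, 0, 1, 1, 0;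
    0, 0, 0, 0, 1, 0, 1, 0, 0, 0, 0, 0, 0, 1, 1, 0;
    0, 0, 0, 0, 0, 1, 0, 1, 0, 0, 0, 0, 1, 0, 0, 1;
    1, 0, 0, 1, 0, 0, 0, 0, 1, 0, 1, 0, 0, 0, 0, 0;
    0, 1, 1, 0, 0, 0, 0, 0, 0, 1, 0, 1, 0, 0, 0, 0;
    0, 1, 1, 0, 0, 0, 0, 0, 1, 0, 1, 0, 0, 0, 0, 0;
    1, 0, 0, 1, 0, 0, 0, 0, 0, 1, 0, 1, 0, 0, 0, 0;
    0, 0, 0, 0, 1, 0, 0, 1, 0, 0, 0, 0, 1, 0, 1, 0;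
    0, 0, 0, 0, 0, 1, 1, 0, 0, 0, 0, 0, 0, 1, 0, 1;
    0, 0, 0, 0, 0, 1, 1, 0, 0, 0, 0, 0, 1, 0, 1, 0;
    0, 0, 0, 0, 1, 0, 0, 1, 0, 0, 0, 0, 0, 1, 0, 1]

/-- `H_Z(LP[a′,b′])`, right block (certificate data). [cite: LinPryadko2024, §IV.C Statement 8 (arXiv:2306.16400 chunk p0010 L58–63)] -/
def cZR : Matrix (Fin 16) (Fin 16) (ZMod 2) :=
  !![1, 0, 0, 1, 0, 1, 0, 0, 0, 0, 0, 0, 0, 0, 1, 0;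
    0, 1, 1, 0, 1, 0, 0, 0, 0, 0, 0, 0, 0, 0, 0, 1;
    0, 1, 1, 0, 0, 0, 0, 1, 0, 0, 0, 0, 1, 0, 0, 0;
    1, 0, 0, 1, 0, 0, 1, 0, 0, 0, 0, 0, 0, 1, 0, 0;
    0, 0, 1, 0, 1, 0, 0, 1, 0, 1, 0, 0, 0, 0, 0, 0;
    0, 0, 0, 1, 0, 1, 1, 0, 1, 0, 0, 0, 0, 0, 0, 0;
    1, 0, 0, 0, 0, 1, 1, 0, 0, 0, 0, 1, 0, 0, 0, 0;
    0, 1, 0, 0, 1, 0, 0, 1, 0, 0, 1, 0, 0, 0, 0, 0;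
    0, 0, 0, 0, 0, 0, 1, 0, 1, 0, 0, 1, 0, 1, 0, 0;
    0, 0, 0, 0, 0, 0, 0, 1, 0, 1, 1, 0, 1, 0, 0, 0;
    0, 0, 0, 0, 1, 0, 0, 0, 0, 1, 1, 0, 0, 0, 0, 1;
    0, 0, 0, 0, 0, 1, 0, 0, 1, 0, 0, 1, 0, 0, 1, 0;
    0, 1, 0, 0, 0, 0, 0, 0, 0, 0, 1, 0, 1, 0, 0, 1;
    1, 0, 0, 0, 0, 0, 0, 0, 0, 0, 0, 1, 0, 1, 1, 0;
    0, 0, 0, 1, 0, 0, 0, 0, 1, 0, 0, 0, 0, 1, 1, 0;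
    0, 0, 1, 0, 0, 0, 0, 0, 0, 1, 0, 0, 1, 0, 0, 1]

set_option maxHeartbeats 1000000 in
set_option maxRecDepth 100000 in
/-- membership in the identity double coset `G_aG_b`, decided. [cite: LinPryadko2024, §IV.C Statement 8 (arXiv:2306.16400 chunk p0010 L58–63)] -/
theorem mem_D_iff (y : Perm (Fin 4)) : dcMk Ga Gb y = dcMk Ga Gb 1 ↔ ∃ i : Fin 16, dTab i = y := by
  rw [dcMk_eq_iff]
  simp only [mem_Ga_iff, mem_Gb_iff]
  revert y
  decide

/-- `dTab i ∈ G_aG_b`. [cite: LinPryadko2024, §IV.C Statement 8 (arXiv:2306.16400 chunk p0010 L58–63)] -/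
theorem dTab_mem (i : Fin 16) : dcMk Ga Gb (dTab i) = dcMk Ga Gb 1 := (mem_D_iff _).2 ⟨i, rfl⟩
/-- `qTabL m ∈ G_aG_b`. [cite: LinPryadko2024, §IV.C Statement 8 (arXiv:2306.16400 chunk p0010 L58–63)] -/
theorem qTabL_mem (m : Fin 16) : dcMk Ga Gb (qTabL m) = dcMk Ga Gb 1 :=
  (mem_D_iff _).2 (by revert m; decide)
/-- `qTabR m ∈ G_aG_b`. [cite: LinPryadko2024, §IV.C Statement 8 (arXiv:2306.16400 chunk p0010 L58–63)] -/
theorem qTabR_mem (m : Fin 16) : dcMk Ga Gb (qTabR m) = dcMk Ga Gb 1 :=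
  (mem_D_iff _).2 (by revert m; decide)

/-- check relabelling `Fin 16 ≃ G_a1G_b`. [cite: LinPryadko2024, §IV.C Statement 8 (arXiv:2306.16400 chunk p0010 L58–63)] -/
noncomputable def eR : Fin 16 ≃ {x : Perm (Fin 4) // dcMk Ga Gb x = dcMk Ga Gb 1} :=
  Equiv.ofBijective (fun i => ⟨dTab i, dTab_mem i⟩) (by
    constructor
    · intro i j h
      have h' : dTab i = dTab j := congrArg Subtype.val h
      revert h'; revert i j; decide
    · rintro ⟨y, hy⟩
      obtain ⟨i, hi⟩ := (mem_D_iff y).1 hy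
      exact ⟨i, Subtype.ext hi⟩)

/-- qubit relabelling `Fin 16 ⊕ Fin 16 ≃ (L ⊔ R)-qubits of G_a1G_b`. [cite: LinPryadko2024, §IV.C Statement 8 (arXiv:2306.16400 chunk p0010 L58–63)] -/
noncomputable def eQ : Fin 16 ⊕ Fin 16 ≃
    {q : Perm (Fin 4) ⊕ Perm (Fin 4) // Sum.elim (dcMk Ga Gb) (dcMk Ga Gb) q = dcMk Ga Gb 1} :=
  Equiv.ofBijective
    (Sum.elim (fun m => ⟨Sum.inl (qTabL m), qTabL_mem m⟩) (fun m => ⟨Sum.inr (qTabR m), qTabR_mem m⟩)) (by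
    constructor
    · rintro (i | i) (j | j) h
      · have h' : qTabL i = qTabL j := by simpa using congrArg Subtype.val h
        revert h'; revert i j; decide
      · simpa using congrArg Subtype.val h
      · simpa using congrArg Subtype.val h
      · have h' : qTabR i = qTabR j := by simpa using congrArg Subtype.val h
        revert h'; revert i j; decide
    · rintro ⟨y | y, hy⟩
      · obtain ⟨i, hi⟩ := (mem_D_iff y).1 hy
        have hall : ∀ i : Fin 16, ∃ m : Fin 16, qTabL m = dTab i := by decide
        obtain ⟨m, hm⟩ := hall i
        exact ⟨Sum.inl m, Subtype.ext (by simp [hm, hi])⟩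
      · obtain ⟨i, hi⟩ := (mem_D_iff y).1 hy
        have hall : ∀ i : Fin 16, ∃ m : Fin 16, qTabR m = dTab i := by decide
        obtain ⟨m, hm⟩ := hall i
        exact ⟨Sum.inr m, Subtype.ext (by simp [hm, hi])⟩)

set_option maxHeartbeats 1000000 in
set_option maxRecDepth 100000 in
/-- The subcode re-presented on `Fin 16 ⊔ (Fin 16 ⊕ Fin 16)` (literal tables).
[cite: LinPryadko2024, §IV.C Statement 8 (arXiv:2306.16400 chunk p0010 L58–63)] -/
def S16 : CSSCode (Fin 16) (Fin 16) (Fin 16 ⊕ Fin 16) where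
  HX := Matrix.of fun i q => Sum.elim (tXL i) (tXR i) q
  HZ := Matrix.of fun i q => Sum.elim (tZL i) (tZR i) q
  comm := by decide

set_option maxHeartbeats 1000000 in
set_option maxRecDepth 100000 in
/-- `S16.HX`, left block, IS `H_X(LP[a,b])` restricted along `dTab`/`qTabL` (entrywise `decide`; stated in
applied form so that no symbolic unfolding of the literal tables is ever needed). [cite: LinPryadko2024, §IV.C Statement 8 (arXiv:2306.16400 chunk p0010 L58–63)] -/
theorem S16_HX_inl : ∀ i m : Fin 16,
    S16.HX i (Sum.inl m) = (HX aS bS).submatrix dTab (Sum.map qTabL qTabR) i (Sum.inl m) := by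
  decide

set_option maxHeartbeats 1000000 in
set_option maxRecDepth 100000 in
/-- `S16.HX`, right block. [cite: LinPryadko2024, §IV.C Statement 8 (arXiv:2306.16400 chunk p0010 L58–63)] -/
theorem S16_HX_inr : ∀ i m : Fin 16,
    S16.HX i (Sum.inr m) = (HX aS bS).submatrix dTab (Sum.map qTabL qTabR) i (Sum.inr m) := by
  decide

set_option maxHeartbeats 1000000 in
set_option maxRecDepth 100000 in
/-- `S16.HZ`, left block. [cite: LinPryadko2024, §IV.C Statement 8 (arXiv:2306.16400 chunk p0010 L58–63)] -/
theorem S16_HZ_inl : ∀ i m : Fin 16,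
    S16.HZ i (Sum.inl m) = (HZ aS bS).submatrix dTab (Sum.map qTabL qTabR) i (Sum.inl m) := by
  decide

set_option maxHeartbeats 1000000 in
set_option maxRecDepth 100000 in
/-- `S16.HZ`, right block. [cite: LinPryadko2024, §IV.C Statement 8 (arXiv:2306.16400 chunk p0010 L58–63)] -/
theorem S16_HZ_inr : ∀ i m : Fin 16,
    S16.HZ i (Sum.inr m) = (HZ aS bS).submatrix dTab (Sum.map qTabL qTabR) i (Sum.inr m) := by
  decide

/-- `S16.HX = H_X(LP[a,b])` restricted along `dTab` (checks) and `qTabL ⊔ qTabR` (qubits). [cite: LinPryadko2024, §IV.C Statement 8 (arXiv:2306.16400 chunk p0010 L58–63)] -/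
theorem S16_HX_val : S16.HX = (HX aS bS).submatrix dTab (Sum.map qTabL qTabR) := by
  ext i q
  rcases q with m | m
  exacts [S16_HX_inl i m, S16_HX_inr i m]

/-- `S16.HZ` likewise. [cite: LinPryadko2024, §IV.C Statement 8 (arXiv:2306.16400 chunk p0010 L58–63)] -/
theorem S16_HZ_val : S16.HZ = (HZ aS bS).submatrix dTab (Sum.map qTabL qTabR) := by
  ext i q
  rcases q with m | m
  exacts [S16_HZ_inl i m, S16_HZ_inr i m]

/-- entry formula, restricted `H_X`, left block. [cite: LinPryadko2024, §IV.C Statement 8 (arXiv:2306.16400 chunk p0010 L58–63)] -/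
theorem sub_HX_inl (i m : Fin 16) :
    (HX aS bS).submatrix dTab (Sum.map qTabL qTabR) i (Sum.inl m) = aS (dTab i * (qTabL m)⁻¹) := by
  rw [Matrix.submatrix_apply, Sum.map_inl, HX_apply_inl]

/-- entry formula, restricted `H_X`, right block. [cite: LinPryadko2024, §IV.C Statement 8 (arXiv:2306.16400 chunk p0010 L58–63)] -/
theorem sub_HX_inr (i m : Fin 16) :
    (HX aS bS).submatrix dTab (Sum.map qTabL qTabR) i (Sum.inr m) = bS ((qTabR m)⁻¹ * dTab i) := by
  rw [Matrix.submatrix_apply, Sum.map_inr, HX_apply_inr]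

/-- entry formula, restricted `H_Z`, left block. [cite: LinPryadko2024, §IV.C Statement 8 (arXiv:2306.16400 chunk p0010 L58–63)] -/
theorem sub_HZ_inl (i m : Fin 16) :
    (HZ aS bS).submatrix dTab (Sum.map qTabL qTabR) i (Sum.inl m) = bS ((dTab i)⁻¹ * qTabL m) := by
  rw [Matrix.submatrix_apply, Sum.map_inl, HZ_apply_inl]

/-- entry formula, restricted `H_Z`, right block. [cite: LinPryadko2024, §IV.C Statement 8 (arXiv:2306.16400 chunk p0010 L58–63)] -/
theorem sub_HZ_inr (i m : Fin 16) :
    (HZ aS bS).submatrix dTab (Sum.map qTabL qTabR) i (Sum.inr m) = aS (qTabR m * (dTab i)⁻¹) := by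
  rw [Matrix.submatrix_apply, Sum.map_inr, HZ_apply_inr]

/-- entry formula, subcode `H_X` along `eR`, `eQ`, left block. [cite: LinPryadko2024, §IV.C Statement 8 (arXiv:2306.16400 chunk p0010 L58–63)] -/
theorem dc_HX_inl [instDD : ∀ H K : Subgroup (Perm (Fin 4)), DecidableEq (DoubleCoset.Quotient (H : Set (Perm (Fin 4))) K)] (i m : Fin 16) :
    (dcSubcode aS_supp bS_supp (dcMk Ga Gb 1)).HX.submatrix eR eQ i (Sum.inl m) = aS (dTab i * (qTabL m)⁻¹) := by
  have h1 : ((eR i : {x : Perm (Fin 4) // dcMk Ga Gb x = dcMk Ga Gb 1}) : Perm (Fin 4)) = dTab i := rfl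
  have h2 : ((eQ (Sum.inl m) : {q : Perm (Fin 4) ⊕ Perm (Fin 4) // Sum.elim (dcMk Ga Gb) (dcMk Ga Gb) q = dcMk Ga Gb 1}) :
      Perm (Fin 4) ⊕ Perm (Fin 4)) = Sum.inl (qTabL m) := rfl
  rw [Matrix.submatrix_apply, CSSCode.fiberCode_HX, Matrix.submatrix_apply, css_HX, h1, h2, HX_apply_inl]

/-- entry formula, subcode `H_X`, right block. [cite: LinPryadko2024, §IV.C Statement 8 (arXiv:2306.16400 chunk p0010 L58–63)] -/
theorem dc_HX_inr [instDD : ∀ H K : Subgroup (Perm (Fin 4)), DecidableEq (DoubleCoset.Quotient (H : Set (Perm (Fin 4))) K)] (i m : Fin 16) :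
    (dcSubcode aS_supp bS_supp (dcMk Ga Gb 1)).HX.submatrix eR eQ i (Sum.inr m) = bS ((qTabR m)⁻¹ * dTab i) := by
  have h1 : ((eR i : {x : Perm (Fin 4) // dcMk Ga Gb x = dcMk Ga Gb 1}) : Perm (Fin 4)) = dTab i := rfl
  have h2 : ((eQ (Sum.inr m) : {q : Perm (Fin 4) ⊕ Perm (Fin 4) // Sum.elim (dcMk Ga Gb) (dcMk Ga Gb) q = dcMk Ga Gb 1}) :
      Perm (Fin 4) ⊕ Perm (Fin 4)) = Sum.inr (qTabR m) := rfl
  rw [Matrix.submatrix_apply, CSSCode.fiberCode_HX, Matrix.submatrix_apply, css_HX, h1, h2, HX_apply_inr]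

/-- entry formula, subcode `H_Z`, left block. [cite: LinPryadko2024, §IV.C Statement 8 (arXiv:2306.16400 chunk p0010 L58–63)] -/
theorem dc_HZ_inl [instDD : ∀ H K : Subgroup (Perm (Fin 4)), DecidableEq (DoubleCoset.Quotient (H : Set (Perm (Fin 4))) K)] (i m : Fin 16) :
    (dcSubcode aS_supp bS_supp (dcMk Ga Gb 1)).HZ.submatrix eR eQ i (Sum.inl m) = bS ((dTab i)⁻¹ * qTabL m) := by
  have h1 : ((eR i : {x : Perm (Fin 4) // dcMk Ga Gb x = dcMk Ga Gb 1}) : Perm (Fin 4)) = dTab i := rfl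
  have h2 : ((eQ (Sum.inl m) : {q : Perm (Fin 4) ⊕ Perm (Fin 4) // Sum.elim (dcMk Ga Gb) (dcMk Ga Gb) q = dcMk Ga Gb 1}) :
      Perm (Fin 4) ⊕ Perm (Fin 4)) = Sum.inl (qTabL m) := rfl
  rw [Matrix.submatrix_apply, CSSCode.fiberCode_HZ, Matrix.submatrix_apply, css_HZ, h1, h2, HZ_apply_inl]

/-- entry formula, subcode `H_Z`, right block. [cite: LinPryadko2024, §IV.C Statement 8 (arXiv:2306.16400 chunk p0010 L58–63)] -/
theorem dc_HZ_inr [instDD : ∀ H K : Subgroup (Perm (Fin 4)), DecidableEq (DoubleCoset.Quotient (H : Set (Perm (Fin 4))) K)] (i m : Fin 16) :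
    (dcSubcode aS_supp bS_supp (dcMk Ga Gb 1)).HZ.submatrix eR eQ i (Sum.inr m) = aS (qTabR m * (dTab i)⁻¹) := by
  have h1 : ((eR i : {x : Perm (Fin 4) // dcMk Ga Gb x = dcMk Ga Gb 1}) : Perm (Fin 4)) = dTab i := rfl
  have h2 : ((eQ (Sum.inr m) : {q : Perm (Fin 4) ⊕ Perm (Fin 4) // Sum.elim (dcMk Ga Gb) (dcMk Ga Gb) q = dcMk Ga Gb 1}) :
      Perm (Fin 4) ⊕ Perm (Fin 4)) = Sum.inr (qTabR m) := rfl
  rw [Matrix.submatrix_apply, CSSCode.fiberCode_HZ, Matrix.submatrix_apply, css_HZ, h1, h2, HZ_apply_inr]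

/-- `S16` IS the identity-double-coset subcode of `LP[a,b]` along `eR`, `eQ`. [cite: LinPryadko2024, §IV.C Statement 8 (arXiv:2306.16400 chunk p0010 L58–63)] -/
theorem S16_HX [instDD : ∀ H K : Subgroup (Perm (Fin 4)), DecidableEq (DoubleCoset.Quotient (H : Set (Perm (Fin 4))) K)] :
    S16.HX = (dcSubcode aS_supp bS_supp (dcMk Ga Gb 1)).HX.submatrix eR eQ := by
  rw [S16_HX_val]
  ext i q
  rcases q with m | m
  · rw [sub_HX_inl, dc_HX_inl]
  · rw [sub_HX_inr, dc_HX_inr]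

/-- … and the `Z` side. [cite: LinPryadko2024, §IV.C Statement 8 (arXiv:2306.16400 chunk p0010 L58–63)] -/
theorem S16_HZ [instDD : ∀ H K : Subgroup (Perm (Fin 4)), DecidableEq (DoubleCoset.Quotient (H : Set (Perm (Fin 4))) K)] :
    S16.HZ = (dcSubcode aS_supp bS_supp (dcMk Ga Gb 1)).HZ.submatrix eR eQ := by
  rw [S16_HZ_val]
  ext i q
  rcases q with m | m
  · rw [sub_HZ_inl, dc_HZ_inl]
  · rw [sub_HZ_inr, dc_HZ_inr]

/-- `G′ = ℤ₄ × ℤ₂ × ℤ₂`, written multiplicatively. [cite: LinPryadko2024, §IV.C Statement 8 "a group G' of rank |G_a 1 G_b|" (arXiv:2306.16400 chunk p0010 L58–63)] -/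
abbrev G16 : Type := Multiplicative (ZMod 4 × ZMod 2 × ZMod 2)

/-- index `(i,j,k) ↦ 4i+2j+k`. [cite: LinPryadko2024, §IV.C Statement 8 (arXiv:2306.16400 chunk p0010 L58–63)] -/
def idx16 (g : G16) : Fin 16 :=
  ⟨(Multiplicative.toAdd g).1.val * 4 + (Multiplicative.toAdd g).2.1.val * 2 + (Multiplicative.toAdd g).2.2.val, by
    have h1 := (Multiplicative.toAdd g).1.val_lt
    have h2 := (Multiplicative.toAdd g).2.1.val_lt
    have h3 := (Multiplicative.toAdd g).2.2.val_lt
    omega⟩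

/-- inverse indexing. [cite: LinPryadko2024, §IV.C Statement 8 (arXiv:2306.16400 chunk p0010 L58–63)] -/
def ofIdx16 (i : Fin 16) : G16 :=
  Multiplicative.ofAdd (((i.val / 4 : ℕ) : ZMod 4), (((i.val / 2 % 2 : ℕ) : ZMod 2)), ((i.val % 2 : ℕ) : ZMod 2))

/-- `Fin 16 ≃ G′`. [cite: LinPryadko2024, §IV.C Statement 8 (arXiv:2306.16400 chunk p0010 L58–63)] -/
def e16 : Fin 16 ≃ G16 where
  toFun := ofIdx16
  invFun := idx16
  left_inv := by intro i; revert i; decide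
  right_inv := by intro g; revert g; decide

/-- `a′ ∈ 𝔽₂[G′]`. [cite: LinPryadko2024, §IV.C Statement 8 (arXiv:2306.16400 chunk p0010 L58–63)] -/
def aP (g : G16) : ZMod 2 := aTab (idx16 g)
/-- `b′ ∈ 𝔽₂[G′]`. [cite: LinPryadko2024, §IV.C Statement 8 (arXiv:2306.16400 chunk p0010 L58–63)] -/
def bP (g : G16) : ZMod 2 := bTab (idx16 g)

set_option maxHeartbeats 1000000 in
set_option maxRecDepth 100000 in
/-- The abelian 2BGA code `LP[a′,b′]` re-presented on `Fin 16 ⊔ (Fin 16 ⊕ Fin 16)` (literal tables).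
[cite: LinPryadko2024, §IV.C Statement 8 (arXiv:2306.16400 chunk p0010 L58–63)] -/
def C16 : CSSCode (Fin 16) (Fin 16) (Fin 16 ⊕ Fin 16) where
  HX := Matrix.of fun i q => Sum.elim (cXL i) (cXR i) q
  HZ := Matrix.of fun i q => Sum.elim (cZL i) (cZR i) q
  comm := by decide

set_option maxHeartbeats 1000000 in
set_option maxRecDepth 100000 in
/-- `C16` IS `LP[a′,b′] = TwoBlockGA.css aP bP` over `G′` along `e16`. [cite: LinPryadko2024, §IV.C Statement 8 (arXiv:2306.16400 chunk p0010 L58–63)] -/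
theorem C16_HX : C16.HX = (css aP bP).HX.submatrix e16 (Equiv.sumCongr e16 e16) := by
  ext i q
  rcases q with m | m
  · simp only [C16, e16, Matrix.of_apply, Sum.elim_inl, Matrix.submatrix_apply, Equiv.sumCongr_apply,
      Equiv.coe_fn_mk, Sum.map_inl, css_HX, HX_apply_inl]
    revert i m; decide
  · simp only [C16, e16, Matrix.of_apply, Sum.elim_inr, Matrix.submatrix_apply, Equiv.sumCongr_apply,
      Equiv.coe_fn_mk, Sum.map_inr, css_HX, HX_apply_inr]
    revert i m; decide

set_option maxHeartbeats 1000000 in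
set_option maxRecDepth 100000 in
/-- `Z` side. [cite: LinPryadko2024, §IV.C Statement 8 (arXiv:2306.16400 chunk p0010 L58–63)] -/
theorem C16_HZ : C16.HZ = (css aP bP).HZ.submatrix e16 (Equiv.sumCongr e16 e16) := by
  ext i q
  rcases q with m | m
  · simp only [C16, e16, Matrix.of_apply, Sum.elim_inl, Matrix.submatrix_apply, Equiv.sumCongr_apply,
      Equiv.coe_fn_mk, Sum.map_inl, css_HZ, HZ_apply_inl]
    revert i m; decide
  · simp only [C16, e16, Matrix.of_apply, Sum.elim_inr, Matrix.submatrix_apply, Equiv.sumCongr_apply,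
      Equiv.coe_fn_mk, Sum.map_inr, css_HZ, HZ_apply_inr]
    revert i m; decide

set_option maxHeartbeats 1000000 in
set_option maxRecDepth 100000 in
/-- change of `X`-stabiliser basis, both directions (explicit matrices, `decide`).
[cite: LinPryadko2024, §IV.C Statement 8 (arXiv:2306.16400 chunk p0010 L58–63)] -/
theorem S16_C16_HX : S16.HX = uX * C16.HX ∧ C16.HX = vX * S16.HX := by
  constructor <;> decide

set_option maxHeartbeats 1000000 in
set_option maxRecDepth 100000 in
/-- change of `Z`-stabiliser basis. [cite: LinPryadko2024, §IV.C Statement 8 (arXiv:2306.16400 chunk p0010 L58–63)] -/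
theorem S16_C16_HZ : S16.HZ = uZ * C16.HZ ∧ C16.HZ = vZ * S16.HZ := by
  constructor <;> decide

/-- Hence equal stabiliser spaces. [cite: LinPryadko2024, §IV.C Statement 8 (arXiv:2306.16400 chunk p0010 L58–63)] -/
theorem rowSpace_S16_eq_C16 :
    rowSpace S16.HX = rowSpace C16.HX ∧ rowSpace S16.HZ = rowSpace C16.HZ :=
  ⟨le_antisymm (CSSCode.rowSpace_le_of_eq_mul uX S16_C16_HX.1) (CSSCode.rowSpace_le_of_eq_mul vX S16_C16_HX.2),
   le_antisymm (CSSCode.rowSpace_le_of_eq_mul uZ S16_C16_HZ.1) (CSSCode.rowSpace_le_of_eq_mul vZ S16_C16_HZ.2)⟩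

/-- `|G′| = 16`. [cite: LinPryadko2024, §IV.C Statement 8 "rank |G_a 1 G_b|" (arXiv:2306.16400 chunk p0010 L58–63)] -/
theorem card_G16 : Fintype.card G16 = 16 := by
  rw [← Fintype.card_congr e16, Fintype.card_fin]

/-- `|G_a1G_b| = 16`. [cite: LinPryadko2024, §IV.C Statement 8 (arXiv:2306.16400 chunk p0010 L58–63)] -/
theorem card_dc_one [instDD : ∀ H K : Subgroup (Perm (Fin 4)), DecidableEq (DoubleCoset.Quotient (H : Set (Perm (Fin 4))) K)] :
    Fintype.card {x : Perm (Fin 4) // dcMk Ga Gb x = dcMk Ga Gb 1} = 16 := by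
  rw [← Fintype.card_congr eR, Fintype.card_fin]

/-- ★★ **Statement 8's conclusion holds for `(S₄; G_a, G_b)` of §E — by an ABELIAN group, not an amalgam.**
The subcode of `LP[a,b]` (`a = aS`, `b = bS`, support groups `G_a`, `G_b`: two Sylow `2`-subgroups of `S₄`,
`N = V₄` abelian and normal in both, `SylowS4.not_isAmalgam`: no amalgam `G′ ⊇ G_a, G_b` exists) supported in
the double coset `G_a1G_b` has exactly the `k`, `d^X`, `d^Z` of the 2BGA code `LP[a′,b′]` over
`G′ = ℤ₄×ℤ₂×ℤ₂`, `|G′| = |G_a1G_b| = 16` (`card_G16`, `card_dc_one`); indeed its check matrices and those of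
`LP[a′,b′]` have THE SAME ROW SPACES after the explicit relabelling `eR`, `eQ`, `e16` (`rowSpace_S16_eq_C16`),
i.e. the two codes are permutation-equivalent. (Numerically `[[32,8,4]]`, not claimed here.) So the printed
statement survives this instance while its printed proof cannot: the `G′` is not built from `G_a` and `G_b`.
[cite: LinPryadko2024, §IV.C Statement 8 "the subcode of LP[a,b] supported in the double-coset G_a1G_b is equivalent to a 2BGA code over a group G' of rank |G_a 1 G_b|" (arXiv:2306.16400 chunk p0010 L58–63)] -/
theorem statement8_instance_abelian [instDD : ∀ H K : Subgroup (Perm (Fin 4)), DecidableEq (DoubleCoset.Quotient (H : Set (Perm (Fin 4))) K)] :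
    (dcSubcode aS_supp bS_supp (dcMk Ga Gb 1)).k = (css aP bP).k ∧
    (dcSubcode aS_supp bS_supp (dcMk Ga Gb 1)).dX = (css aP bP).dX ∧
    (dcSubcode aS_supp bS_supp (dcMk Ga Gb 1)).dZ = (css aP bP).dZ := by
  have h1k := CSSCode.k_eq_of_submatrix S16_HX S16_HZ
  have h1x := CSSCode.dX_eq_of_submatrix S16_HX S16_HZ
  have h1z := CSSCode.dZ_eq_of_submatrix S16_HX S16_HZ
  have h2k := CSSCode.k_eq_of_submatrix C16_HX C16_HZ
  have h2x := CSSCode.dX_eq_of_submatrix C16_HX C16_HZ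
  have h2z := CSSCode.dZ_eq_of_submatrix C16_HX C16_HZ
  obtain ⟨h3k, h3x, h3z⟩ := CSSCode.params_eq_of_rowSpace_eq S16 C16 rowSpace_S16_eq_C16.1 rowSpace_S16_eq_C16.2
  exact ⟨h1k.symm.trans (h3k.trans h2k), h1x.symm.trans (h3x.trans h2x), h1z.symm.trans (h3z.trans h2z)⟩

end SylowS4

/-! ### §G. The obstruction behind §E in general: in an exact amalgam the conjugation actions of `G_a` and
`G_b` on a common normal subgroup `N` have a product set closed under reversal
If `N ≤ G_a ∩ G_b` is normalised by both support groups (the printed hypothesis "normal in both"), then in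
any exact amalgam `G'` the element `ιb(β)ιa(α)` is some `ιa(α′)ιb(β′)`, and comparing the two conjugations
of `ι(N)` gives: **for all `α ∈ G_a`, `β ∈ G_b` there are `α′ ∈ G_a`, `β′ ∈ G_b` with
`β(αnα⁻¹)β⁻¹ = α′(β′nβ′⁻¹)α′⁻¹` for every `n ∈ N`** (`IsAmalgam.exists_conj_swap`). Read in `Aut(N)`: the
set `θ_a(G_a)·θ_b(G_b)` must contain `θ_b(G_b)·θ_a(G_a)`; for the two Sylow `D₈ ⊂ S₄` acting on `V₄` by two
different transpositions this fails (`SylowS4.not_isAmalgam`). -/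

namespace IsAmalgam

variable {G : Type*} [Group G] {G' : Type*} [Group G'] {Ha Hb : Subgroup G} {ιa : Ha →* G'} {ιb : Hb →* G'}

/-- ★ **Necessary condition for an exact amalgam** (the mechanism of `SylowS4.not_isAmalgam`): if
`N`-elements (`n ∈ G_a ∩ G_b`) are conjugated into `G_a ∩ G_b` by both support groups, then for every
`α ∈ G_a`, `β ∈ G_b` some `α′ ∈ G_a`, `β′ ∈ G_b` induce, in the opposite order, the same conjugation on `N`:
`β(αnα⁻¹)β⁻¹ = α′(β′nβ′⁻¹)α′⁻¹`. [cite: LinPryadko2024, §IV.C Statement 8 "N ≡ G_a ∩ G_b … normal in both support groups" and App. VIII.B (arXiv:2306.16400 chunks p0010 L58–63, p0018 L79–100)] -/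
theorem exists_conj_swap (h : IsAmalgam Ha Hb ιa ιb)
    (hNa : ∀ α : Ha, ∀ n : G, n ∈ Ha → n ∈ Hb → (α : G) * n * (α : G)⁻¹ ∈ Hb)
    (hNb : ∀ β : Hb, ∀ n : G, n ∈ Ha → n ∈ Hb → (β : G) * n * (β : G)⁻¹ ∈ Ha)
    (α : Ha) (β : Hb) :
    ∃ (α' : Ha) (β' : Hb), ∀ n : G, n ∈ Ha → n ∈ Hb →
      (β : G) * ((α : G) * n * (α : G)⁻¹) * (β : G)⁻¹ = α' * ((β' : G) * n * (β' : G)⁻¹) * (α' : G)⁻¹ := by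
  obtain ⟨α', β', hx⟩ := h.surj (ιb β * ιa α)
  refine ⟨α', β', fun n hna hnb => ?_⟩
  -- the two conjugates, as elements of `G_a` resp. `G_b`
  have hm₁ : (α : G) * n * (α : G)⁻¹ ∈ Ha := Ha.mul_mem (Ha.mul_mem α.2 hna) (Ha.inv_mem α.2)
  have hm₂ : (β : G) * ((α : G) * n * (α : G)⁻¹) * (β : G)⁻¹ ∈ Hb :=
    Hb.mul_mem (Hb.mul_mem β.2 (hNa α n hna hnb)) (Hb.inv_mem β.2)
  have hm₃ : (β' : G) * n * (β' : G)⁻¹ ∈ Hb := Hb.mul_mem (Hb.mul_mem β'.2 hnb) (Hb.inv_mem β'.2)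
  have hm₄ : (α' : G) * ((β' : G) * n * (β' : G)⁻¹) * (α' : G)⁻¹ ∈ Ha :=
    Ha.mul_mem (Ha.mul_mem α'.2 (hNb β' n hna hnb)) (Ha.inv_mem α'.2)
  -- conjugation of `ι(n)` by `ιb β · ιa α`
  have lhs : (ιb β * ιa α) * ιa ⟨n, hna⟩ * (ιb β * ιa α)⁻¹ =
      ιb ⟨(β : G) * ((α : G) * n * (α : G)⁻¹) * (β : G)⁻¹, hm₂⟩ := by
    have e1 : ιa α * ιa ⟨n, hna⟩ * (ιa α)⁻¹ = ιa ⟨(α : G) * n * (α : G)⁻¹, hm₁⟩ := by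
      rw [← map_inv, ← map_mul, ← map_mul]; rfl
    have e2 : ιa ⟨(α : G) * n * (α : G)⁻¹, hm₁⟩ = ιb ⟨(α : G) * n * (α : G)⁻¹, hNa α n hna hnb⟩ :=
      h.agree _ hm₁ (hNa α n hna hnb)
    have e3 : ιb β * ιb ⟨(α : G) * n * (α : G)⁻¹, hNa α n hna hnb⟩ * (ιb β)⁻¹ =
        ιb ⟨(β : G) * ((α : G) * n * (α : G)⁻¹) * (β : G)⁻¹, hm₂⟩ := by
      rw [← map_inv, ← map_mul, ← map_mul]; rfl
    calc (ιb β * ιa α) * ιa ⟨n, hna⟩ * (ιb β * ιa α)⁻¹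
        = ιb β * (ιa α * ιa ⟨n, hna⟩ * (ιa α)⁻¹) * (ιb β)⁻¹ := by group
      _ = ιb ⟨(β : G) * ((α : G) * n * (α : G)⁻¹) * (β : G)⁻¹, hm₂⟩ := by rw [e1, e2, e3]
  -- conjugation of `ι(n)` by `ιa α' · ιb β'`
  have rhs : (ιa α' * ιb β') * ιa ⟨n, hna⟩ * (ιa α' * ιb β')⁻¹ =
      ιa ⟨(α' : G) * ((β' : G) * n * (β' : G)⁻¹) * (α' : G)⁻¹, hm₄⟩ := by
    have e1 : ιb β' * ιb ⟨n, hnb⟩ * (ιb β')⁻¹ = ιb ⟨(β' : G) * n * (β' : G)⁻¹, hm₃⟩ := by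
      rw [← map_inv, ← map_mul, ← map_mul]; rfl
    have e2 : ιb ⟨(β' : G) * n * (β' : G)⁻¹, hm₃⟩ = ιa ⟨(β' : G) * n * (β' : G)⁻¹, hNb β' n hna hnb⟩ :=
      (h.agree _ (hNb β' n hna hnb) hm₃).symm
    have e3 : ιa α' * ιa ⟨(β' : G) * n * (β' : G)⁻¹, hNb β' n hna hnb⟩ * (ιa α')⁻¹ =
        ιa ⟨(α' : G) * ((β' : G) * n * (β' : G)⁻¹) * (α' : G)⁻¹, hm₄⟩ := by
      rw [← map_inv, ← map_mul, ← map_mul]; rfl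
    calc (ιa α' * ιb β') * ιa ⟨n, hna⟩ * (ιa α' * ιb β')⁻¹
        = ιa α' * (ιb β' * ιa ⟨n, hna⟩ * (ιb β')⁻¹) * (ιa α')⁻¹ := by group
      _ = ιa α' * (ιb β' * ιb ⟨n, hnb⟩ * (ιb β')⁻¹) * (ιa α')⁻¹ := by rw [h.agree n hna hnb]
      _ = ιa ⟨(α' : G) * ((β' : G) * n * (β' : G)⁻¹) * (α' : G)⁻¹, hm₄⟩ := by rw [e1, e2, e3]
  rw [← hx, rhs] at lhs
  -- `ιa x = ιb y ⇒ x = y`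
  exact ((h.left_eq_right_iff _ _).1 lhs).symm

end IsAmalgam

/-! ### §H. The dimension: the subcode and `LP[a′,b′]` are `[[32, 8, ·]]` codes (rank certificates, `decide`) -/

namespace SylowS4

open Matrix

/-- rank-certificate data for `S16` (rUX). [folklore] -/
private def rUX : Matrix (Fin 12) (Fin 16) (ZMod 2) :=
  !![1, 0, 0, 1, 1, 0, 1, 1, 1, 1, 1, 1, 0, 0, 0, 0;
    0, 1, 1, 0, 0, 1, 0, 1, 1, 0, 1, 1, 0, 0, 0, 0;
    0, 1, 0, 0, 0, 1, 1, 1, 1, 0, 1, 1, 0, 0, 0, 0;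
    0, 1, 1, 1, 0, 1, 1, 0, 0, 0, 1, 1, 0, 0, 0, 0;
    0, 1, 1, 0, 1, 1, 0, 1, 1, 1, 1, 1, 0, 0, 0, 0;
    1, 1, 1, 0, 1, 0, 0, 1, 1, 1, 0, 0, 0, 0, 0, 0;
    0, 1, 1, 0, 0, 0, 1, 0, 0, 0, 1, 1, 0, 0, 0, 0;
    0, 0, 1, 0, 1, 0, 1, 0, 0, 0, 0, 0, 0, 0, 0, 0;
    0, 1, 1, 0, 0, 0, 1, 0, 0, 0, 0, 1, 0, 0, 0, 0;
    0, 1, 1, 0, 1, 1, 0, 1, 1, 1, 1, 0, 0, 0, 0, 0;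
    0, 1, 1, 0, 0, 1, 1, 1, 1, 0, 1, 1, 0, 0, 0, 0;
    1, 0, 0, 1, 1, 0, 1, 1, 0, 1, 1, 1, 0, 0, 0, 0]

/-- rank-certificate data for `S16` (rNXL). [folklore] -/
private def rNXL : Matrix (Fin 12) (Fin 16) (ZMod 2) :=
  !![1, 0, 0, 0, 0, 0, 0, 0, 0, 0, 0, 1, 0, 1, 1, 0;
    0, 1, 0, 0, 0, 0, 0, 0, 0, 0, 1, 0, 1, 0, 0, 1;
    0, 0, 1, 0, 0, 0, 0, 0, 0, 1, 0, 0, 1, 0, 0, 1;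
    0, 0, 0, 1, 0, 0, 0, 0, 1, 0, 0, 0, 0, 1, 1, 0;
    0, 0, 0, 0, 1, 0, 0, 0, 0, 1, 1, 0, 0, 0, 0, 1;
    0, 0, 0, 0, 0, 1, 0, 0, 1, 0, 0, 1, 0, 0, 1, 0;
    0, 0, 0, 0, 0, 0, 1, 0, 1, 0, 0, 1, 0, 1, 0, 0;
    0, 0, 0, 0, 0, 0, 0, 1, 0, 1, 1, 0, 1, 0, 0, 0;
    0, 0, 0, 0, 0, 0, 0, 0, 0, 0, 0, 0, 0, 0, 0, 0;
    0, 0, 0, 0, 0, 0, 0, 0, 0, 0, 0, 0, 0, 0, 0, 0;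
    0, 0, 0, 0, 0, 0, 0, 0, 0, 0, 0, 0, 0, 0, 0, 0;
    0, 0, 0, 0, 0, 0, 0, 0, 0, 0, 0, 0, 0, 0, 0, 0]

/-- rank-certificate data for `S16` (rNXR). [folklore] -/
private def rNXR : Matrix (Fin 12) (Fin 16) (ZMod 2) :=
  !![0, 0, 0, 0, 0, 1, 0, 1, 1, 1, 1, 1, 0, 1, 1, 0;
    0, 0, 0, 0, 0, 1, 0, 1, 1, 1, 1, 1, 0, 1, 1, 0;
    0, 0, 0, 0, 0, 1, 0, 1, 1, 1, 1, 1, 1, 0, 0, 1;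
    0, 0, 0, 0, 0, 1, 0, 1, 1, 1, 1, 1, 1, 0, 0, 1;
    0, 1, 0, 1, 0, 0, 0, 0, 1, 0, 0, 1, 1, 1, 1, 1;
    0, 1, 0, 1, 0, 0, 0, 0, 1, 0, 0, 1, 1, 1, 1, 1;
    0, 1, 0, 1, 0, 0, 0, 0, 0, 1, 1, 0, 1, 1, 1, 1;
    0, 1, 0, 1, 0, 0, 0, 0, 0, 1, 1, 0, 1, 1, 1, 1;
    1, 1, 0, 0, 0, 0, 0, 0, 0, 0, 1, 1, 1, 1, 1, 1;
    0, 0, 1, 1, 0, 0, 0, 0, 1, 1, 0, 0, 1, 1, 1, 1;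
    0, 0, 0, 0, 1, 1, 0, 0, 1, 1, 1, 1, 0, 0, 1, 1;
    0, 0, 0, 0, 0, 0, 1, 1, 1, 1, 1, 1, 1, 1, 0, 0]

/-- rank-certificate data for `S16` (rMX). [folklore] -/
private def rMX : Matrix (Fin 16) (Fin 12) (ZMod 2) :=
  !![1, 0, 0, 1, 0, 0, 1, 0, 1, 1, 0, 0;
    0, 1, 1, 0, 1, 0, 0, 0, 1, 1, 0, 0;
    0, 0, 1, 0, 0, 0, 0, 0, 0, 0, 1, 0;
    1, 0, 0, 0, 0, 1, 1, 0, 0, 0, 0, 0;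
    0, 1, 1, 0, 0, 0, 0, 1, 0, 0, 0, 0;
    1, 0, 0, 1, 0, 1, 0, 0, 0, 0, 0, 0;
    0, 1, 0, 0, 0, 0, 0, 0, 0, 0, 1, 0;
    0, 0, 0, 1, 0, 1, 1, 0, 0, 0, 1, 1;
    1, 0, 0, 0, 0, 0, 0, 0, 0, 0, 0, 1;
    0, 0, 1, 0, 1, 0, 0, 1, 0, 0, 0, 0;
    0, 0, 0, 0, 0, 0, 1, 0, 1, 0, 0, 0;
    0, 0, 0, 0, 1, 0, 0, 0, 0, 1, 0, 0;
    0, 0, 0, 1, 0, 0, 0, 0, 0, 0, 0, 1;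
    0, 1, 0, 0, 1, 0, 0, 1, 0, 0, 1, 1;
    0, 0, 0, 0, 0, 0, 0, 1, 0, 1, 0, 0;
    0, 0, 0, 0, 0, 1, 0, 0, 1, 0, 0, 0]

/-- rank-certificate data for `S16` (rSXL). [folklore] -/
private def rSXL : Matrix (Fin 16) (Fin 12) (ZMod 2) :=
  !![1, 0, 0, 0, 0, 0, 0, 0, 0, 0, 0, 0;
    0, 1, 0, 0, 0, 0, 0, 0, 0, 0, 0, 0;
    0, 0, 1, 0, 0, 0, 0, 0, 0, 0, 0, 0;
    0, 0, 0, 1, 0, 0, 0, 0, 0, 0, 0, 0;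
    0, 0, 0, 0, 1, 0, 0, 0, 0, 0, 0, 0;
    0, 0, 0, 0, 0, 1, 0, 0, 0, 0, 0, 0;
    0, 0, 0, 0, 0, 0, 1, 0, 0, 0, 0, 0;
    0, 0, 0, 0, 0, 0, 0, 1, 0, 0, 0, 0;
    0, 0, 0, 0, 0, 0, 0, 0, 0, 0, 0, 0;
    0, 0, 0, 0, 0, 0, 0, 0, 0, 0, 0, 0;
    0, 0, 0, 0, 0, 0, 0, 0, 0, 0, 0, 0;
    0, 0, 0, 0, 0, 0, 0, 0, 0, 0, 0, 0;
    0, 0, 0, 0, 0, 0, 0, 0, 0, 0, 0, 0;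
    0, 0, 0, 0, 0, 0, 0, 0, 0, 0, 0, 0;
    0, 0, 0, 0, 0, 0, 0, 0, 0, 0, 0, 0;
    0, 0, 0, 0, 0, 0, 0, 0, 0, 0, 0, 0]

/-- rank-certificate data for `S16` (rSXR). [folklore] -/
private def rSXR : Matrix (Fin 16) (Fin 12) (ZMod 2) :=
  !![0, 0, 0, 0, 0, 0, 0, 0, 1, 0, 0, 0;
    0, 0, 0, 0, 0, 0, 0, 0, 0, 0, 0, 0;
    0, 0, 0, 0, 0, 0, 0, 0, 0, 1, 0, 0;
    0, 0, 0, 0, 0, 0, 0, 0, 0, 0, 0, 0;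
    0, 0, 0, 0, 0, 0, 0, 0, 0, 0, 1, 0;
    0, 0, 0, 0, 0, 0, 0, 0, 0, 0, 0, 0;
    0, 0, 0, 0, 0, 0, 0, 0, 0, 0, 0, 1;
    0, 0, 0, 0, 0, 0, 0, 0, 0, 0, 0, 0;
    0, 0, 0, 0, 0, 0, 0, 0, 0, 0, 0, 0;
    0, 0, 0, 0, 0, 0, 0, 0, 0, 0, 0, 0;
    0, 0, 0, 0, 0, 0, 0, 0, 0, 0, 0, 0;
    0, 0, 0, 0, 0, 0, 0, 0, 0, 0, 0, 0;
    0, 0, 0, 0, 0, 0, 0, 0, 0, 0, 0, 0;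
    0, 0, 0, 0, 0, 0, 0, 0, 0, 0, 0, 0;
    0, 0, 0, 0, 0, 0, 0, 0, 0, 0, 0, 0;
    0, 0, 0, 0, 0, 0, 0, 0, 0, 0, 0, 0]

/-- rank-certificate data for `S16` (rUZ). [folklore] -/
private def rUZ : Matrix (Fin 12) (Fin 16) (ZMod 2) :=
  !![0, 0, 0, 0, 0, 0, 0, 0, 0, 0, 1, 0, 0, 0, 0, 0;
    1, 0, 1, 1, 1, 1, 0, 1, 1, 0, 1, 1, 0, 0, 0, 0;
    1, 0, 1, 1, 1, 1, 0, 1, 1, 0, 1, 0, 0, 0, 0, 0;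
    1, 1, 1, 1, 1, 1, 0, 1, 1, 1, 0, 0, 0, 0, 0, 0;
    0, 1, 1, 0, 1, 0, 0, 1, 0, 1, 1, 1, 0, 0, 0, 0;
    0, 1, 0, 0, 1, 0, 1, 1, 0, 0, 1, 1, 0, 0, 0, 0;
    0, 0, 0, 0, 1, 1, 1, 1, 1, 1, 0, 0, 0, 0, 0, 0;
    0, 0, 1, 0, 0, 0, 1, 1, 0, 1, 0, 0, 0, 0, 0, 0;
    0, 0, 1, 1, 0, 0, 1, 0, 0, 1, 0, 0, 0, 0, 0, 0;
    1, 1, 1, 1, 1, 1, 0, 1, 1, 0, 0, 0, 0, 0, 0, 0;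
    0, 1, 0, 0, 1, 0, 0, 0, 0, 0, 1, 1, 0, 0, 0, 0;
    1, 0, 0, 0, 0, 1, 0, 0, 0, 0, 1, 1, 0, 0, 0, 0]

/-- rank-certificate data for `S16` (rNZL). [folklore] -/
private def rNZL : Matrix (Fin 12) (Fin 16) (ZMod 2) :=
  !![1, 0, 0, 1, 0, 0, 0, 0, 0, 1, 0, 1, 0, 0, 0, 0;
    0, 1, 0, 1, 0, 0, 0, 0, 0, 1, 1, 0, 0, 0, 0, 0;
    0, 0, 1, 1, 0, 0, 0, 0, 0, 0, 1, 1, 0, 0, 0, 0;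
    0, 0, 0, 0, 1, 0, 0, 1, 0, 0, 0, 0, 0, 1, 0, 1;
    0, 0, 0, 0, 0, 1, 0, 1, 0, 0, 0, 0, 0, 1, 1, 0;
    0, 0, 0, 0, 0, 0, 1, 1, 0, 0, 0, 0, 0, 0, 1, 1;
    0, 0, 0, 0, 0, 0, 0, 0, 1, 1, 1, 1, 0, 0, 0, 0;
    0, 0, 0, 0, 0, 0, 0, 0, 0, 0, 0, 0, 1, 1, 1, 1;
    0, 0, 0, 0, 0, 0, 0, 0, 0, 0, 0, 0, 0, 0, 0, 0;
    0, 0, 0, 0, 0, 0, 0, 0, 0, 0, 0, 0, 0, 0, 0, 0;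
    0, 0, 0, 0, 0, 0, 0, 0, 0, 0, 0, 0, 0, 0, 0, 0;
    0, 0, 0, 0, 0, 0, 0, 0, 0, 0, 0, 0, 0, 0, 0, 0]

/-- rank-certificate data for `S16` (rNZR). [folklore] -/
private def rNZR : Matrix (Fin 12) (Fin 16) (ZMod 2) :=
  !![0, 0, 0, 0, 0, 1, 0, 0, 1, 0, 0, 1, 0, 0, 1, 0;
    0, 1, 0, 1, 0, 1, 0, 0, 0, 0, 1, 1, 1, 1, 0, 1;
    0, 1, 0, 1, 0, 1, 0, 1, 0, 1, 0, 1, 0, 1, 0, 1;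
    0, 0, 0, 1, 0, 0, 0, 0, 1, 0, 0, 0, 0, 1, 1, 0;
    0, 0, 0, 1, 0, 1, 0, 1, 0, 1, 1, 1, 1, 1, 0, 0;
    0, 1, 0, 1, 0, 1, 0, 1, 0, 1, 0, 1, 0, 1, 0, 1;
    0, 0, 0, 0, 0, 1, 0, 1, 1, 1, 1, 1, 1, 0, 1, 0;
    0, 1, 0, 1, 0, 0, 0, 0, 1, 0, 1, 0, 1, 1, 1, 1;
    1, 1, 0, 0, 0, 0, 0, 0, 0, 0, 1, 1, 1, 1, 1, 1;
    0, 0, 1, 1, 0, 0, 0, 0, 1, 1, 0, 0, 1, 1, 1, 1;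
    0, 0, 0, 0, 1, 1, 0, 0, 1, 1, 1, 1, 0, 0, 1, 1;
    0, 0, 0, 0, 0, 0, 1, 1, 1, 1, 1, 1, 1, 1, 0, 0]

/-- rank-certificate data for `S16` (rMZ). [folklore] -/
private def rMZ : Matrix (Fin 16) (Fin 12) (ZMod 2) :=
  !![1, 0, 1, 0, 0, 0, 1, 0, 1, 0, 0, 0;
    1, 0, 1, 0, 0, 0, 0, 0, 0, 1, 0, 0;
    0, 0, 0, 1, 0, 1, 0, 1, 0, 1, 1, 0;
    0, 0, 0, 0, 1, 1, 0, 0, 1, 0, 0, 0;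
    0, 1, 0, 0, 0, 0, 0, 0, 0, 1, 1, 0;
    0, 1, 0, 0, 0, 0, 1, 0, 1, 0, 0, 1;
    0, 0, 0, 0, 1, 0, 0, 1, 0, 0, 1, 0;
    0, 0, 0, 0, 1, 1, 0, 1, 0, 0, 0, 0;
    0, 0, 0, 1, 0, 1, 0, 0, 1, 0, 0, 1;
    0, 0, 0, 1, 0, 0, 0, 0, 0, 1, 0, 0;
    1, 0, 0, 0, 0, 0, 0, 0, 0, 0, 0, 0;
    0, 1, 1, 0, 0, 0, 0, 0, 0, 0, 0, 0;
    0, 0, 0, 0, 1, 0, 0, 0, 0, 0, 0, 1;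
    0, 0, 0, 1, 0, 0, 0, 1, 0, 0, 0, 0;
    0, 1, 1, 0, 0, 0, 1, 0, 0, 0, 1, 0;
    1, 0, 0, 0, 0, 0, 1, 0, 0, 0, 0, 1]

/-- rank-certificate data for `S16` (rSZL). [folklore] -/
private def rSZL : Matrix (Fin 16) (Fin 12) (ZMod 2) :=
  !![1, 0, 0, 0, 0, 0, 0, 0, 0, 0, 0, 0;
    0, 1, 0, 0, 0, 0, 0, 0, 0, 0, 0, 0;
    0, 0, 1, 0, 0, 0, 0, 0, 0, 0, 0, 0;
    0, 0, 0, 0, 0, 0, 0, 0, 0, 0, 0, 0;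
    0, 0, 0, 1, 0, 0, 0, 0, 0, 0, 0, 0;
    0, 0, 0, 0, 1, 0, 0, 0, 0, 0, 0, 0;
    0, 0, 0, 0, 0, 1, 0, 0, 0, 0, 0, 0;
    0, 0, 0, 0, 0, 0, 0, 0, 0, 0, 0, 0;
    0, 0, 0, 0, 0, 0, 1, 0, 0, 0, 0, 0;
    0, 0, 0, 0, 0, 0, 0, 0, 0, 0, 0, 0;
    0, 0, 0, 0, 0, 0, 0, 0, 0, 0, 0, 0;
    0, 0, 0, 0, 0, 0, 0, 0, 0, 0, 0, 0;
    0, 0, 0, 0, 0, 0, 0, 1, 0, 0, 0, 0;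
    0, 0, 0, 0, 0, 0, 0, 0, 0, 0, 0, 0;
    0, 0, 0, 0, 0, 0, 0, 0, 0, 0, 0, 0;
    0, 0, 0, 0, 0, 0, 0, 0, 0, 0, 0, 0]

/-- rank-certificate data for `S16` (rSZR). [folklore] -/
private def rSZR : Matrix (Fin 16) (Fin 12) (ZMod 2) :=
  !![0, 0, 0, 0, 0, 0, 0, 0, 1, 0, 0, 0;
    0, 0, 0, 0, 0, 0, 0, 0, 0, 0, 0, 0;
    0, 0, 0, 0, 0, 0, 0, 0, 0, 1, 0, 0;
    0, 0, 0, 0, 0, 0, 0, 0, 0, 0, 0, 0;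
    0, 0, 0, 0, 0, 0, 0, 0, 0, 0, 1, 0;
    0, 0, 0, 0, 0, 0, 0, 0, 0, 0, 0, 0;
    0, 0, 0, 0, 0, 0, 0, 0, 0, 0, 0, 1;
    0, 0, 0, 0, 0, 0, 0, 0, 0, 0, 0, 0;
    0, 0, 0, 0, 0, 0, 0, 0, 0, 0, 0, 0;
    0, 0, 0, 0, 0, 0, 0, 0, 0, 0, 0, 0;
    0, 0, 0, 0, 0, 0, 0, 0, 0, 0, 0, 0;
    0, 0, 0, 0, 0, 0, 0, 0, 0, 0, 0, 0;
    0, 0, 0, 0, 0, 0, 0, 0, 0, 0, 0, 0;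
    0, 0, 0, 0, 0, 0, 0, 0, 0, 0, 0, 0;
    0, 0, 0, 0, 0, 0, 0, 0, 0, 0, 0, 0;
    0, 0, 0, 0, 0, 0, 0, 0, 0, 0, 0, 0]


/-- (plumbing) `N` for `S16.HX`. [folklore] -/
private def rNX : Matrix (Fin 12) (Fin 16 ⊕ Fin 16) (ZMod 2) := Matrix.of fun i q => Sum.elim (rNXL i) (rNXR i) q
/-- (plumbing) `S` for `S16.HX`. [folklore] -/
private def rSX : Matrix (Fin 16 ⊕ Fin 16) (Fin 12) (ZMod 2) := Matrix.of fun q j => Sum.elim (fun m => rSXL m j) (fun m => rSXR m j) q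
/-- (plumbing) `N` for `S16.HZ`. [folklore] -/
private def rNZ : Matrix (Fin 12) (Fin 16 ⊕ Fin 16) (ZMod 2) := Matrix.of fun i q => Sum.elim (rNZL i) (rNZR i) q
/-- (plumbing) `S` for `S16.HZ`. [folklore] -/
private def rSZ : Matrix (Fin 16 ⊕ Fin 16) (Fin 12) (ZMod 2) := Matrix.of fun q j => Sum.elim (fun m => rSZL m j) (fun m => rSZR m j) q

set_option maxHeartbeats 1000000 in
set_option maxRecDepth 100000 in
/-- certificate identities for `S16.HX` (rank `12`). [folklore] -/
private theorem S16_HX_cert : rUX * S16.HX = rNX ∧ rMX * rNX = S16.HX ∧ rNX * rSX = 1 := by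
  refine ⟨?_, ?_, ?_⟩ <;> decide

set_option maxHeartbeats 1000000 in
set_option maxRecDepth 100000 in
/-- certificate identities for `S16.HZ` (rank `12`). [folklore] -/
private theorem S16_HZ_cert : rUZ * S16.HZ = rNZ ∧ rMZ * rNZ = S16.HZ ∧ rNZ * rSZ = 1 := by
  refine ⟨?_, ?_, ?_⟩ <;> decide

/-- rank from a certificate: `U H = N`, `M N = H`, `N S = 1_r ⟹ rank H = r` (re-proved plumbing). [folklore] -/
private theorem rank_eq_of_cert' {m n : Type*} [Fintype m] [Fintype n] [DecidableEq n] {r : ℕ}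
    {H : Matrix m n (ZMod 2)} {U : Matrix (Fin r) m (ZMod 2)} {M : Matrix m (Fin r) (ZMod 2)}
    {N : Matrix (Fin r) n (ZMod 2)} {S : Matrix n (Fin r) (ZMod 2)}
    (h1 : U * H = N) (h2 : M * N = H) (h3 : N * S = 1) : H.rank = r := by
  apply le_antisymm
  · calc H.rank = (M * N).rank := by rw [h2]
      _ ≤ N.rank := Matrix.rank_mul_le_right _ _
      _ ≤ Fintype.card (Fin r) := Matrix.rank_le_card_height _
      _ = r := Fintype.card_fin r
  · calc r = (1 : Matrix (Fin r) (Fin r) (ZMod 2)).rank := by rw [Matrix.rank_one, Fintype.card_fin]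
      _ = (N * S).rank := by rw [h3]
      _ ≤ N.rank := Matrix.rank_mul_le_left _ _
      _ = (U * H).rank := by rw [h1]
      _ ≤ H.rank := Matrix.rank_mul_le_right _ _

/-- `rank H_X = rank H_Z = 12` for `S16`. [cite: LinPryadko2024, §IV.C Statement 8 (arXiv:2306.16400 chunk p0010 L58–63)] -/
theorem S16_rank : S16.HX.rank = 12 ∧ S16.HZ.rank = 12 :=
  ⟨rank_eq_of_cert' S16_HX_cert.1 S16_HX_cert.2.1 S16_HX_cert.2.2,
   rank_eq_of_cert' S16_HZ_cert.1 S16_HZ_cert.2.1 S16_HZ_cert.2.2⟩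

/-- `k(S16) = 32 − 12 − 12 = 8`. [cite: LinPryadko2024, §IV.C Statement 8 (arXiv:2306.16400 chunk p0010 L58–63)] -/
theorem S16_k : S16.k = 8 := by
  rw [CSSCode.k_eq, S16_rank.1, S16_rank.2, Fintype.card_sum, Fintype.card_fin]

/-- ★ **The `G_a1G_b`-subcode of `LP[a,b]` over `S₄` (§E–§F) encodes `k = 8` qubits on `32`**, and so does
the equivalent abelian code `LP[a′,b′]` over `ℤ₄×ℤ₂×ℤ₂`. [cite: LinPryadko2024, §IV.C Statement 8 (arXiv:2306.16400 chunk p0010 L58–63)] -/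
theorem statement8_instance_k [instDD : ∀ H K : Subgroup (Equiv.Perm (Fin 4)), DecidableEq (DoubleCoset.Quotient (H : Set (Equiv.Perm (Fin 4))) K)] :
    (dcSubcode aS_supp bS_supp (dcMk Ga Gb 1)).k = 8 ∧ (css aP bP).k = 8 := by
  have h1 := CSSCode.k_eq_of_submatrix S16_HX S16_HZ   -- S16.k = subcode.k
  have h2 := (statement8_instance_abelian (instDD := instDD)).1
  refine ⟨h1 ▸ S16_k, ?_⟩
  rw [← h2, ← h1, S16_k]

end SylowS4

/-! ### §I. The distance: `d_X = d_Z = 4`, so both codes are `[[32, 8, 4]]` (syndrome and witness certificates) -/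

namespace SylowS4

open Matrix

/-- a weight-4 `Z`-logical of `S16` (in `ker H_X`, not a `Z`-stabiliser) (certificate data). [cite: LinPryadko2024, §IV.C Statement 8 (arXiv:2306.16400 chunk p0010 L58–63)] -/
def vZ4 : Fin 16 ⊕ Fin 16 → ZMod 2 :=
  Sum.elim (![1, 0, 0, 1, 0, 1, 0, 0, 0, 0, 0, 0, 0, 0, 1, 0] : Fin 16 → ZMod 2) (![0, 0, 0, 0, 0, 0, 0, 0, 0, 0, 0, 0, 0, 0, 0, 0] : Fin 16 → ZMod 2)

/-- witness `X`-logical anticommuting with `vZ4` (`H_Z u = 0`, `u·vZ4 = 1`) (certificate data). [cite: LinPryadko2024, §IV.C Statement 8 (arXiv:2306.16400 chunk p0010 L58–63)] -/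
def uZw : Fin 16 ⊕ Fin 16 → ZMod 2 :=
  Sum.elim (![1, 0, 0, 0, 0, 0, 0, 0, 0, 0, 0, 1, 0, 1, 0, 1] : Fin 16 → ZMod 2) (![0, 0, 0, 0, 0, 0, 0, 0, 1, 1, 1, 1, 1, 1, 0, 0] : Fin 16 → ZMod 2)

/-- a weight-4 `X`-logical of `S16` (certificate data). [cite: LinPryadko2024, §IV.C Statement 8 (arXiv:2306.16400 chunk p0010 L58–63)] -/
def vX4 : Fin 16 ⊕ Fin 16 → ZMod 2 :=
  Sum.elim (![1, 1, 1, 1, 0, 0, 0, 0, 0, 0, 0, 0, 0, 0, 0, 0] : Fin 16 → ZMod 2) (![0, 0, 0, 0, 0, 0, 0, 0, 0, 0, 0, 0, 0, 0, 0, 0] : Fin 16 → ZMod 2)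

/-- witness `Z`-logical anticommuting with `vX4` (certificate data). [cite: LinPryadko2024, §IV.C Statement 8 (arXiv:2306.16400 chunk p0010 L58–63)] -/
def uXw : Fin 16 ⊕ Fin 16 → ZMod 2 :=
  Sum.elim (![1, 0, 0, 0, 0, 0, 0, 0, 0, 0, 0, 1, 0, 1, 0, 1] : Fin 16 → ZMod 2) (![0, 0, 0, 1, 0, 0, 0, 0, 0, 1, 0, 0, 0, 1, 1, 0] : Fin 16 → ZMod 2)

set_option maxRecDepth 100000 in
/-- certificate checks for the two weight-4 logicals. [folklore] -/
private theorem logical_certs :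
    S16.HX *ᵥ vZ4 = 0 ∧ S16.HZ *ᵥ uZw = 0 ∧ uZw ⬝ᵥ vZ4 ≠ 0 ∧ hammingNorm vZ4 = 4 ∧
    S16.HZ *ᵥ vX4 = 0 ∧ S16.HX *ᵥ uXw = 0 ∧ uXw ⬝ᵥ vX4 ≠ 0 ∧ hammingNorm vX4 = 4 := by
  refine ⟨?_, ?_, ?_, ?_, ?_, ?_, ?_, ?_⟩ <;> decide

set_option maxHeartbeats 4000000 in
set_option maxRecDepth 100000 in
/-- no single column of `S16.HX` vanishes (L). [folklore] -/
private theorem colX1_L : ∀ a : Fin 16, S16.HX.col (Sum.inl a) ≠ 0 := by decide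

set_option maxHeartbeats 4000000 in
set_option maxRecDepth 100000 in
/-- no single column of `S16.HX` vanishes (R). [folklore] -/
private theorem colX1_R : ∀ a : Fin 16, S16.HX.col (Sum.inr a) ≠ 0 := by decide

set_option maxHeartbeats 4000000 in
set_option maxRecDepth 100000 in
/-- no two distinct columns of `S16.HX` sum to zero (LL). [folklore] -/
private theorem colX2_LL : ∀ a b : Fin 16, a ≠ b → S16.HX.col (Sum.inl a) + S16.HX.col (Sum.inl b) ≠ 0 := by decide

set_option maxHeartbeats 4000000 in
set_option maxRecDepth 100000 in
/-- no two distinct columns of `S16.HX` sum to zero (LR). [folklore] -/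
private theorem colX2_LR : ∀ a b : Fin 16, S16.HX.col (Sum.inl a) + S16.HX.col (Sum.inr b) ≠ 0 := by decide

set_option maxHeartbeats 4000000 in
set_option maxRecDepth 100000 in
/-- no two distinct columns of `S16.HX` sum to zero (RL). [folklore] -/
private theorem colX2_RL : ∀ a b : Fin 16, S16.HX.col (Sum.inr a) + S16.HX.col (Sum.inl b) ≠ 0 := by decide

set_option maxHeartbeats 4000000 in
set_option maxRecDepth 100000 in
/-- no two distinct columns of `S16.HX` sum to zero (RR). [folklore] -/
private theorem colX2_RR : ∀ a b : Fin 16, a ≠ b → S16.HX.col (Sum.inr a) + S16.HX.col (Sum.inr b) ≠ 0 := by decide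

set_option maxHeartbeats 4000000 in
set_option maxRecDepth 100000 in
/-- no three columns of `S16.HX` sum to zero (LLL). [folklore] -/
private theorem colX3_LLL : ∀ a b c : Fin 16,
    S16.HX.col (Sum.inl a) + S16.HX.col (Sum.inl b) + S16.HX.col (Sum.inl c) ≠ 0 := by decide

set_option maxHeartbeats 4000000 in
set_option maxRecDepth 100000 in
/-- no three columns of `S16.HX` sum to zero (LLR). [folklore] -/
private theorem colX3_LLR : ∀ a b c : Fin 16,
    S16.HX.col (Sum.inl a) + S16.HX.col (Sum.inl b) + S16.HX.col (Sum.inr c) ≠ 0 := by decide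

set_option maxHeartbeats 4000000 in
set_option maxRecDepth 100000 in
/-- no three columns of `S16.HX` sum to zero (LRL). [folklore] -/
private theorem colX3_LRL : ∀ a b c : Fin 16,
    S16.HX.col (Sum.inl a) + S16.HX.col (Sum.inr b) + S16.HX.col (Sum.inl c) ≠ 0 := by decide

set_option maxHeartbeats 4000000 in
set_option maxRecDepth 100000 in
/-- no three columns of `S16.HX` sum to zero (LRR). [folklore] -/
private theorem colX3_LRR : ∀ a b c : Fin 16,
    S16.HX.col (Sum.inl a) + S16.HX.col (Sum.inr b) + S16.HX.col (Sum.inr c) ≠ 0 := by decide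

set_option maxHeartbeats 4000000 in
set_option maxRecDepth 100000 in
/-- no three columns of `S16.HX` sum to zero (RLL). [folklore] -/
private theorem colX3_RLL : ∀ a b c : Fin 16,
    S16.HX.col (Sum.inr a) + S16.HX.col (Sum.inl b) + S16.HX.col (Sum.inl c) ≠ 0 := by decide

set_option maxHeartbeats 4000000 in
set_option maxRecDepth 100000 in
/-- no three columns of `S16.HX` sum to zero (RLR). [folklore] -/
private theorem colX3_RLR : ∀ a b c : Fin 16,
    S16.HX.col (Sum.inr a) + S16.HX.col (Sum.inl b) + S16.HX.col (Sum.inr c) ≠ 0 := by decide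

set_option maxHeartbeats 4000000 in
set_option maxRecDepth 100000 in
/-- no three columns of `S16.HX` sum to zero (RRL). [folklore] -/
private theorem colX3_RRL : ∀ a b c : Fin 16,
    S16.HX.col (Sum.inr a) + S16.HX.col (Sum.inr b) + S16.HX.col (Sum.inl c) ≠ 0 := by decide

set_option maxHeartbeats 4000000 in
set_option maxRecDepth 100000 in
/-- no three columns of `S16.HX` sum to zero (RRR). [folklore] -/
private theorem colX3_RRR : ∀ a b c : Fin 16,
    S16.HX.col (Sum.inr a) + S16.HX.col (Sum.inr b) + S16.HX.col (Sum.inr c) ≠ 0 := by decide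

set_option maxHeartbeats 4000000 in
set_option maxRecDepth 100000 in
/-- no single column of `S16.HZ` vanishes (L). [folklore] -/
private theorem colZ1_L : ∀ a : Fin 16, S16.HZ.col (Sum.inl a) ≠ 0 := by decide

set_option maxHeartbeats 4000000 in
set_option maxRecDepth 100000 in
/-- no single column of `S16.HZ` vanishes (R). [folklore] -/
private theorem colZ1_R : ∀ a : Fin 16, S16.HZ.col (Sum.inr a) ≠ 0 := by decide

set_option maxHeartbeats 4000000 in
set_option maxRecDepth 100000 in
/-- no two distinct columns of `S16.HZ` sum to zero (LL). [folklore] -/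
private theorem colZ2_LL : ∀ a b : Fin 16, a ≠ b → S16.HZ.col (Sum.inl a) + S16.HZ.col (Sum.inl b) ≠ 0 := by decide

set_option maxHeartbeats 4000000 in
set_option maxRecDepth 100000 in
/-- no two distinct columns of `S16.HZ` sum to zero (LR). [folklore] -/
private theorem colZ2_LR : ∀ a b : Fin 16, S16.HZ.col (Sum.inl a) + S16.HZ.col (Sum.inr b) ≠ 0 := by decide

set_option maxHeartbeats 4000000 in
set_option maxRecDepth 100000 in
/-- no two distinct columns of `S16.HZ` sum to zero (RL). [folklore] -/
private theorem colZ2_RL : ∀ a b : Fin 16, S16.HZ.col (Sum.inr a) + S16.HZ.col (Sum.inl b) ≠ 0 := by decide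

set_option maxHeartbeats 4000000 in
set_option maxRecDepth 100000 in
/-- no two distinct columns of `S16.HZ` sum to zero (RR). [folklore] -/
private theorem colZ2_RR : ∀ a b : Fin 16, a ≠ b → S16.HZ.col (Sum.inr a) + S16.HZ.col (Sum.inr b) ≠ 0 := by decide

set_option maxHeartbeats 4000000 in
set_option maxRecDepth 100000 in
/-- no three columns of `S16.HZ` sum to zero (LLL). [folklore] -/
private theorem colZ3_LLL : ∀ a b c : Fin 16,
    S16.HZ.col (Sum.inl a) + S16.HZ.col (Sum.inl b) + S16.HZ.col (Sum.inl c) ≠ 0 := by decide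

set_option maxHeartbeats 4000000 in
set_option maxRecDepth 100000 in
/-- no three columns of `S16.HZ` sum to zero (LLR). [folklore] -/
private theorem colZ3_LLR : ∀ a b c : Fin 16,
    S16.HZ.col (Sum.inl a) + S16.HZ.col (Sum.inl b) + S16.HZ.col (Sum.inr c) ≠ 0 := by decide

set_option maxHeartbeats 4000000 in
set_option maxRecDepth 100000 in
/-- no three columns of `S16.HZ` sum to zero (LRL). [folklore] -/
private theorem colZ3_LRL : ∀ a b c : Fin 16,
    S16.HZ.col (Sum.inl a) + S16.HZ.col (Sum.inr b) + S16.HZ.col (Sum.inl c) ≠ 0 := by decide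

set_option maxHeartbeats 4000000 in
set_option maxRecDepth 100000 in
/-- no three columns of `S16.HZ` sum to zero (LRR). [folklore] -/
private theorem colZ3_LRR : ∀ a b c : Fin 16,
    S16.HZ.col (Sum.inl a) + S16.HZ.col (Sum.inr b) + S16.HZ.col (Sum.inr c) ≠ 0 := by decide

set_option maxHeartbeats 4000000 in
set_option maxRecDepth 100000 in
/-- no three columns of `S16.HZ` sum to zero (RLL). [folklore] -/
private theorem colZ3_RLL : ∀ a b c : Fin 16,
    S16.HZ.col (Sum.inr a) + S16.HZ.col (Sum.inl b) + S16.HZ.col (Sum.inl c) ≠ 0 := by decide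

set_option maxHeartbeats 4000000 in
set_option maxRecDepth 100000 in
/-- no three columns of `S16.HZ` sum to zero (RLR). [folklore] -/
private theorem colZ3_RLR : ∀ a b c : Fin 16,
    S16.HZ.col (Sum.inr a) + S16.HZ.col (Sum.inl b) + S16.HZ.col (Sum.inr c) ≠ 0 := by decide

set_option maxHeartbeats 4000000 in
set_option maxRecDepth 100000 in
/-- no three columns of `S16.HZ` sum to zero (RRL). [folklore] -/
private theorem colZ3_RRL : ∀ a b c : Fin 16,
    S16.HZ.col (Sum.inr a) + S16.HZ.col (Sum.inr b) + S16.HZ.col (Sum.inl c) ≠ 0 := by decide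

set_option maxHeartbeats 4000000 in
set_option maxRecDepth 100000 in
/-- no three columns of `S16.HZ` sum to zero (RRR). [folklore] -/
private theorem colZ3_RRR : ∀ a b c : Fin 16,
    S16.HZ.col (Sum.inr a) + S16.HZ.col (Sum.inr b) + S16.HZ.col (Sum.inr c) ≠ 0 := by decide

/-- a binary vector is the sum of the basis vectors of its support. [folklore] -/
private theorem eq_sum_single_support (v : Fin 16 ⊕ Fin 16 → ZMod 2) :
    v = ∑ q ∈ Finset.univ.filter (fun q => v q ≠ 0), (Pi.single q (1 : ZMod 2) : Fin 16 ⊕ Fin 16 → ZMod 2) := by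
  funext q
  rw [Finset.sum_apply, Finset.sum_pi_single]
  by_cases hq : v q = 0
  · simp [hq]
  · have h1 : v q = 1 := by
      have : ∀ x : ZMod 2, x ≠ 0 → x = 1 := by decide
      exact this _ hq
    simp [h1]

/-- **no nonzero vector of weight `≤ 3` has zero `H_X`-syndrome** (so every `Z`-logical has weight `≥ 4`).
[cite: LinPryadko2024, §IV.C Statement 8 (arXiv:2306.16400 chunk p0010 L58–63)] -/
theorem four_le_of_HX_mulVec_eq_zero (v : Fin 16 ⊕ Fin 16 → ZMod 2) (hv : S16.HX *ᵥ v = 0) (hne : v ≠ 0) :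
    4 ≤ hammingNorm v := by
  by_contra hlt
  push Not at hlt
  set s := Finset.univ.filter (fun q => v q ≠ 0) with hs
  have hcard : s.card = hammingNorm v := rfl
  have hv' := eq_sum_single_support v
  rw [← hs] at hv'
  have hpos : 0 < s.card := by
    rw [Finset.card_pos]
    by_contra hem
    rw [Finset.not_nonempty_iff_eq_empty] at hem
    apply hne
    rw [hv', hem, Finset.sum_empty]
  have hle : s.card ≤ 3 := by omega
  interval_cases h : s.card
  · obtain ⟨a, ha⟩ := Finset.card_eq_one.1 h
    rw [ha, Finset.sum_singleton] at hv'
    rw [hv', Matrix.mulVec_single_one] at hv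
    rcases a with a | a
    · exact colX1_L a hv
    · exact colX1_R a hv
  · obtain ⟨a, b, hab, hs2⟩ := Finset.card_eq_two.1 h
    rw [hs2, Finset.sum_pair hab] at hv'
    rw [hv', Matrix.mulVec_add, Matrix.mulVec_single_one, Matrix.mulVec_single_one] at hv
    rcases a with a | a <;> rcases b with b | b
    · exact colX2_LL a b (fun h => hab (congrArg Sum.inl h)) hv
    · exact colX2_LR a b hv
    · exact colX2_RL a b hv
    · exact colX2_RR a b (fun h => hab (congrArg Sum.inr h)) hv
  · obtain ⟨a, b, c, hab, hac, hbc, hs3⟩ := Finset.card_eq_three.1 h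
    rw [hs3, Finset.sum_insert (by simp [hab, hac]), Finset.sum_pair hbc] at hv'
    rw [hv', Matrix.mulVec_add, Matrix.mulVec_add, Matrix.mulVec_single_one, Matrix.mulVec_single_one,
      Matrix.mulVec_single_one, ← add_assoc] at hv
    rcases a with a | a <;> rcases b with b | b <;> rcases c with c | c
    · exact colX3_LLL a b c hv
    · exact colX3_LLR a b c hv
    · exact colX3_LRL a b c hv
    · exact colX3_LRR a b c hv
    · exact colX3_RLL a b c hv
    · exact colX3_RLR a b c hv
    · exact colX3_RRL a b c hv
    · exact colX3_RRR a b c hv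

/-- … and the same for `H_Z`-syndromes (every `X`-logical has weight `≥ 4`). [cite: LinPryadko2024, §IV.C Statement 8 (arXiv:2306.16400 chunk p0010 L58–63)] -/
theorem four_le_of_HZ_mulVec_eq_zero (v : Fin 16 ⊕ Fin 16 → ZMod 2) (hv : S16.HZ *ᵥ v = 0) (hne : v ≠ 0) :
    4 ≤ hammingNorm v := by
  by_contra hlt
  push Not at hlt
  set s := Finset.univ.filter (fun q => v q ≠ 0) with hs
  have hcard : s.card = hammingNorm v := rfl
  have hv' := eq_sum_single_support v
  rw [← hs] at hv'
  have hpos : 0 < s.card := by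
    rw [Finset.card_pos]
    by_contra hem
    rw [Finset.not_nonempty_iff_eq_empty] at hem
    apply hne
    rw [hv', hem, Finset.sum_empty]
  have hle : s.card ≤ 3 := by omega
  interval_cases h : s.card
  · obtain ⟨a, ha⟩ := Finset.card_eq_one.1 h
    rw [ha, Finset.sum_singleton] at hv'
    rw [hv', Matrix.mulVec_single_one] at hv
    rcases a with a | a
    · exact colZ1_L a hv
    · exact colZ1_R a hv
  · obtain ⟨a, b, hab, hs2⟩ := Finset.card_eq_two.1 h
    rw [hs2, Finset.sum_pair hab] at hv'
    rw [hv', Matrix.mulVec_add, Matrix.mulVec_single_one, Matrix.mulVec_single_one] at hv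
    rcases a with a | a <;> rcases b with b | b
    · exact colZ2_LL a b (fun h => hab (congrArg Sum.inl h)) hv
    · exact colZ2_LR a b hv
    · exact colZ2_RL a b hv
    · exact colZ2_RR a b (fun h => hab (congrArg Sum.inr h)) hv
  · obtain ⟨a, b, c, hab, hac, hbc, hs3⟩ := Finset.card_eq_three.1 h
    rw [hs3, Finset.sum_insert (by simp [hab, hac]), Finset.sum_pair hbc] at hv'
    rw [hv', Matrix.mulVec_add, Matrix.mulVec_add, Matrix.mulVec_single_one, Matrix.mulVec_single_one,
      Matrix.mulVec_single_one, ← add_assoc] at hv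
    rcases a with a | a <;> rcases b with b | b <;> rcases c with c | c
    · exact colZ3_LLL a b c hv
    · exact colZ3_LLR a b c hv
    · exact colZ3_LRL a b c hv
    · exact colZ3_LRR a b c hv
    · exact colZ3_RLL a b c hv
    · exact colZ3_RLR a b c hv
    · exact colZ3_RRL a b c hv
    · exact colZ3_RRR a b c hv

/-- `d_Z(S16) = 4`. [cite: LinPryadko2024, §IV.C Statement 8 (arXiv:2306.16400 chunk p0010 L58–63)] -/
theorem S16_dZ : S16.dZ = 4 := by
  obtain ⟨h1, h2, h3, h4, -, -, -, -⟩ := logical_certs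
  refine S16.dZ_eq_of_witness h1 (not_mem_rowSpace_of_witness uZw h2 h3) h4 fun w hw hw' => ?_
  exact four_le_of_HX_mulVec_eq_zero w hw fun h0 => hw' (h0 ▸ Submodule.zero_mem _)

/-- `d_X(S16) = 4`. [cite: LinPryadko2024, §IV.C Statement 8 (arXiv:2306.16400 chunk p0010 L58–63)] -/
theorem S16_dX : S16.dX = 4 := by
  obtain ⟨-, -, -, -, h1, h2, h3, h4⟩ := logical_certs
  refine S16.dX_eq_of_witness h1 (not_mem_rowSpace_of_witness uXw h2 h3) h4 fun w hw hw' => ?_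
  exact four_le_of_HZ_mulVec_eq_zero w hw fun h0 => hw' (h0 ▸ Submodule.zero_mem _)

/-- `S16` is a `[[32, 8, 4]]` code. [cite: LinPryadko2024, §IV.C Statement 8 (arXiv:2306.16400 chunk p0010 L58–63)] -/
theorem S16_isCode : S16.IsCode 32 8 4 := by
  have hk : 0 < S16.k := by rw [S16_k]; norm_num
  have h := S16.isCode_of_dX_dZ hk S16_dX S16_dZ
  rwa [S16_k, Fintype.card_sum, Fintype.card_fin] at h

/-- ★★ **`[[32, 8, 4]]` twice**: the `G_a1G_b`-subcode of `LP[a,b]` over `S₄` (two Sylow `D₈`'s, no amalgam)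
and the abelian two-block code `LP[a′,b′]` over `ℤ₄×ℤ₂×ℤ₂` it is equivalent to are both `[[32,8,4]]` codes
(census predicate `CSSCode.IsCode`). [cite: LinPryadko2024, §IV.C Statement 8 (arXiv:2306.16400 chunk p0010 L58–63)] -/
theorem statement8_instance_isCode
    [instDD : ∀ H K : Subgroup (Equiv.Perm (Fin 4)), DecidableEq (DoubleCoset.Quotient (H : Set (Equiv.Perm (Fin 4))) K)] :
    (dcSubcode aS_supp bS_supp (dcMk Ga Gb 1)).IsCode 32 8 4 ∧ (css aP bP).IsCode 32 8 4 := by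
  refine ⟨(CSSCode.isCode_iff_of_submatrix S16_HX S16_HZ 32 8 4).1 S16_isCode, ?_⟩
  -- `C16` has the parameters of `S16` (same row spaces), and `css aP bP` those of `C16` (reindexing)
  obtain ⟨hk, hx, hz⟩ := CSSCode.params_eq_of_rowSpace_eq S16 C16 rowSpace_S16_eq_C16.1 rowSpace_S16_eq_C16.2
  have hk16 : 0 < C16.k := by rw [← hk, S16_k]; norm_num
  have h16 : C16.IsCode 32 8 4 := by
    have h := C16.isCode_of_dX_dZ hk16 (hx ▸ S16_dX) (hz ▸ S16_dZ)
    rwa [← hk, S16_k, Fintype.card_sum, Fintype.card_fin] at h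
  exact (CSSCode.isCode_iff_of_submatrix C16_HX C16_HZ 32 8 4).1 h16

end SylowS4

end TwoBlockGA

end Literature.InformationTheory.QuantumCodes
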